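import Literature.MathematicalPhysics.QuantumFieldTheory.BalabanImbrieJaffe1984to88.BIJ88Close231RegularRegionCwt
import Literature.MathematicalPhysics.QuantumFieldTheory.BalabanImbrieJaffe1984to88.BIJ88LocDerivHolder230RegularTorus

/-!
# `BalabanImbrieJaffe1984to88.BIJ88LocDerivHolder231RegularRegion` — T. Bałaban, J. Imbrie, A. Jaffe, *Effective action and cluster properties
of the abelian Higgs model*, Commun. Math. Phys. **114** (1988) 257–315 [BalabanImbrieJaffe1988], Sect. 2 p. 263 [PDF 7], (2.27)–(2.29), (2.31)
and the sentence after (2.31): **THE HÖLDER MEMBER OF ORDER `1 + θ` OF (2.31) FOR A GENERAL REGION `Ω ⊂ T_η` AT A NON-FLAT BACKGROUND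
`u = e^{ieεA}` WITH `A` (2.23)-REGULAR ON `Ω` ONLY, FOR THE PRINTED LOCALIZATION DATA WITH BIG-BLOCK CUBES AND A SMOOTH CUT-OFF** — print:
*"Bounds analogous to (2.30), (2.31) hold for covariant derivatives and Hölder derivatives of G_{k,loc}(u) of order less than two … for (2.31) we
assume smoothness throughout the subset Ω ⊂ T_η"*.  r18 gen 25's `BIJ88LocDerivHolder231RegularTorus` is the case `Ω = T_η` with `A` regular on
the whole torus; here `Ω` is ANY union of big blocks (side `L^kL^s`) containing the big-block hull of the reference box `Ω₀`, and the regularity of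
`A` is assumed on `Ω` alone — with r18 gen 25's `BIJ88Close231RegularRegionCwt` (value, kernel and order-1 members for the region) this puts EVERY
member of the p. 263 sentence *"of order less than two"* for (2.31) in the tree for a general region at the (2.23)-regular background.

statement-level skeleton of published theorems with citation tags; proofs where landed; nothing here is a claim about the Yang–Mills mass gap

PDF held: `paper:balaban1988-cmp114-bij-abelian-higgs-effective-action` (journal page = PDF page + 256); p. 263 [PDF 7] re-read this session on the
materialised text layer; [6] = [Balaban1983RegularityDecay] Theorem p. 573 (1.9)–(1.12) through r01's `BIJ85NeumannPropagatorRegularHolder`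
(`holder_covD_gBox_sub_gBox_le` — the Hölder member of the `δG` clause for big-block unions `B ⊆ Ω₀` with `A` regular on `Ω₀` —,
`input19_holder_regular_deep`), `BIJ85NeumannPropagatorRegularDeriv` (`input110_deriv_regular_deep`, `input112_deriv_regular_deep`) and
`BIJ85NeumannPropagatorRegularClose` (through r18's `inputs_regular_region`) — all stated for regions with the regularity of `A` assumed on the
region only.

v1.1 (r18 gen 29, literature-prover-lit-balaban-r18-g29-0, 2026-08-23; DOC-ONLY — every declaration byte-identical with v1.0 p357888 ✓ f79340256afd):
the p. 263 quotation block below restored to the printed wording and order; the non-printed gloss «As in [6, 7] we need control over u …» taken out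
of the quotation marks (referee ref-5 D-g77-2, the residual instance of the pseudo-quote class p27 removed from its three files in p368776/p368781/p368784).

CITATION HEADER (lean-in-tree rule).  lit-balaban cell (HOME `run/shared/lean/pub/lit-balaban/`), Phase 2, seat r18 gen 25 (unit `lit-balaban-r18`,
literature-prover-lit-balaban-r18-g25-0; C2 §§1–4 fold owner), free-target protocol G.5-34(d), TAKING #4 line HOME/STATUS.md (cc p29 g30 — the
order-`θ ≤ 1` Hölder members and the small-`u` lane are his; this file is the order-(1+θ) member AT THE REGULAR BACKGROUND for a general region,
DISJOINT — and r01, p31).  Rows of `HOME/lit-balaban-r18/ROWS-C2.md` served (LOCATED MEMBERS, cells only; heads unchanged): **C2.Claim@263**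
*"Bounds analogous to (2.30), (2.31) … of order less than two"* and **C2.Eq2.31** (head p02's `BIJ88OpClose231Proof`).  Kind: theorems only (no
definition, no `Prop`-valued fact).  Files USED BY NAME, nothing restated: r18 g25 `BIJ88Close231RegularRegionCwt` (**`inputs_regular_region`**,
**`cubeFamB_subset_of_hull_subset`**, **`mem_deepRows_of_depth`**, **`deriv231_regular_region_of_lipschitz`**), r18 g25
`BIJ88LocDerivHolder230RegularTorus` (**`norm_holA_mul_sub_le`** — the telescoping of a transported difference along a contour at a unitary
background —, `T_le_length_of_isSChain`, `bondSum_shift`/`bondSum_unshift`, the `ζ^Π` smoothness facts `exists_abs_deriv_and_deriv_deriv_smoothTransition_le`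
… via p29/r18), r01 g26+ `BIJ85NeumannPropagatorRegularHolder` (**`holder_covD_gBox_sub_gBox_le`**, **`input19_holder_regular_deep`**, `holA`,
`IsSChain`, `bondSum`, `norm_holA`), `BIJ85NeumannPropagatorRegularDeriv` (**`input110_deriv_regular_deep`**, **`input112_deriv_regular_deep`**),
r18 g24 `BIJ88Close231RegularTorusCwt` (`bbHull`, `subset_bbHull`, `bbHull_bigBlock`, `cubeFamB`, `deepRows`, `mem_deepRows`, `rowMargin`,
`rowHyp_ii_hull`), p29 g26 `BIJ88LocWeights227Torus` (`labels`, `lamFam`, `activeLabels`, `rowHyp_i`, `rowHyp_iii`, `mem_activeLabels_of_ne_zero_of_deep`,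
`card_subtype_activeLabels_le`, `mem_and_abs_sub_le_of_T_le`, `sum_abs_lamT_le_one`, …), p29 g28 `BIJ88LocDerivHolder230FlatTorus`
(`abs_weight_shift_sub_le_of_hull`, `abs_weight_bondDiff_sub_le_of_hull`), p29 g27 `BIJ88LocDeriv231FlatTorus` (`covD_gLocT_sub_apply`),
`BIJ88LocDeriv230FlatTorus` (`T_shift_le_one`, `abs_T_shift_sub_le`), `BIJ88LocDeriv230ZetaPiFlatTorus` (`norm_rowSource_sub_le_of_lipschitz`, the
`ζ^Π` facts), p31 (`gBox`, `gLocT`, `cubeT`, `boxCoord`, `norm_rowSource_le`, `rowSource_ne_zero`, `abs_lam_le_one`), p38's metric `B5Ineq137Torus.T`,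
r18's `BIJ88Sect3Statements.covD`/`cfg`.  PRIVATE COPIES (statements of record in r18 g25's `BIJ88LocDerivHolder231RegularTorus` §1/§4, copied so
that this file does not import the 2165-line `Ω = T_η` file, whose §5 it generalizes): the four tail kernels `norm_tail_le'`, `norm_tailDiff_le'`,
`T_gt_of_tail_ne_zero'`, `T_gt_of_tailDiff_ne_zero'` and the two hull-Lipschitz kernels `abs_zeta_shift_sub_le_of_hull`, `abs_zeta_bondDiff_sub_le_of_hull`.

THE PRINTED TEXT (verbatim, p. 263, in the printed order; text layer `p0007.txt` L16–26 re-read gen 29).  *"|(G_{k,loc}(u)f − G_k(Ω,u)f)(x)| ≦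
e^{−cr(e_k)}e^{−c dist(suppt f,x)}‖f‖_∞, (2.31) for dist(x, Ω^c) ≧ O(r(e_k)). [Each G_k(□_α, u) is close to G_k(Ω, u) for the relevant x₁, x₂,
therefore the convex combination and G_{k,loc} are close also.] We assume that u is smooth in the □_α's entering the sum in (2.27); for (2.31) we
assume smoothness throughout the subset Ω ⊂ T_η. This means that in a neighborhood of each □_α there exists an A, λ such that u =
exp[ie_kη(A + ∂λ)] with |∂A|, |∂*A| ≦ O(p(e_k)). (2.32) … Bounds analogous to (2.30), (2.31) hold for covariant derivatives and Holder [sic]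
derivatives of G_{k,loc}(u) of order less than two."*  [v1.1 note, referee ref-5 D-g77-2: v1.0 of this header carried, INSIDE the quotation marks
and out of the printed order, the gloss «As in [6, 7] we need control over u in order to obtain these estimates» — that sentence is NOT printed
on p. 263 (it is our paraphrase of [BalabanImbrieJaffe1985] p. 326, *"The propagators arising from Δ_k(u_k), under the restriction (7.3.1) on the
gauge field, also satisfy the regularity and decay estimates of [7]"*); removed from the quotation here, content and declarations unchanged.]
*"Smooth"* `u` ON `Ω` is taken in the (2.23)-regular form of [BalabanImbrieJaffe1985] p. 326 / [6]: `u = e^{ieεA}` with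
`L^kε|e|/e_k·|∂A|(z) ≦ c·e_k^{β−1}/L^k` FOR `z ∈ Ω`, `0 < e_k ≦ e₁`.

WHAT IS PROVED (theorems only; 0 `sorry`; standard axioms).
* §2 **`input112_holder_regular_region`** — r01's `holder_covD_gBox_sub_gBox_le` (the Hölder member `1 + α` of [6] (1.11)–(1.12) for
  `G_k(B,u)f − G_k(Ω,u)f`, `B ⊆ Ω` big-block unions, `A` regular on `Ω`) read in the tree's sup-torus metric `T` and level-`k` units
  (`(L^k/|x₁−x₂|_T)^α·‖U(A(Γ))D_u(·)(⟨x₂,μ⟩) − D_u(·)(⟨x₁,μ⟩)‖ ≤ (L^kε)·c₀·e^{−δ₀D/L^k}·e^{−δ₀(D_b+D_f)/L^k}·F`, `δ₀ = 1/(8L^s)`).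
* §4 **`derivHolder231_regular_region_of_smooth`** — for `0 ≤ θ < 1` and moduli `K₁, K₂ ≥ 0`: `∃ s₀ ∀ s ≥ s₀ ∃ c₀ e₁ > 0` (from
  `(d, L, a, e, c, β, θ, K₁, K₂, s)` only) such that on every torus of the series (`P.d = d+1`, `P.L = L ≥ 2`), at every level `1 ≤ k ≤ K` with
  `k + s ≤ m + K`, `3L^kL^s ≤ |T^{(0)}|`, for EVERY union `Ω` of big blocks, every `A` (2.23)-regular ON `Ω` (`0 < e_k ≤ e₁`), `u = e^{ieεA}`, every
  reference no-wrap box `Ω₀` shorter than the torus with torus gap `≥ R` and `bbHull (L^kL^s) Ω₀ ⊆ Ω`, `s_g ≥ 1`, `W ≥ 2s_g/3 + R₀/2 + R`,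
  `R > rowMargin + (d+2)L^k + 1`, `0 ≤ R₁ < R₀`, EVERY real cut-off `ζ″` with `|ζ″| ≤ 1`, `= 0` beyond `R₀`, `= 1` within `R₁`, first differences
  `≤ K₁/(R₀−R₁)`, mixed second differences `≤ K₂/(R₀−R₁)²`, every direction `μ`, all bonds `⟨x₁,x₁+e_μ⟩`, `⟨x₂,x₂+e_μ⟩` with their four end
  points in `Ω₀` at chart depth `≥ R₀ + R`, every nearest-neighbour contour `Γ = (x₁, l)` ending at `x₂` with `|Γ| ≤ (d+1)|x₁ − x₂|_T`, every `f`
  with `‖f‖_∞ ≤ F` supported at sup-torus distance `≥ D ≥ 0` from `x₁` and from `x₂`, WITH `ψ = G_{k,loc}(u)f − G_k(Ω,u)f`: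
  `(L^k/|x₁−x₂|_T)^θ · ‖U(A(Γ))·(D_uψ)(⟨x₂,μ⟩) − (D_uψ)(⟨x₁,μ⟩)‖ ≤`
  `(L^kε)·c₀·(1 + L^k((R₀−R₁)⁻¹ + s_g⁻¹))²·[m·e^{−δ₀(2R−1)/L^k} + e^{−(δ₀/2)(R₁−1)/L^k}]·e^{−(δ₀/2)D/L^k}·F`, `δ₀ = 1/(8L^s)`,
  `m = (⌊(L^k−1+R₀)/s_g⌋+3)^{d+1}`.  MECHANISM: gen 25's eight-term split VERBATIM with `T^{(0)} ↦ Ω` — cube part (A) §2 per hull active at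
  `x₂ + e_μ` (`□̃_α ⊆ Ω` by `cubeFamB_subset_of_hull_subset`); (B) r01's `input112_deriv_regular_deep`; (C) the transported difference telescoped
  ALONG `Γ` (`norm_holA_mul_sub_le`) with (B)'s input per bond; (D) the value member of `inputs_regular_region`; tail part (A″) r01's
  `input19_holder_regular_deep` ON `Ω` at the rows `x₁, x₂`; (B″), (C″) r01's `input110_deriv_regular_deep` ON `Ω` at `x₁` and at EVERY CONTOUR
  SITE; (D″) the value member of `G_k(Ω,u)` at `x₁`; far pairs: two order-1 members (`deriv231_regular_region_of_lipschitz`).  The one new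
  geometric point: every contour site `z` (within `(d+1)|x₁−x₂|_T ≤ (d+1)L^k` of `x₁` for near pairs) is a `rowMargin`-deep row of `Ω`
  (`mem_and_abs_sub_le_of_T_le` from the chart depth `R₀ + R > rowMargin + (d+2)L^k + 1` of `x₁`, then `mem_deepRows_of_depth`).
* §5 **`derivHolder231_regular_region_zetaPi`** — the same at r18's smooth cut-off `ζ^Π = zetaPi R₁ R₀ 0` (`1 ≤ R₁ < R₀ ≤ (|T|−3)/2`; moduli
  `K₁ = C_σ`, `K₂ = C_σ² + C_σ` from `exists_abs_deriv_and_deriv_deriv_smoothTransition_le`), hypothesis-free in `ζ`;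
  `deriv231_regular_region_zetaPi` — the order-1 member of `BIJ88Close231RegularRegionCwt` at `ζ^Π`.
HONEST SCOPE / DIVERGENCE.  (i) `Ω` a union of big blocks of side `L^kL^s` CONTAINING `bbHull (L^kL^s) Ω₀` (print's *"dist(x, Ω^c) ≧ O(r(e_k))"*
read through the reference chart box `Ω₀` of p29/p31's torus data, as in `BIJ88Close231RegularRegionCwt`); `u = e^{ieεA}` exactly with `A` regular
on `Ω` (no change of gauge).  (ii) Near pairs along a contour of length `≤ (d+1)|x₁−x₂|_T` (p30's staircase qualifies); deep bonds only; the cubes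
are the big-block hulls; constants existential (r01's thresholds), `δ₀ = 1/(8L^s)` explicit; the prefactor `(1 + L^k((R₀−R₁)⁻¹+s_g⁻¹))²` is the
honest cost of two lattice derivatives of the weights.  (iii) Not here: the order-(1+θ) member at SMALL (non-regular) `u` (p29's lane; inputs p30
g28 `close112_smallField_deriv_of_inputs`, p27 g37 `…SmallFieldCloseHolder`), the order-`θ ≤ 1` member for a region (p29's
`holder231_*` pattern), (2.30)'s members (no `Ω`).  Imports: r18 g25 `BIJ88Close231RegularRegionCwt`, `BIJ88LocDerivHolder230RegularTorus`.
Literature + Mathlib only.  Unit `lit-balaban-r18` (literature-prover-lit-balaban-r18-g25-0), 2026-08-23.  NOT summit progress.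
-/

open scoped BigOperators Matrix ComplexConjugate
open Finset Matrix

namespace Literature.MathematicalPhysics.QuantumFieldTheory.BalabanImbrieJaffe1984to88.BIJ88LocDerivHolder231RegularRegion

open Literature.MathematicalPhysics.QuantumFieldTheory.Balaban1983to89
open BIJ88Sect3Statements (U1 toC cfg covD norm_toC)
open BIJ85BlockAveragesTorus BIJ85BlockAveragesTorusK
open BIJ88NeumannPropagator227Torus (gBox)
open BIJ88DeltaLoc234Torus (gLocT)
open BIJ88NeumannPropagatorFlatDecayCube
open BIJ88LocWeights227Torus
open BIJ85CovariantHiggsDictionary (expGauge toC_expGauge)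
open BIJ85NeumannPropagatorRegularHolder (SNbr IsSChain bondSum holA holA_nil holA_cons norm_holA input19_holder_regular_deep
  holder_covD_gBox_sub_gBox_le)
open BIJ88LocDeriv230FlatTorus (T_shift_le_one abs_T_shift_sub_le)
open B4GaugeCovariance (pathEnd)
open BIJ88Close231RegularTorusCwt (bbHull subset_bbHull bbHull_bigBlock cubeFamB deepRows mem_deepRows rowMargin rowHyp_ii_hull)
open BIJ88Close231RegularRegionCwt (inputs_regular_region cubeFamB_subset_of_hull_subset mem_deepRows_of_depth
  deriv231_regular_region_of_lipschitz)

noncomputable section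

variable {d : ℕ} {P : Params}

/-! ## §1 Kernel (private copies of r18 gen 25's `BIJ88LocDerivHolder231RegularTorus` §1 — statements of record there): the (2.29) tails for a generic cut-off (`|ζ″| ≤ 1`, `ζ″ = 1` within `R₁`, one-step modulus in the output point) -/

section Tails

/-- kernel: **the tail source** `((ζ″(x′,y) − 1)f(y)` is bounded by `2‖f‖_∞` when `|ζ″| ≤ 1`. [cite: BalabanImbrieJaffe1988, (2.29) p.263] -/
private theorem norm_tail_le' {ζ : Balaban1983to89.Site P 0 → Balaban1983to89.Site P 0 → ℝ} (hζabs : ∀ x y, |ζ x y| ≤ 1)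
    (x : Balaban1983to89.Site P 0) {f : Balaban1983to89.Site P 0 → ℂ} {F : ℝ} (hF : ∀ y, ‖f y‖ ≤ F) (y : Balaban1983to89.Site P 0) :
    ‖((ζ x y : ℂ) - 1) * f y‖ ≤ 2 * F := by
  have hF0 : 0 ≤ F := (norm_nonneg _).trans (hF y)
  have hz1 : ‖(ζ x y : ℂ) - 1‖ ≤ 2 := by
    rw [← Complex.ofReal_one, ← Complex.ofReal_sub, Complex.norm_real, Real.norm_eq_abs, abs_le]
    have h := abs_le.1 (hζabs x y)
    constructor <;> linarith [h.1, h.2]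
  calc ‖((ζ x y : ℂ) - 1) * f y‖ = ‖(ζ x y : ℂ) - 1‖ * ‖f y‖ := norm_mul _ _
    _ ≤ 2 * F := mul_le_mul hz1 (hF y) (norm_nonneg _) (by norm_num)

/-- kernel: **the tail-difference source** `(ζ″(x+e_μ,y) − ζ″(x,y))f(y)` is bounded by the one-step modulus times `‖f‖_∞`.
[cite: BalabanImbrieJaffe1988, (2.29) p.263] -/
private theorem norm_tailDiff_le' {ζ : Balaban1983to89.Site P 0 → Balaban1983to89.Site P 0 → ℝ} {Kζ : ℝ} (hKζ : 0 ≤ Kζ)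
    {x : Balaban1983to89.Site P 0} {μ : Fin P.d} (hζlip : ∀ y, |ζ (x.shift μ) y - ζ x y| ≤ Kζ)
    {f : Balaban1983to89.Site P 0 → ℂ} {F : ℝ} (hF : ∀ y, ‖f y‖ ≤ F) (y : Balaban1983to89.Site P 0) :
    ‖((ζ (x.shift μ) y : ℂ) - (ζ x y : ℂ)) * f y‖ ≤ Kζ * F := by
  have hz : ‖(ζ (x.shift μ) y : ℂ) - (ζ x y : ℂ)‖ ≤ Kζ := by
    rw [← Complex.ofReal_sub, Complex.norm_real, Real.norm_eq_abs]; exact hζlip y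
  calc ‖((ζ (x.shift μ) y : ℂ) - (ζ x y : ℂ)) * f y‖ = ‖(ζ (x.shift μ) y : ℂ) - (ζ x y : ℂ)‖ * ‖f y‖ := norm_mul _ _
    _ ≤ Kζ * F := mul_le_mul hz (hF y) (norm_nonneg _) hKζ

/-- kernel: **where the tail source of the bond `⟨x, x+e_μ⟩` does not vanish, `f ≠ 0` and `|x − y|_T > R₁ − 1`** (`ζ″ = 1` within `R₁`, one
lattice step). [cite: BalabanImbrieJaffe1988, (2.29) p.263] -/
private theorem T_gt_of_tail_ne_zero' {ζ : Balaban1983to89.Site P 0 → Balaban1983to89.Site P 0 → ℝ} {R₁ : ℝ}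
    (hζR₁ : ∀ x y, B5Ineq137Torus.T P 0 x y ≤ R₁ → ζ x y = 1) (x : Balaban1983to89.Site P 0) (μ : Fin P.d)
    {f : Balaban1983to89.Site P 0 → ℂ} {y : Balaban1983to89.Site P 0} (hne : ((ζ (x.shift μ) y : ℂ) - 1) * f y ≠ 0) :
    f y ≠ 0 ∧ R₁ - 1 < B5Ineq137Torus.T P 0 x y := by
  refine ⟨right_ne_zero_of_mul hne, ?_⟩
  have hz : ζ (x.shift μ) y ≠ 1 := by
    intro h1; exact hne (by rw [h1]; push_cast; ring)
  have hgt : R₁ < B5Ineq137Torus.T P 0 (x.shift μ) y := lt_of_not_ge fun hle => hz (hζR₁ (x.shift μ) y hle)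
  have h1 := abs_le.1 (abs_T_shift_sub_le x y μ)
  linarith

/-- kernel: **where the tail-difference source does not vanish, `f ≠ 0` and `|x − y|_T > R₁ − 1`**. [cite: BalabanImbrieJaffe1988, (2.29) p.263] -/
private theorem T_gt_of_tailDiff_ne_zero' {ζ : Balaban1983to89.Site P 0 → Balaban1983to89.Site P 0 → ℝ} {R₁ : ℝ}
    (hζR₁ : ∀ x y, B5Ineq137Torus.T P 0 x y ≤ R₁ → ζ x y = 1) (x : Balaban1983to89.Site P 0) (μ : Fin P.d)
    {f : Balaban1983to89.Site P 0 → ℂ} {y : Balaban1983to89.Site P 0}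
    (hne : ((ζ (x.shift μ) y : ℂ) - (ζ x y : ℂ)) * f y ≠ 0) :
    f y ≠ 0 ∧ R₁ - 1 < B5Ineq137Torus.T P 0 x y := by
  refine ⟨right_ne_zero_of_mul hne, ?_⟩
  by_contra hle
  push Not at hle
  have h1 := abs_le.1 (abs_T_shift_sub_le x y μ)
  have hx : ζ x y = 1 := hζR₁ x y (by linarith)
  have hx' : ζ (x.shift μ) y = 1 := hζR₁ (x.shift μ) y (by linarith)
  exact hne (by rw [hx, hx']; push_cast; ring)

end Tails

/-! ## §2 The Hölder member of the `δG` clause (1.11)–(1.12) at a `u` regular on a region `Ω₀`, `B ⊆ Ω₀` big-block unions, in the level-`k` input shape -/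

section HolderInput

/-- kernel: the units identity `e^{−E/(cL^sL^k)} = e^{−(1/(cL^s))·((L^k)⁻¹E)}`. [folklore] -/
private theorem exp_units (c Ls Lk E : ℝ) (hc : c ≠ 0) (hLs : Ls ≠ 0) (hLk : Lk ≠ 0) :
    Real.exp (-(E / (c * Ls * Lk))) = Real.exp (-(1 / (c * Ls) * (Lk⁻¹ * E))) := by
  congr 1
  field_simp

/-- **THE (1.11)–(1.12) HÖLDER INPUT SHAPE AT A `u = e^{ieεA}` REGULAR ON A BIG-BLOCK REGION `Ω`, `X ⊆ Ω`** (r01's `holder_covD_gBox_sub_gBox_le` =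
[7] Theorem p. 573, the Hölder member *"with the additional factor (1.12)"*, read in p38's metric `T` and level-`k` units exactly as r01's §5
reads (1.9)): `∃ s₀, ∀ α ∈ [0,1), ∀ s ≥ s₀, ∃ c₀ e₁ > 0`: on every `Setup` torus, `1 ≤ k ≤ K`, `k + s ≤ m + K`, `3L^kL^s ≤ |T^{(0)}|`, for every
big-block unions `X ⊆ Ω`, `A` regular on `Ω` (`0 < e_k ≤ e₁`), rows `x₁ ≠ x₂` both `R₀′`-deep in `X`, a nearest-neighbour contour `Γ` from `x₁`
to `x₂` of length `≤ d·T(x₁,x₂)`, `f` with `‖f‖ ≤ F` supported in `X` at distance `≥ D` from both rows, `T∖X` at distance `≥ D_b` from both rows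
and `≥ D_f` from `supp f`:
`(L^k/T(x₁,x₂))^α·‖U(A(Γ))·D_u((G_k(X,u) − G_k(Ω,u))f)(x₂,μ) − D_u((G_k(X,u) − G_k(Ω,u))f)(x₁,μ)‖ ≤ s_k·c₀·e^{−δ₀(L^k)⁻¹D}·e^{−δ₀(L^k)⁻¹(D_b+D_f)}·F`,
`δ₀ = 1/(8L^s)`. [cite: Balaban1983RegularityDecay, Theorem p.573 (1.9), (1.11)–(1.12)]
[cite: BalabanImbrieJaffe1985, p.326 «also satisfy the regularity and decay estimates of [7]»] -/
theorem input112_holder_regular_region (d L : ℕ) (hd : 1 ≤ d) (hL : 2 ≤ L) {a : ℝ} (ha : 0 < a) (e creg β : ℝ) (hcreg : 0 ≤ creg)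
    (hβ : 0 < β) :
    ∃ s₀ : ℕ, ∀ {α : ℝ}, 0 ≤ α → α < 1 → ∀ s : ℕ, s₀ ≤ s → ∃ c₀ e₁ : ℝ, 0 < c₀ ∧ 0 < e₁ ∧
      ∀ (P : Params), P.d = d → P.L = L → ∀ {k : ℕ}, 1 ≤ k → k ≤ P.K → k + s ≤ P.m + P.K →
      3 * (L ^ k * L ^ s) ≤ P.sitesPerDir 0 →
      ∀ (X Ω : Finset (Balaban1983to89.Site P 0)),
        (∀ z z' : Balaban1983to89.Site P 0,
          (∀ μ, (z μ).val / (L ^ k * L ^ s) = (z' μ).val / (L ^ k * L ^ s)) → (z ∈ X ↔ z' ∈ X)) →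
        (∀ z z' : Balaban1983to89.Site P 0,
          (∀ μ, (z μ).val / (L ^ k * L ^ s) = (z' μ).val / (L ^ k * L ^ s)) → (z ∈ Ω ↔ z' ∈ Ω)) →
        X ⊆ Ω →
      ∀ (A : PBond P 0 → ℝ) {ec : ℝ}, 0 < ec → ec ≤ e₁ →
      (∀ z ∈ Ω, ∀ (μ ν : Fin P.d),
          P.spacing k * |e| / ec * |A ⟨z.shift μ, ν⟩ - A ⟨z, ν⟩| ≤ creg * ec ^ (β - 1) / (L : ℝ) ^ k) →
      ∀ (μ : Fin P.d) (x₁ x₂ : Balaban1983to89.Site P 0), x₂ ≠ x₁ →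
        (∀ y, B5Ineq137Torus.T P 0 x₁ y
          ≤ (2 * (5 * (L ^ k * L ^ s) / 8 + L ^ k) + 2 * (L ^ k * L ^ s) * (d + 1) + 1 : ℕ) → y ∈ X) →
        (∀ y, B5Ineq137Torus.T P 0 x₂ y
          ≤ (2 * (5 * (L ^ k * L ^ s) / 8 + L ^ k) + 2 * (L ^ k * L ^ s) * (d + 1) + 1 : ℕ) → y ∈ X) →
      ∀ (l : List (Balaban1983to89.Site P 0)), IsSChain x₁ l → pathEnd x₁ l = x₂ →
        (l.length : ℝ) ≤ (d : ℝ) * B5Ineq137Torus.T P 0 x₁ x₂ →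
      ∀ (f : Balaban1983to89.Site P 0 → ℂ) (F D Db Df : ℝ), (∀ y, ‖f y‖ ≤ F) → (∀ y, y ∉ X → f y = 0) →
        (∀ y, f y ≠ 0 → D ≤ B5Ineq137Torus.T P 0 x₁ y) → (∀ y, f y ≠ 0 → D ≤ B5Ineq137Torus.T P 0 x₂ y) →
        (∀ w, w ∉ X → Db ≤ B5Ineq137Torus.T P 0 x₁ w) → (∀ w, w ∉ X → Db ≤ B5Ineq137Torus.T P 0 x₂ w) →
        (∀ y, f y ≠ 0 → ∀ w, w ∉ X → Df ≤ B5Ineq137Torus.T P 0 y w) →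
        ((P.L : ℝ) ^ k / B5Ineq137Torus.T P 0 x₁ x₂) ^ α *
            ‖holA e A x₁ l * covD P.eps⁻¹ (cfg (expGauge P e A))
                (gBox (B1RG242Torus.α P a k * (P.L : ℝ) ^ (k * P.d)) P.eps⁻¹ (expGauge P e A) k X *ᵥ f -
                  gBox (B1RG242Torus.α P a k * (P.L : ℝ) ^ (k * P.d)) P.eps⁻¹ (expGauge P e A) k Ω *ᵥ f) ⟨x₂, μ⟩
              - covD P.eps⁻¹ (cfg (expGauge P e A))
                (gBox (B1RG242Torus.α P a k * (P.L : ℝ) ^ (k * P.d)) P.eps⁻¹ (expGauge P e A) k X *ᵥ f -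
                  gBox (B1RG242Torus.α P a k * (P.L : ℝ) ^ (k * P.d)) P.eps⁻¹ (expGauge P e A) k Ω *ᵥ f) ⟨x₁, μ⟩‖
          ≤ P.spacing k * (c₀ * Real.exp (-(1 / (8 * (L : ℝ) ^ s) * (((P.L : ℝ) ^ k)⁻¹ * D))) *
              Real.exp (-(1 / (8 * (L : ℝ) ^ s) * (((P.L : ℝ) ^ k)⁻¹ * (Db + Df)))) * F) := by
  obtain ⟨s₀, hs₀⟩ := holder_covD_gBox_sub_gBox_le d L hd hL ha e creg β hcreg hβ
  refine ⟨s₀, fun {α} hα0 hα1 s hs => ?_⟩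
  obtain ⟨c₀, e₁, hc₀, he₁, hmain⟩ := hs₀ hα0 hα1 s hs
  refine ⟨c₀, e₁, hc₀, he₁, ?_⟩
  intro P hPd hPL k hk1 hkK hks hsize X Ω hbig hΩ hXΩ A ec hec hece hreg μ x₁ x₂ hne hint₁ hint₂ l hch hend hlen f F D Db Df hF hfX hsD₁ hsD₂
    hDb₁ hDb₂ hDf
  have hF0 : 0 ≤ F := (norm_nonneg _).trans (hF x₁)
  have hLr : (0 : ℝ) < L := by exact_mod_cast (show 0 < L by omega)
  have hLs : (0 : ℝ) < (L : ℝ) ^ s := pow_pos hLr s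
  have hLk : (0 : ℝ) < (L : ℝ) ^ k := pow_pos hLr k
  have hsk : 0 < P.spacing k := P.spacing_pos k
  have h := hmain P hPd hPL hk1 hkK hks hsize X Ω hbig hΩ hXΩ A hec hece hreg μ x₁ x₂ hne
    (fun y hy => hint₁ y (by
      rw [B3Bound323ZeroTorus.T_eq_supDist]
      exact_mod_cast hy))
    (fun y hy => hint₂ y (by
      rw [B3Bound323ZeroTorus.T_eq_supDist]
      exact_mod_cast hy))
    l hch hend (by rw [← B3Bound323ZeroTorus.T_eq_supDist]; exact hlen)
    f F (max D 0) (max Db 0) (max Df 0) hF hfX (le_max_right _ _) (le_max_right _ _) (le_max_right _ _)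
    (fun z hz => by
      rw [← B3Bound323ZeroTorus.T_eq_supDist]
      exact max_le (hsD₁ z hz) (B5Ineq137Torus.T_nonneg P 0 x₁ z))
    (fun z hz => by
      rw [← B3Bound323ZeroTorus.T_eq_supDist]
      exact max_le (hsD₂ z hz) (B5Ineq137Torus.T_nonneg P 0 x₂ z))
    (fun z hz => by
      rw [← B3Bound323ZeroTorus.T_eq_supDist]
      exact max_le (hDb₁ z hz) (B5Ineq137Torus.T_nonneg P 0 x₁ z))
    (fun z hz => by
      rw [← B3Bound323ZeroTorus.T_eq_supDist]
      exact max_le (hDb₂ z hz) (B5Ineq137Torus.T_nonneg P 0 x₂ z))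
    (fun y z hy hz => by
      rw [← B3Bound323ZeroTorus.T_eq_supDist, B5Ineq137Torus.T_symm]
      exact max_le (hDf y hy z hz) (B5Ineq137Torus.T_nonneg P 0 y z))
  have hPLk : ((L : ℝ) ^ k)⁻¹ = ((P.L : ℝ) ^ k)⁻¹ := by rw [hPL]
  have hPk : (0 : ℝ) < (P.L : ℝ) ^ k := pow_pos P.cast_L_pos k
  have hquot : (((LatticeFieldCalculus.supDist x₁ x₂ : ℝ) / (L : ℝ) ^ k)⁻¹) ^ α
      = ((P.L : ℝ) ^ k / B5Ineq137Torus.T P 0 x₁ x₂) ^ α := by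
    rw [inv_div, B3Bound323ZeroTorus.T_eq_supDist, hPL]
  rw [exp_units 8 ((L : ℝ) ^ s) ((L : ℝ) ^ k) (max D 0 + max Db 0 + max Df 0) (by norm_num) hLs.ne' hLk.ne', hPLk, hquot] at h
  have hδ : (0 : ℝ) ≤ 1 / (8 * (L : ℝ) ^ s) := by positivity
  calc _ ≤ c₀ * P.spacing k
        * Real.exp (-(1 / (8 * (L : ℝ) ^ s) * (((P.L : ℝ) ^ k)⁻¹ * (max D 0 + max Db 0 + max Df 0)))) * F := h
    _ ≤ c₀ * P.spacing k * (Real.exp (-(1 / (8 * (L : ℝ) ^ s) * (((P.L : ℝ) ^ k)⁻¹ * D)))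
          * Real.exp (-(1 / (8 * (L : ℝ) ^ s) * (((P.L : ℝ) ^ k)⁻¹ * (Db + Df))))) * F := by
        refine mul_le_mul_of_nonneg_right (mul_le_mul_of_nonneg_left ?_ (by positivity)) hF0
        rw [← Real.exp_add]
        refine Real.exp_le_exp.2 ?_
        have hLki : (0 : ℝ) ≤ ((P.L : ℝ) ^ k)⁻¹ := (inv_pos.2 hPk).le
        have h1 : D + (Db + Df) ≤ max D 0 + max Db 0 + max Df 0 := by
          linarith [le_max_left D 0, le_max_left Db 0, le_max_left Df 0]
        nlinarith [mul_le_mul_of_nonneg_left (mul_le_mul_of_nonneg_left h1 hLki) hδ]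
    _ = _ := by ring

end HolderInput

/-! ## §3 Kernel (private copies of r18 gen 25's `BIJ88LocDerivHolder231RegularTorus` §4): first and second differences of a smooth cut-off between two chart points, along the coordinate hull -/

section ZetaHull

open BIJ88LocHolder230FlatTorus (norm_sub_le_mul_l1_of_bond_bound)

variable (hPd : P.d = d + 1) {n : ℕ} {c : Fin (d + 1) → ℕ}

/-- kernel: the two unit steps commute. [folklore] -/
private theorem shift_shift_comm (x : Balaban1983to89.Site P 0) (μ ν : Fin P.d) : (x.shift μ).shift ν = (x.shift ν).shift μ := by
  funext κ
  by_cases h1 : κ = ν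
  · subst h1
    by_cases h2 : κ = μ
    · subst h2; rfl
    · simp [Balaban1983to89.Site.shift, Function.update_of_ne h2]
  · by_cases h2 : κ = μ
    · subst h2
      simp [Balaban1983to89.Site.shift, Function.update_of_ne h1]
    · simp [Balaban1983to89.Site.shift, Function.update_of_ne h1, Function.update_of_ne h2]

/-- **THE CUT-OFF AT TWO SHIFTED CHART POINTS DIFFERS BY AT MOST `K₁·|z₂ − z₁|₁`** (telescoping the one-step modulus along a staircase in the
coordinate hull, p29's `norm_sub_le_mul_l1_of_bond_bound`): `|ζ″(x(z₂)+e_μ, y) − ζ″(x(z₁)+e_μ, y)| ≤ K₁·Σ_j|z₂,j − z₁,j|`.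
[cite: BalabanImbrieJaffe1988, (2.29) p.263] -/
private theorem abs_zeta_shift_sub_le_of_hull {ζ : Balaban1983to89.Site P 0 → Balaban1983to89.Site P 0 → ℝ} {K₁ : ℝ}
    (hζ1 : ∀ (x y : Balaban1983to89.Site P 0) (ν : Fin P.d), |ζ (x.shift ν) y - ζ x y| ≤ K₁) (z₁ z₂ : Fin (d + 1) → ℤ) (μ : Fin P.d)
    (y : Balaban1983to89.Site P 0) :
    |ζ ((cubePt hPd n c z₂).shift μ) y - ζ ((cubePt hPd n c z₁).shift μ) y| ≤ K₁ * ∑ j, ((|z₂ j - z₁ j| : ℤ) : ℝ) := by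
  set Ψ : (Fin (d + 1) → ℤ) → ℝ := fun z => ζ ((cubePt hPd n c z).shift μ) y with hΨdef
  rw [← Real.norm_eq_abs]
  show ‖Ψ z₂ - Ψ z₁‖ ≤ _
  refine norm_sub_le_mul_l1_of_bond_bound (fun j => min (z₁ j) (z₂ j)) (fun j => max (z₁ j) (z₂ j)) Ψ ?_
    (fun j => ⟨min_le_left _ _, le_max_left _ _⟩) (fun j => ⟨min_le_right _ _, le_max_right _ _⟩)
  intro z i _ _
  simp only [hΨdef]
  rw [cubePt_add_single, shift_shift_comm, Real.norm_eq_abs]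
  exact hζ1 _ y _

/-- **THE BOND DIFFERENCES `Δ_μζ″(·, y)` OF THE CUT-OFF AT TWO CHART POINTS DIFFER BY AT MOST `K₂·|z₂ − z₁|₁`** (telescoping the mixed second
differences): `|(ζ″(x(z₂)+e_μ, y) − ζ″(x(z₂), y)) − (ζ″(x(z₁)+e_μ, y) − ζ″(x(z₁), y))| ≤ K₂·Σ_j|z₂,j − z₁,j|`.
[cite: BalabanImbrieJaffe1988, (2.29) p.263] -/
private theorem abs_zeta_bondDiff_sub_le_of_hull {ζ : Balaban1983to89.Site P 0 → Balaban1983to89.Site P 0 → ℝ} {K₂ : ℝ}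
    (hζ2 : ∀ (x y : Balaban1983to89.Site P 0) (κ ν : Fin P.d), |ζ ((x.shift ν).shift κ) y - ζ (x.shift ν) y - ζ (x.shift κ) y + ζ x y| ≤ K₂)
    (z₁ z₂ : Fin (d + 1) → ℤ) (μ : Fin P.d) (y : Balaban1983to89.Site P 0) :
    |(ζ ((cubePt hPd n c z₂).shift μ) y - ζ (cubePt hPd n c z₂) y) - (ζ ((cubePt hPd n c z₁).shift μ) y - ζ (cubePt hPd n c z₁) y)| ≤
      K₂ * ∑ j, ((|z₂ j - z₁ j| : ℤ) : ℝ) := by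
  set Ψ : (Fin (d + 1) → ℤ) → ℝ := fun z => ζ ((cubePt hPd n c z).shift μ) y - ζ (cubePt hPd n c z) y with hΨdef
  rw [← Real.norm_eq_abs]
  show ‖Ψ z₂ - Ψ z₁‖ ≤ _
  refine norm_sub_le_mul_l1_of_bond_bound (fun j => min (z₁ j) (z₂ j)) (fun j => max (z₁ j) (z₂ j)) Ψ ?_
    (fun j => ⟨min_le_left _ _, le_max_left _ _⟩) (fun j => ⟨min_le_right _ _, le_max_right _ _⟩)
  intro z i _ _
  simp only [hΨdef]
  rw [cubePt_add_single, Real.norm_eq_abs]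
  have e : ζ (((cubePt hPd n c z).shift (Fin.cast hPd.symm i)).shift μ) y - ζ ((cubePt hPd n c z).shift (Fin.cast hPd.symm i)) y -
      (ζ ((cubePt hPd n c z).shift μ) y - ζ (cubePt hPd n c z) y) =
      ζ (((cubePt hPd n c z).shift (Fin.cast hPd.symm i)).shift μ) y - ζ ((cubePt hPd n c z).shift (Fin.cast hPd.symm i)) y -
        ζ ((cubePt hPd n c z).shift μ) y + ζ (cubePt hPd n c z) y := by ring
  rw [e]
  exact hζ2 (cubePt hPd n c z) y μ (Fin.cast hPd.symm i)

end ZetaHull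

/-! ## §4 The Hölder member of order `1 + θ` of (2.31) for a general big-block region `Ω` at a background regular on `Ω` (eight-term split) -/

section DerivHolder

open BIJ88NeumannPropagatorFlatClose231 (norm_rowSource_le rowSource_ne_zero abs_lam_le_one)
open BIJ88LocDeriv231FlatTorus (covD_gLocT_sub_apply)
open BIJ88LocDeriv230ZetaPiFlatTorus (norm_rowSource_sub_le_of_lipschitz)
open BIJ88LocDerivHolder230FlatTorus (abs_weight_shift_sub_le_of_hull abs_weight_bondDiff_sub_le_of_hull)
open BIJ85NeumannPropagatorRegularDeriv (input110_deriv_regular_deep input112_deriv_regular_deep)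
open BIJ88LocDerivHolder230RegularTorus (norm_holA_mul_sub_le T_le_length_of_isSChain)

/-- kernel: `t^θ ≤ t` for `t ≥ 1`, `θ ≤ 1`. [folklore] -/
private theorem rpow_le_self_of_one_le' {t θ : ℝ} (ht : 1 ≤ t) (hθ : θ ≤ 1) : t ^ θ ≤ t := by
  calc t ^ θ ≤ t ^ (1 : ℝ) := Real.rpow_le_rpow_of_exponent_le ht hθ
    _ = t := Real.rpow_one t

/-- kernel: `covD` is additive in the field (difference form). [folklore] -/
private theorem covD_sub' (c' : ℝ) (u : PBond P 0 → ℂ) (φ ψ : Balaban1983to89.Site P 0 → ℂ) (b : PBond P 0) :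
    covD c' u (φ - ψ) b = covD c' u φ b - covD c' u ψ b := by
  simp only [covD, Pi.sub_apply]; ring

/-- kernel: `covD` of a propagator applied to a difference of sources. [folklore] -/
private theorem covD_mulVec_sub' (c' : ℝ) (u : PBond P 0 → ℂ) (G : Matrix (Balaban1983to89.Site P 0) (Balaban1983to89.Site P 0) ℂ)
    (φ ψ : Balaban1983to89.Site P 0 → ℂ) (b : PBond P 0) :
    covD c' u (G *ᵥ (φ - ψ)) b = covD c' u (G *ᵥ φ) b - covD c' u (G *ᵥ ψ) b := by
  rw [Matrix.mulVec_sub, covD_sub']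

/-- kernel: `covD` of the zero field vanishes. [folklore] -/
private theorem covD_zero' (c' : ℝ) (u : PBond P 0 → ℂ) (b : PBond P 0) : covD c' u (0 : Balaban1983to89.Site P 0 → ℂ) b = 0 := by
  simp [covD]

/-- kernel: a deeper chart margin implies a shallower one. [folklore] -/
private theorem depth_mono'' (hPd : P.d = d + 1) {n : ℕ} {c M0 : Fin (d + 1) → ℕ} {D D' : ℝ} (hDD : D ≤ D')
    {x : Balaban1983to89.Site P 0}
    (hdeep : ∀ i, D' ≤ (boxCoord hPd n c x i : ℝ) ∧ (boxCoord hPd n c x i : ℝ) + D' ≤ (n * M0 i : ℕ) - 1) :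
    ∀ i, D ≤ (boxCoord hPd n c x i : ℝ) ∧ (boxCoord hPd n c x i : ℝ) + D ≤ (n * M0 i : ℕ) - 1 :=
  fun i => ⟨hDD.trans (hdeep i).1, by linarith [(hdeep i).2]⟩

/-- kernel: the end point of a contour is one of its sites. [folklore] -/
private theorem pathEnd_mem' : ∀ (x : Balaban1983to89.Site P 0) (l : List (Balaban1983to89.Site P 0)), pathEnd x l ∈ x :: l
  | x, [] => by simp [pathEnd]
  | x, y :: l => by
      have h := pathEnd_mem' y l
      simp only [pathEnd, List.mem_cons] at h ⊢
      exact Or.inr h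
set_option maxHeartbeats 3200000 in
/-- **THE HÖLDER MEMBER OF ORDER `1 + θ` (`0 ≤ θ < 1`) OF (2.31) FOR A GENERAL BIG-BLOCK REGION `Ω` AT A NON-FLAT BACKGROUND `u = e^{ieεA}` WITH `A` (2.23)-REGULAR ON `Ω`, FOR
THE PRINTED LOCALIZATION DATA WITH BIG-BLOCK CUBES AND A SMOOTH CUT-OFF, ALONG ANY NEAREST-NEIGHBOUR CONTOUR OF LENGTH `≤ (d+1)|x₁ − x₂|_T`**
(p. 263: *"Bounds analogous to (2.30), (2.31) hold for covariant derivatives and Holder derivatives of G_{k,loc}(u) of order less than two"* —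
the member of top order of (2.31), i.e. [6] (1.9) *"with the additional factor (1.12)"* for `ψ = G_{k,loc}(u)f − G_k(Ω,u)f`; print: *"for (2.31) we assume smoothness throughout the subset Ω ⊂ T_η"*). r18 gen 25's `BIJ88LocDerivHolder231RegularTorus.derivHolder231_regular_of_smooth` (the case `Ω = T_η`, `A` regular on the whole torus) VERBATIM with `T_η ↦ Ω ⊇ bbHull(Ω₀)` (a union of big blocks containing the big-block hull of the reference box) and the regularity of `A` assumed on `Ω` only.
For `0 ≤ θ < 1` and moduli `K₁, K₂ ≥ 0`: `∃ s₀ ∀ s ≥ s₀ ∃ c₀ e₁ > 0` (from `(d, L, a, e, c, β, θ, K₁, K₂, s)` only) such that on every torus of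
the series (`P.d = d+1`, `P.L = L ≥ 2`), at every level `1 ≤ k ≤ K` with `k + s ≤ m + K`, `3L^kL^s ≤ |T^{(0)}|`, for every big-block region `Ω`, every `A` (2.23)-regular
on `Ω` (`0 < e_k ≤ e₁`), `u = e^{ieεA}`, every reference no-wrap box `Ω₀ = c·L^k + Π_i[0, L^kM₀_i)` shorter than the torus with torus gap
`≥ R` and `bbHull (L^kL^s) Ω₀ ⊆ Ω`, grid spacing `s_g ≥ 1`, half-width `W ≥ 2s_g/3 + R₀/2 + R`, radii `R > rowMargin + (d+2)L^k + 1`, `0 ≤ R₁ < R₀`, EVERY real cut-off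
`ζ″` with `|ζ″| ≤ 1`, `ζ″(x,y) = 0` for `|x − y|_T ≥ R₀`, `ζ″(x,y) = 1` for `|x − y|_T ≤ R₁`, first lattice differences in `x` bounded by
`K₁/(R₀−R₁)` and mixed second ones by `K₂/(R₀−R₁)²`, every direction `μ`, all bonds `⟨x₁, x₁+e_μ⟩`, `⟨x₂, x₂+e_μ⟩` with their four end
points in `Ω₀` at chart depth `≥ R₀ + R`, every nearest-neighbour contour `Γ = (x₁, l)` ending at `x₂` with `|Γ| ≤ (d+1)|x₁ − x₂|_T`, and
every `f` (`‖f‖_∞ ≤ F`) supported at sup-torus distance `≥ D ≥ 0` from `x₁` and from `x₂`, with `ψ = G_{k,loc}(u)f − G_k(Ω,u)f`: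
`(L^k/|x₁ − x₂|_T)^θ·‖U(A(Γ))(D_uψ)(x₂, μ) − (D_uψ)(x₁, μ)‖ ≤`
`(L^kε)·c₀·(1 + L^k((R₀−R₁)⁻¹ + s_g⁻¹))²·[m·e^{−δ₀(2R−1)/L^k} + e^{−(δ₀/2)(R₁−1)/L^k}]·e^{−(δ₀/2)D/L^k}·F`, `δ₀ = 1/(8L^s)`,
`m = (⌊(L^k − 1 + R₀)/s_g⌋ + 3)^{d+1}` (`D_uψ` written as the difference of the two covariant derivatives).  MECHANISM (near pairs
`|x₁ − x₂|_T ≤ L^k`): p29's (2.32) bond identity `covD_gLocT_sub_apply` at both bonds with `G_k(□̃_α,u) − G_k(Ω,u)` in the cube part, and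
EIGHT terms — cube part: (A) the Hölder member of [7] (1.11)–(1.12) at the regular `u` (r01's `holder_covD_gBox_sub_gBox_le`, §2) per
hull active at `x₂ + e_μ`; (B) the derivative member of (1.11)–(1.12) (r01's `input112_deriv_regular_deep`) at `⟨x₁,x₁+e_μ⟩` on the difference
of the row sources of `x₂ + e_μ`, `x₁ + e_μ`; (C) the transported difference of the values of `(G_k(□̃_α,u) − G_k(Ω,u))` on the
bond-difference source of `x₂`, telescoped ALONG `Γ` at the non-flat `u` (`norm_holA_mul_sub_le`) with (B)'s input per bond; (D) the value
member of (1.11)–(1.12) (r18's `inputs_regular_region`) on the second difference of the row weights — tail part (`G_k(Ω,u)` on `(ζ″ − 1)f`, which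
lives at distance `> R₁ − 1`): (A″) [7] (1.9) on `Ω` at the rows `x₁, x₂` (r01's `input19_holder_regular_deep`); (B″) (1.10)'s derivative member on
`Ω` (r01's `input110_deriv_regular_deep`, at `x₁` and at every contour site) on `(ζ″(x₂+e_μ,·) − ζ″(x₁+e_μ,·))f` (§4); (C″) the telescoping along `Γ` of
`G_k(Ω,u)(Δ_μζ″(x₂,·)f)`; (D″) (1.10)'s value member on the second difference of `ζ″` (§4); far pairs: two derivative members (§2).
[cite: BalabanImbrieJaffe1988, (2.31) p.263] [cite: Balaban1983RegularityDecay, (1.9), (1.11)–(1.12) p.573] -/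
theorem derivHolder231_regular_region_of_smooth (d L : ℕ) (hL : 2 ≤ L) {a : ℝ} (ha : 0 < a) (e creg β : ℝ) (hcreg : 0 ≤ creg) (hβ : 0 < β)
    {θ : ℝ} (hθ0 : 0 ≤ θ) (hθ1 : θ < 1) {K₁ K₂ : ℝ} (hK₁ : 0 ≤ K₁) (hK₂ : 0 ≤ K₂) :
    ∃ s₀ : ℕ, ∀ s : ℕ, s₀ ≤ s → ∃ c₀ e₁ : ℝ, 0 < c₀ ∧ 0 < e₁ ∧
      ∀ (P : Params) (hPd : P.d = d + 1), P.L = L → ∀ (k : ℕ), 1 ≤ k → k ≤ P.K → k + s ≤ P.m + P.K →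
      3 * (L ^ k * L ^ s) ≤ P.sitesPerDir 0 →
      ∀ (Ω : Finset (Balaban1983to89.Site P 0)),
        (∀ z z' : Balaban1983to89.Site P 0, (∀ μ, (z μ).val / (L ^ k * L ^ s) = (z' μ).val / (L ^ k * L ^ s)) → (z ∈ Ω ↔ z' ∈ Ω)) →
      ∀ (A : PBond P 0 → ℝ) (ec : ℝ), 0 < ec → ec ≤ e₁ →
      (∀ z ∈ Ω, ∀ (μ ν : Fin P.d),
          P.spacing k * |e| / ec * |A ⟨z.shift μ, ν⟩ - A ⟨z, ν⟩| ≤ creg * ec ^ (β - 1) / (L : ℝ) ^ k) →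
      ∀ (c M0 : Fin (d + 1) → ℕ), (∀ i, c i * P.L ^ k + P.L ^ k * M0 i ≤ P.sitesPerDir 0) → (∀ i, P.L ^ k * M0 i < P.sitesPerDir 0) →
        bbHull (L ^ k * L ^ s) (cubeT hPd (P.L ^ k) c fun i => P.L ^ k * M0 i) ⊆ Ω →
      ∀ (sg W : ℕ), 1 ≤ sg → ∀ (R R₀ R₁ : ℝ), ((rowMargin L (d + 1) k s : ℕ) : ℝ) + ((d : ℝ) + 2) * (P.L : ℝ) ^ k + 1 < R → 0 ≤ R₁ → R₁ < R₀ →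
        2 * (sg : ℝ) / 3 + R₀ / 2 + R ≤ W → (∀ i, ((P.L ^ k * M0 i : ℕ) : ℝ) + R ≤ P.sitesPerDir 0) →
      ∀ (ζ : Balaban1983to89.Site P 0 → Balaban1983to89.Site P 0 → ℝ), (∀ x y, |ζ x y| ≤ 1) →
        (∀ x y, R₀ ≤ B5Ineq137Torus.T P 0 x y → ζ x y = 0) → (∀ x y, B5Ineq137Torus.T P 0 x y ≤ R₁ → ζ x y = 1) →
        (∀ (x y : Balaban1983to89.Site P 0) (ν : Fin P.d), |ζ (x.shift ν) y - ζ x y| ≤ K₁ / (R₀ - R₁)) →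
        (∀ (x y : Balaban1983to89.Site P 0) (κ ν : Fin P.d),
          |ζ ((x.shift ν).shift κ) y - ζ (x.shift ν) y - ζ (x.shift κ) y + ζ x y| ≤ K₂ / (R₀ - R₁) ^ 2) →
      ∀ (x₁ x₂ : Balaban1983to89.Site P 0) (μ : Fin P.d),
        x₁ ∈ (cubeT hPd (P.L ^ k) c fun i => P.L ^ k * M0 i) →
        (∀ i, R₀ + R ≤ (boxCoord hPd (P.L ^ k) c x₁ i : ℝ) ∧ (boxCoord hPd (P.L ^ k) c x₁ i : ℝ) + (R₀ + R) ≤ (P.L ^ k * M0 i : ℕ) - 1) →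
        x₁.shift μ ∈ (cubeT hPd (P.L ^ k) c fun i => P.L ^ k * M0 i) →
        (∀ i, R₀ + R ≤ (boxCoord hPd (P.L ^ k) c (x₁.shift μ) i : ℝ) ∧
          (boxCoord hPd (P.L ^ k) c (x₁.shift μ) i : ℝ) + (R₀ + R) ≤ (P.L ^ k * M0 i : ℕ) - 1) →
        x₂ ∈ (cubeT hPd (P.L ^ k) c fun i => P.L ^ k * M0 i) →
        (∀ i, R₀ + R ≤ (boxCoord hPd (P.L ^ k) c x₂ i : ℝ) ∧ (boxCoord hPd (P.L ^ k) c x₂ i : ℝ) + (R₀ + R) ≤ (P.L ^ k * M0 i : ℕ) - 1) →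
        x₂.shift μ ∈ (cubeT hPd (P.L ^ k) c fun i => P.L ^ k * M0 i) →
        (∀ i, R₀ + R ≤ (boxCoord hPd (P.L ^ k) c (x₂.shift μ) i : ℝ) ∧
          (boxCoord hPd (P.L ^ k) c (x₂.shift μ) i : ℝ) + (R₀ + R) ≤ (P.L ^ k * M0 i : ℕ) - 1) →
      ∀ (l : List (Balaban1983to89.Site P 0)), IsSChain x₁ l → pathEnd x₁ l = x₂ →
        (l.length : ℝ) ≤ ((d : ℝ) + 1) * B5Ineq137Torus.T P 0 x₁ x₂ →
      ∀ (f : Balaban1983to89.Site P 0 → ℂ) (F D : ℝ), (∀ y, ‖f y‖ ≤ F) → 0 ≤ D →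
        (∀ y, f y ≠ 0 → D ≤ B5Ineq137Torus.T P 0 x₁ y) → (∀ y, f y ≠ 0 → D ≤ B5Ineq137Torus.T P 0 x₂ y) →
        ((P.L : ℝ) ^ k / B5Ineq137Torus.T P 0 x₁ x₂) ^ θ *
          ‖holA e A x₁ l *
              (covD P.eps⁻¹ (cfg (expGauge P e A))
                  (gLocT (B1RG242Torus.α P a k * (P.L : ℝ) ^ (k * P.d)) P.eps⁻¹ (expGauge P e A) k
                    (cubeFamB hPd (P.L ^ k) c M0 sg W (L ^ k * L ^ s)) (lamFam hPd (P.L ^ k) c M0 sg) ζ *ᵥ f) ⟨x₂, μ⟩ -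
                covD P.eps⁻¹ (cfg (expGauge P e A))
                  (gBox (B1RG242Torus.α P a k * (P.L : ℝ) ^ (k * P.d)) P.eps⁻¹ (expGauge P e A) k Ω *ᵥ f) ⟨x₂, μ⟩) -
            (covD P.eps⁻¹ (cfg (expGauge P e A))
                (gLocT (B1RG242Torus.α P a k * (P.L : ℝ) ^ (k * P.d)) P.eps⁻¹ (expGauge P e A) k
                  (cubeFamB hPd (P.L ^ k) c M0 sg W (L ^ k * L ^ s)) (lamFam hPd (P.L ^ k) c M0 sg) ζ *ᵥ f) ⟨x₁, μ⟩ -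
              covD P.eps⁻¹ (cfg (expGauge P e A))
                (gBox (B1RG242Torus.α P a k * (P.L : ℝ) ^ (k * P.d)) P.eps⁻¹ (expGauge P e A) k Ω *ᵥ f) ⟨x₁, μ⟩)‖ ≤
          P.spacing k * (c₀ * (1 + (P.L : ℝ) ^ k * ((R₀ - R₁)⁻¹ + (sg : ℝ)⁻¹)) ^ 2 *
            ((((⌊(((P.L : ℝ) ^ k) - 1 + R₀) / sg⌋₊ : ℝ) + 3) ^ (d + 1)) *
                Real.exp (-(1 / (8 * (L : ℝ) ^ s) * (((P.L : ℝ) ^ k)⁻¹ * (2 * R - 1)))) +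
              Real.exp (-(1 / (8 * (L : ℝ) ^ s) / 2 * (((P.L : ℝ) ^ k)⁻¹ * (R₁ - 1))))) *
            Real.exp (-(1 / (8 * (L : ℝ) ^ s) / 2 * (((P.L : ℝ) ^ k)⁻¹ * D))) * F) := by
  obtain ⟨s₅, HA0⟩ := input112_holder_regular_region (d + 1) L (Nat.succ_pos d) hL ha e creg β hcreg hβ
  obtain ⟨s₆, HH0⟩ := input19_holder_regular_deep (d + 1) L (Nat.succ_pos d) hL ha e creg β hcreg hβ
  obtain ⟨s₁, H1⟩ := input112_deriv_regular_deep (d + 1) L (Nat.succ_pos d) hL ha e creg β hcreg hβ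
  obtain ⟨s₂, H2⟩ := inputs_regular_region (d + 1) L (Nat.succ_pos d) hL ha e creg β hcreg hβ
  obtain ⟨s₃, H3⟩ := input110_deriv_regular_deep (d + 1) L (Nat.succ_pos d) hL ha e creg β hcreg hβ
  obtain ⟨s₄, H4⟩ := deriv231_regular_region_of_lipschitz d L hL ha e creg β hcreg hβ hK₁
  refine ⟨max (max (max s₅ s₆) s₁) (max (max s₂ s₃) s₄), fun s hs => ?_⟩
  have hs₅ : s₅ ≤ s := le_trans (le_trans (le_trans (le_max_left _ _) (le_max_left _ _)) (le_max_left _ _)) hs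
  have hs₆ : s₆ ≤ s := le_trans (le_trans (le_trans (le_max_right _ _) (le_max_left _ _)) (le_max_left _ _)) hs
  have hs₁ : s₁ ≤ s := le_trans (le_trans (le_max_right _ _) (le_max_left _ _)) hs
  have hs₂ : s₂ ≤ s := le_trans (le_trans (le_trans (le_max_left _ _) (le_max_left _ _)) (le_max_right _ _)) hs
  have hs₃ : s₃ ≤ s := le_trans (le_trans (le_trans (le_max_right _ _) (le_max_left _ _)) (le_max_right _ _)) hs
  have hs₄ : s₄ ≤ s := le_trans (le_trans (le_max_right _ _) (le_max_right _ _)) hs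
  obtain ⟨cA, eA, hcA, heA, GA⟩ := HA0 hθ0 hθ1 s hs₅
  obtain ⟨cH, eH, hcH, heH, GH⟩ := HH0 hθ0 hθ1 s hs₆
  obtain ⟨c₁, e₁, hc₁, he₁, G1⟩ := H1 s hs₁
  obtain ⟨c₂, e₂, hc₂, he₂, G2⟩ := H2 s hs₂
  obtain ⟨c₃, e₃, hc₃, he₃, G3⟩ := H3 s hs₃
  obtain ⟨cg, eg, hcg, heg, Hg⟩ := H4 s hs₄
  -- the rates
  have hLr : (0 : ℝ) < L := by exact_mod_cast (show 0 < L by omega)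
  have hLs : (0 : ℝ) < (L : ℝ) ^ s := pow_pos hLr s
  set δ : ℝ := 1 / (8 * (L : ℝ) ^ s) with hδdef
  have hδ0 : 0 < δ := by positivity
  set δ₄ : ℝ := 1 / (4 * (L : ℝ) ^ s) with hδ₄def
  have hδ₄0 : 0 < δ₄ := by positivity
  have hδ4 : δ ≤ δ₄ := one_div_le_one_div_of_le (by positivity) (by nlinarith)
  -- the constants
  have hdpos : (0 : ℝ) ≤ (d : ℝ) := Nat.cast_nonneg d
  set eβ : ℝ := Real.exp (((d : ℝ) + 2) * δ) with heβdef
  have heβ0 : 0 < eβ := Real.exp_pos _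
  set Λ₀ : ℝ := max K₁ (3 * Real.pi * (d + 1 : ℕ) / 2) with hΛ₀def
  have hΛ₀0 : 0 ≤ Λ₀ := hK₁.trans (le_max_left _ _)
  set Λ₀₂ : ℝ := K₂ + 4 * Real.pi ^ 2 + 3 * Real.pi * (d + 1 : ℕ) * K₁ with hΛ₀₂def
  have hΛ₀₂0 : 0 ≤ Λ₀₂ := by rw [hΛ₀₂def]; positivity
  set CA : ℝ := cA * eβ with hCAdef
  set CB : ℝ := 2 * ((d : ℝ) + 1) * Λ₀ * c₁ * eβ with hCBdef
  set CC : ℝ := 2 * ((d : ℝ) + 1) * Λ₀ * c₁ * eβ ^ 2 with hCCdef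
  set CD : ℝ := 4 * ((d : ℝ) + 1) * Λ₀₂ * c₂ * eβ with hCDdef
  set CtA : ℝ := 2 * cH * eβ with hCtAdef
  set CtB : ℝ := ((d : ℝ) + 1) * c₃ * K₁ * eβ with hCtBdef
  set CtD : ℝ := ((d : ℝ) + 1) * c₂ * K₂ * eβ with hCtDdef
  have hCA0 : 0 < CA := by rw [hCAdef]; positivity
  have hCB0 : 0 ≤ CB := by rw [hCBdef]; positivity
  have hCC0 : 0 ≤ CC := by rw [hCCdef]; positivity
  have hCD0 : 0 ≤ CD := by rw [hCDdef]; positivity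
  have hCtA0 : 0 ≤ CtA := by rw [hCtAdef]; positivity
  have hCtB0 : 0 ≤ CtB := by rw [hCtBdef]; positivity
  have hCtD0 : 0 ≤ CtD := by rw [hCtDdef]; positivity
  set C : ℝ := CA + CB + CC + CD + (CtA + CtB + CtB + CtD) + 2 * cg with hCdef
  have hC0 : 0 < C := by rw [hCdef]; positivity
  refine ⟨C, min (min (min eA eH) e₁) (min (min e₂ e₃) eg), hC0,
    lt_min (lt_min (lt_min heA heH) he₁) (lt_min (lt_min he₂ he₃) heg), ?_⟩
  intro P hPd hPL k hk1 hkK hks hsize Ω hΩ A ec hec hece hreg c M0 hfit0 hN0 hΩ₀ sg W hsg R R₀ R₁ hR hR₁ hR10 hW hgap ζ hζabs hζ0 hζR₁ hζ1 hζ2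
    x₁ x₂ μ hx₁ hdeep₁ hx₁e hdeep₁e hx₂ hdeep₂ hx₂e hdeep₂e l hch hend hlen f F D hF hD hsupp₁ hsupp₂
  have heceA : ec ≤ eA := hece.trans ((min_le_left _ _).trans ((min_le_left _ _).trans (min_le_left _ _)))
  have heceH : ec ≤ eH := hece.trans ((min_le_left _ _).trans ((min_le_left _ _).trans (min_le_right _ _)))
  have hece₁ : ec ≤ e₁ := hece.trans ((min_le_left _ _).trans (min_le_right _ _))
  have hece₂ : ec ≤ e₂ := hece.trans ((min_le_right _ _).trans ((min_le_left _ _).trans (min_le_left _ _)))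
  have hece₃ : ec ≤ e₃ := hece.trans ((min_le_right _ _).trans ((min_le_left _ _).trans (min_le_right _ _)))
  have heceg : ec ≤ eg := hece.trans ((min_le_right _ _).trans (min_le_right _ _))
  obtain ⟨I2, I3⟩ := G2 P hPd hPL hk1 hkK hks hsize Ω hΩ A hec hece₂ hreg
  -- elementary facts
  have hn : 1 ≤ P.L ^ k := Nat.one_le_pow _ _ P.L_pos
  have hk : 0 + k ≤ P.m + P.K := by omega
  have hLpos : (0 : ℝ) < P.L := P.cast_L_pos
  have hLk : (0 : ℝ) < (P.L : ℝ) ^ k := pow_pos hLpos _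
  have hLkinv : 0 < ((P.L : ℝ) ^ k)⁻¹ := inv_pos.mpr hLk
  have hLLk : ((P.L : ℝ) ^ k)⁻¹ * (P.L : ℝ) ^ k = 1 := inv_mul_cancel₀ hLk.ne'
  set ρm : ℝ := ((rowMargin L (d + 1) k s : ℕ) : ℝ) with hρmdef
  have hρm0 : 0 ≤ ρm := Nat.cast_nonneg _
  have hL1 : (P.L : ℝ) ^ k ≤ ((d : ℝ) + 2) * (P.L : ℝ) ^ k := le_mul_of_one_le_left hLk.le (by linarith)
  have hρR : ρm < R := by linarith
  have hRm : ρm + 1 < R := by linarith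
  have hR1 : 1 < R := by linarith
  have hR0 : 0 ≤ R := by linarith
  have hR₀ : 0 ≤ R₀ := hR₁.trans hR10.le
  have hs0 : 0 < sg := hsg
  have hsr : (0 : ℝ) < sg := by exact_mod_cast hs0
  have hgap' : 0 < R₀ - R₁ := sub_pos.2 hR10
  have hF0 : 0 ≤ F := (norm_nonneg _).trans (hF x₁)
  have hsp0 : 0 < P.spacing k := P.spacing_pos k
  have heps : 0 < P.eps := P.eps_pos
  have hK₁' : 0 ≤ K₁ / (R₀ - R₁) := div_nonneg hK₁ hgap'.le
  have hK₂' : 0 ≤ K₂ / (R₀ - R₁) ^ 2 := div_nonneg hK₂ (by positivity)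
  have hS2 : 2 < P.sitesPerDir 0 := by
    have h1 : 1 ≤ L ^ s := Nat.one_le_pow _ _ (by omega)
    have h2 : 2 ≤ L ^ k := le_trans hL (Nat.le_self_pow (by omega) L)
    have h3 : 3 * (2 * 1) ≤ 3 * (L ^ k * L ^ s) := Nat.mul_le_mul_left 3 (Nat.mul_le_mul h2 h1)
    omega
  have hdeep₁₀ := depth_mono'' hPd (show R₀ ≤ R₀ + R by linarith) hdeep₁
  have hdeep₁e₀ := depth_mono'' hPd (show R₀ ≤ R₀ + R by linarith) hdeep₁e
  have hdeep₂₀ := depth_mono'' hPd (show R₀ ≤ R₀ + R by linarith) hdeep₂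
  have hdeep₂e₀ := depth_mono'' hPd (show R₀ ≤ R₀ + R by linarith) hdeep₂e
  -- abbreviations
  set Ω₀ : Finset (Balaban1983to89.Site P 0) := cubeT hPd (P.L ^ k) c fun i => P.L ^ k * M0 i with hΩ₀def
  set A' : ℝ := B1RG242Torus.α P a k * (P.L : ℝ) ^ (k * P.d) with hA'def
  set U : GaugeField P 0 U1 := expGauge P e A with hUdef
  set cubeB := cubeFamB hPd (P.L ^ k) c M0 sg W (L ^ k * L ^ s) with hcubeBdef
  set G₀ := gBox A' P.eps⁻¹ U k Ω with hG₀def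
  set x₁' := x₁.shift μ with hx₁'def
  set x₂' := x₂.shift μ with hx₂'def
  set T12 : ℝ := B5Ineq137Torus.T P 0 x₁ x₂ with hT12def
  have hT0 : 0 ≤ T12 := B5Ineq137Torus.T_nonneg P 0 x₁ x₂
  set m : ℝ := ((⌊(((P.L : ℝ) ^ k) - 1 + R₀) / sg⌋₊ : ℝ) + 3) ^ (d + 1) with hmdef
  have hm0 : 0 ≤ m := by rw [hmdef]; positivity
  set uv : ℝ := (R₀ - R₁)⁻¹ + (sg : ℝ)⁻¹ with huvdef
  have huv0 : 0 ≤ uv := by rw [huvdef]; positivity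
  set br : ℝ := 1 + (P.L : ℝ) ^ k * uv with hbrdef
  have hbr1 : 1 ≤ br := by rw [hbrdef]; exact le_add_of_nonneg_right (by positivity)
  have hbr0 : 0 ≤ br := zero_le_one.trans hbr1
  have hbr2 : br ≤ br ^ 2 := by
    calc br = 1 * br := (one_mul _).symm
      _ ≤ br * br := mul_le_mul_of_nonneg_right hbr1 hbr0
      _ = br ^ 2 := (sq br).symm
  have hbr21 : 1 ≤ br ^ 2 := hbr1.trans hbr2
  have hLuv : (P.L : ℝ) ^ k * uv ≤ br := by rw [hbrdef]; exact le_add_of_nonneg_left zero_le_one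
  have hLu1 : (P.L : ℝ) ^ k * (R₀ - R₁)⁻¹ ≤ br := by
    refine le_trans ?_ hLuv
    rw [huvdef]
    exact mul_le_mul_of_nonneg_left (le_add_of_nonneg_right (inv_pos.mpr hsr).le) hLk.le
  set brR : ℝ := 1 + (P.L : ℝ) ^ k * (R₀ - R₁)⁻¹ with hbrRdef
  have hbrR : brR ≤ br := by
    rw [hbrRdef, hbrdef, huvdef, mul_add]
    linarith only [mul_nonneg hLk.le (inv_pos.mpr hsr).le]
  have hbrR0 : 0 ≤ brR := by rw [hbrRdef]; positivity
  set E : ℝ := Real.exp (-(δ / 2 * (((P.L : ℝ) ^ k)⁻¹ * D))) with hEdef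
  set E2R : ℝ := Real.exp (-(δ * (((P.L : ℝ) ^ k)⁻¹ * (2 * R - 1)))) with hE2Rdef
  set ER1 : ℝ := Real.exp (-(δ / 2 * (((P.L : ℝ) ^ k)⁻¹ * (R₁ - 1)))) with hER1def
  have hE0 : 0 < E := Real.exp_pos _
  have hE2R0 : 0 < E2R := Real.exp_pos _
  have hER10 : 0 < ER1 := Real.exp_pos _
  have hεD : 0 ≤ ((P.L : ℝ) ^ k)⁻¹ * D := mul_nonneg hLkinv.le hD
  have hED : ∀ {δ'}, δ ≤ δ' → Real.exp (-(δ' * (((P.L : ℝ) ^ k)⁻¹ * D))) ≤ E := by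
    intro δ' hδ'
    refine Real.exp_le_exp.2 ?_
    have h1 : δ / 2 * (((P.L : ℝ) ^ k)⁻¹ * D) ≤ δ' * (((P.L : ℝ) ^ k)⁻¹ * D) :=
      mul_le_mul_of_nonneg_right (by linarith) hεD
    linarith
  -- the two slots of the bracket
  set slot1 : ℝ := m * br ^ 2 * E2R with hslot1def
  set slot2 : ℝ := br ^ 2 * ER1 with hslot2def
  have hslot10 : 0 ≤ slot1 := by positivity
  have hslot20 : 0 ≤ slot2 := by positivity
  -- the weight
  set w : ℝ := ((P.L : ℝ) ^ k / T12) ^ θ with hwdef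
  have hw0 : 0 ≤ w := Real.rpow_nonneg (div_nonneg hLk.le hT0) θ
  -- the transport and its modulus
  set τ : ℂ := holA e A x₁ l with hτdef
  have hτ1 : ‖τ‖ = 1 := norm_holA e A x₁ l
  -- the target, factorised
  have hRHS : P.spacing k * (C * br ^ 2 * (m * E2R + ER1) * E * F) =
      P.spacing k * (C * (1 + (P.L : ℝ) ^ k * ((R₀ - R₁)⁻¹ + (sg : ℝ)⁻¹)) ^ 2 *
        ((((⌊(((P.L : ℝ) ^ k) - 1 + R₀) / sg⌋₊ : ℝ) + 3) ^ (d + 1)) *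
            Real.exp (-(1 / (8 * (L : ℝ) ^ s) * (((P.L : ℝ) ^ k)⁻¹ * (2 * R - 1)))) +
          Real.exp (-(1 / (8 * (L : ℝ) ^ s) / 2 * (((P.L : ℝ) ^ k)⁻¹ * (R₁ - 1))))) *
        Real.exp (-(1 / (8 * (L : ℝ) ^ s) / 2 * (((P.L : ℝ) ^ k)⁻¹ * D))) * F) := by
    rw [hmdef, hbrdef, huvdef, hEdef, hE2Rdef, hER1def]
  rw [← hRHS]
  have hslots : C * br ^ 2 * (m * E2R + ER1) * E * F = C * (slot1 + slot2) * E * F := by rw [hslot1def, hslot2def]; ring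
  have hRHS0 : 0 ≤ P.spacing k * (C * br ^ 2 * (m * E2R + ER1) * E * F) := by positivity
  -- coincident points: the contour is empty and the difference vanishes
  by_cases hne : x₂ = x₁
  · have hl0 : l = [] := by
      have h1 : (l.length : ℝ) ≤ 0 := by
        have h0 := hlen
        rw [hT12def, hne, B5Ineq137Torus.T_self, mul_zero] at h0; exact h0
      have h2 : l.length = 0 := by exact_mod_cast le_antisymm h1 (Nat.cast_nonneg _)
      exact List.eq_nil_of_length_eq_zero h2
    have hτ : τ = 1 := by rw [hτdef, hl0, holA_nil]
    rw [hτ, one_mul, hne, sub_self, norm_zero, mul_zero]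
    exact hRHS0
  set X₁ := covD P.eps⁻¹ (cfg U) (gLocT A' P.eps⁻¹ U k cubeB (lamFam hPd (P.L ^ k) c M0 sg) ζ *ᵥ f) ⟨x₁, μ⟩ with hX₁def
  set X₂ := covD P.eps⁻¹ (cfg U) (gLocT A' P.eps⁻¹ U k cubeB (lamFam hPd (P.L ^ k) c M0 sg) ζ *ᵥ f) ⟨x₂, μ⟩ with hX₂def
  set Y₁ := covD P.eps⁻¹ (cfg U) (G₀ *ᵥ f) ⟨x₁, μ⟩ with hY₁def
  set Y₂ := covD P.eps⁻¹ (cfg U) (G₀ *ᵥ f) ⟨x₂, μ⟩ with hY₂def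
  by_cases hnear : (P.L : ℝ) ^ k < T12
  · /- FAR PAIRS: two derivative members (§2), `|U(A(Γ))| = 1` -/
    have hTpos : 0 < T12 := hLk.trans hnear
    have hw1 : w ≤ 1 := by
      refine Real.rpow_le_one (div_nonneg hLk.le hT0) ?_ hθ0
      rw [div_le_one hTpos]; exact hnear.le
    have hg₁ := Hg P hPd hPL k hk1 hkK hks hsize Ω hΩ A ec hec heceg hreg c M0 hfit0 hN0 hΩ₀ sg W hsg R R₀ R₁ hRm hR₁ hR10 hW hgap ζ
      hζabs hζ0 hζR₁ hζ1 x₁ μ hx₁ hdeep₁ hx₁e hdeep₁e f F D hF hD hsupp₁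
    have hg₂ := Hg P hPd hPL k hk1 hkK hks hsize Ω hΩ A ec hec heceg hreg c M0 hfit0 hN0 hΩ₀ sg W hsg R R₀ R₁ hRm hR₁ hR10 hW hgap ζ
      hζabs hζ0 hζR₁ hζ1 x₂ μ hx₂ hdeep₂ hx₂e hdeep₂e f F D hF hD hsupp₂
    have hBg : ∀ X : ℝ, X ≤ P.spacing k * (cg * ((((⌊(((P.L : ℝ) ^ k) - 1 + R₀) / sg⌋₊ : ℝ) + 3) ^ (d + 1)) *
          (1 + (P.L : ℝ) ^ k * ((R₀ - R₁)⁻¹ + (sg : ℝ)⁻¹)) *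
          Real.exp (-(1 / (8 * (L : ℝ) ^ s) * (((P.L : ℝ) ^ k)⁻¹ * (2 * R - 1)))) +
        (1 + (P.L : ℝ) ^ k * (R₀ - R₁)⁻¹) * Real.exp (-(1 / (8 * (L : ℝ) ^ s) / 2 * (((P.L : ℝ) ^ k)⁻¹ * (R₁ - 1))))) *
        Real.exp (-(1 / (8 * (L : ℝ) ^ s) / 2 * (((P.L : ℝ) ^ k)⁻¹ * D))) * F) →
        X ≤ P.spacing k * (cg * (slot1 + slot2) * E * F) := fun X hX => by
      rw [← hmdef, ← huvdef, ← hbrdef, ← hbrRdef, ← hδdef, ← hEdef, ← hE2Rdef, ← hER1def] at hX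
      refine hX.trans (mul_le_mul_of_nonneg_left ?_ hsp0.le)
      refine mul_le_mul_of_nonneg_right (mul_le_mul_of_nonneg_right (mul_le_mul_of_nonneg_left ?_ hcg.le) hE0.le) hF0
      rw [hslot1def, hslot2def]
      have h1 : m * br * E2R ≤ m * br ^ 2 * E2R := mul_le_mul_of_nonneg_right (mul_le_mul_of_nonneg_left hbr2 hm0) hE2R0.le
      have h2 : brR * ER1 ≤ br ^ 2 * ER1 := mul_le_mul_of_nonneg_right (hbrR.trans hbr2) hER10.le
      linarith only [h1, h2]
    have h1 : ‖X₁ - Y₁‖ ≤ P.spacing k * (cg * (slot1 + slot2) * E * F) := hBg _ hg₁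
    have h2 : ‖X₂ - Y₂‖ ≤ P.spacing k * (cg * (slot1 + slot2) * E * F) := hBg _ hg₂
    have hτX : ‖τ * (X₂ - Y₂)‖ = ‖X₂ - Y₂‖ := by rw [norm_mul, hτ1, one_mul]
    calc w * ‖τ * (X₂ - Y₂) - (X₁ - Y₁)‖ ≤ 1 * ‖τ * (X₂ - Y₂) - (X₁ - Y₁)‖ := mul_le_mul_of_nonneg_right hw1 (norm_nonneg _)
      _ ≤ ‖τ * (X₂ - Y₂)‖ + ‖X₁ - Y₁‖ := by rw [one_mul]; exact norm_sub_le _ _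
      _ ≤ P.spacing k * (cg * (slot1 + slot2) * E * F) + P.spacing k * (cg * (slot1 + slot2) * E * F) := by
          rw [hτX]; exact add_le_add h2 h1
      _ = P.spacing k * ((2 * cg) * (slot1 + slot2) * E * F) := by ring
      _ ≤ P.spacing k * (C * br ^ 2 * (m * E2R + ER1) * E * F) := by
          rw [hslots]
          refine mul_le_mul_of_nonneg_left ?_ hsp0.le
          have hc : 2 * cg ≤ C := by rw [hCdef]; linarith only [hCA0.le, hCB0, hCC0, hCD0, hCtA0, hCtB0, hCtD0]
          exact mul_le_mul_of_nonneg_right (mul_le_mul_of_nonneg_right (mul_le_mul_of_nonneg_right hc (by positivity)) hE0.le) hF0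
  /- NEAR PAIRS -/
  push Not at hnear
  -- chart coordinates of the two base points
  obtain ⟨hz₁, hxz₁⟩ := cubePt_boxCoord hPd hfit0 hx₁
  obtain ⟨hz₂, hxz₂⟩ := cubePt_boxCoord hPd hfit0 hx₂
  set z₁ := boxCoord hPd (P.L ^ k) c x₁ with hz₁def
  set z₂ := boxCoord hPd (P.L ^ k) c x₂ with hz₂def
  have hdT : ((d : ℝ) + 2) * T12 ≤ ((d : ℝ) + 2) * (P.L : ℝ) ^ k := mul_le_mul_of_nonneg_left hnear (by positivity)
  have hdT1 : 0 ≤ ((d : ℝ) + 1) * T12 := by positivity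
  have hdT' : ((d : ℝ) + 1) * T12 ≤ ((d : ℝ) + 2) * T12 := mul_le_mul_of_nonneg_right (by linarith) hT0
  set tmax : ℝ := 1 + ((d : ℝ) + 2) * T12 with htmaxdef
  have hRbig : ρm + tmax < R := by rw [htmaxdef]; linarith
  have hdeepT : ∀ i, T12 ≤ (z₁ i : ℝ) ∧ (z₁ i : ℝ) + T12 ≤ (P.L ^ k * M0 i : ℕ) - 1 := fun i => by
    have h1 := hdeep₁ i
    constructor <;> linarith only [h1.1, h1.2, hnear, hR, hρm0, hR₀, hL1]
  have hclose : ∀ i, ((|z₁ i - z₂ i| : ℤ) : ℝ) ≤ T12 := (mem_and_abs_sub_le_of_T_le hPd hfit0 hdeepT le_rfl).2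
  have hroom₁ : ∀ j, z₁ j + 1 < ((P.L ^ k * M0 j : ℕ) : ℤ) := fun j => by
    have h1 : ((z₁ j : ℤ) : ℝ) + 2 ≤ ((P.L ^ k * M0 j : ℕ) : ℝ) := by linarith only [(hdeep₁ j).2, hR1, hR₀]
    have h2 : z₁ j + 2 ≤ ((P.L ^ k * M0 j : ℕ) : ℤ) := by exact_mod_cast h1
    omega
  have hroom₂ : ∀ j, z₂ j + 1 < ((P.L ^ k * M0 j : ℕ) : ℤ) := fun j => by
    have h1 : ((z₂ j : ℤ) : ℝ) + 2 ≤ ((P.L ^ k * M0 j : ℕ) : ℝ) := by linarith only [(hdeep₂ j).2, hR1, hR₀]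
    have h2 : z₂ j + 2 ≤ ((P.L ^ k * M0 j : ℕ) : ℤ) := by exact_mod_cast h1
    omega
  have hl1 : ∑ j, ((|z₂ j - z₁ j| : ℤ) : ℝ) ≤ ((d : ℝ) + 1) * T12 := by
    calc ∑ j, ((|z₂ j - z₁ j| : ℤ) : ℝ) ≤ ∑ _j : Fin (d + 1), T12 :=
          Finset.sum_le_sum fun j _ => by rw [abs_sub_comm]; exact hclose j
      _ = ((d : ℝ) + 1) * T12 := by rw [Finset.sum_const, Finset.card_univ, Fintype.card_fin, nsmul_eq_mul]; push_cast; ring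
  -- the weight against one factor `T12`: `w·T12 ≤ L^k`
  have hwT : w * T12 ≤ (P.L : ℝ) ^ k := by
    rcases hT0.eq_or_lt with hT00 | hTpos
    · rw [← hT00, mul_zero]; exact hLk.le
    · have hq : 1 ≤ (P.L : ℝ) ^ k / T12 := by rw [le_div_iff₀ hTpos, one_mul]; exact hnear
      calc w * T12 ≤ (P.L : ℝ) ^ k / T12 * T12 := mul_le_mul_of_nonneg_right (rpow_le_self_of_one_le' hq hθ1.le) hT0
        _ = (P.L : ℝ) ^ k := div_mul_cancel₀ _ hTpos.ne'
  -- distances between the four end points and to the contour sites (the end point `x₂` is a contour site)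
  have hx₂mem : x₂ ∈ x₁ :: l := by rw [← hend]; exact pathEnd_mem' x₁ l
  have hx₁mem : x₁ ∈ x₁ :: l := List.mem_cons_self
  have hlenT : (l.length : ℝ) ≤ ((d : ℝ) + 1) * T12 := hlen
  have hc1 : ∀ z ∈ x₁ :: l, B5Ineq137Torus.T P 0 x₁ z ≤ ((d : ℝ) + 1) * T12 := fun z hz =>
    (T_le_length_of_isSChain x₁ l hch z hz).trans hlenT
  have hT21 : B5Ineq137Torus.T P 0 x₂ x₁ = T12 := by rw [B5Ineq137Torus.T_symm]
  have hc2 : ∀ z ∈ x₁ :: l, B5Ineq137Torus.T P 0 x₂ z ≤ ((d : ℝ) + 2) * T12 := fun z hz => by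
    have h1 := B5Ineq137Torus.T_triangle P 0 x₂ x₁ z; have h2 := hc1 z hz
    linarith only [h1, h2, hT21]
  have hc1' : ∀ z ∈ x₁ :: l, B5Ineq137Torus.T P 0 x₁' z ≤ tmax := fun z hz => by
    have h1 := B5Ineq137Torus.T_triangle P 0 x₁' x₁ z; have h2 := hc1 z hz
    have h3 : B5Ineq137Torus.T P 0 x₁' x₁ ≤ 1 := by rw [B5Ineq137Torus.T_symm]; exact T_shift_le_one x₁ μ
    rw [htmaxdef]; linarith only [h1, h2, h3, hdT']
  have hc2' : ∀ z ∈ x₁ :: l, B5Ineq137Torus.T P 0 x₂' z ≤ tmax := fun z hz => by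
    have h1 := B5Ineq137Torus.T_triangle P 0 x₂' x₂ z; have h2 := hc2 z hz
    have h3 : B5Ineq137Torus.T P 0 x₂' x₂ ≤ 1 := by rw [B5Ineq137Torus.T_symm]; exact T_shift_le_one x₂ μ
    rw [htmaxdef]; linarith only [h1, h2, h3]
  have hc1t : ∀ z ∈ x₁ :: l, B5Ineq137Torus.T P 0 x₁ z ≤ tmax := fun z hz => by
    have h2 := hc1 z hz; rw [htmaxdef]; linarith only [h2, hdT']
  have hc2t : ∀ z ∈ x₁ :: l, B5Ineq137Torus.T P 0 x₂ z ≤ tmax := fun z hz => by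
    have h2 := hc2 z hz; rw [htmaxdef]; linarith only [h2]
  -- the active-label sets of the four end points
  have hmem : ∀ x : Balaban1983to89.Site P 0, x ∈ blockK k (blkIter k x) := fun x => mem_blockK.2 rfl
  set S : Balaban1983to89.Site P 0 → Finset ↥(labels (P.L ^ k) M0 sg) := fun p =>
    (activeLabels hPd (P.L ^ k) c sg R₀ (blkIter k p)).subtype fun α => α ∈ labels (P.L ^ k) M0 sg with hSdef
  have hcard : ∀ p, ((S p).card : ℝ) ≤ m := fun p => by
    have h1 := card_subtype_activeLabels_le (hPd := hPd) (c := c) (M0 := M0) hn hs0 hR₀ (blkIter k p)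
    have e1 : (((P.L ^ k : ℕ) : ℕ) : ℝ) = (P.L : ℝ) ^ k := by push_cast; rfl
    rw [e1] at h1; exact h1
  have hS : ∀ (p : Balaban1983to89.Site P 0),
      (∀ i, R₀ ≤ (boxCoord hPd (P.L ^ k) c p i : ℝ) ∧ (boxCoord hPd (P.L ^ k) c p i : ℝ) + R₀ ≤ (P.L ^ k * M0 i : ℕ) - 1) →
      ∀ (α : ↥(labels (P.L ^ k) M0 sg)) (y : Balaban1983to89.Site P 0), ζ p y * lamFam hPd (P.L ^ k) c M0 sg α p y ≠ 0 → α ∈ S p := by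
    intro p hdeep α y hne'
    rw [hSdef, Finset.mem_subtype]
    exact mem_activeLabels_of_ne_zero_of_deep hk hs0 hfit0 hζ0 (hmem p) hdeep hne'
  -- the hull geometry at a deep active point `p`: every `q` within `tmax` of `p` is a `rowMargin`-deep row of the hull and sees `T ∖ hull`
  -- at distance `≥ Dβ = R − 1 − (d+2)L^k`; every active source lies in the hull and sees `T ∖ hull` at distance `≥ R`
  set Dβ : ℝ := R - 1 - ((d : ℝ) + 2) * (P.L : ℝ) ^ k with hDβdef
  have hDβ0 : 0 ≤ Dβ := by rw [hDβdef]; linarith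
  have deepq : ∀ (α : ↥(labels (P.L ^ k) M0 sg)) (p : Balaban1983to89.Site P 0), p ∈ Ω₀ →
      (∀ i, R₀ + R ≤ (boxCoord hPd (P.L ^ k) c p i : ℝ) ∧ (boxCoord hPd (P.L ^ k) c p i : ℝ) + (R₀ + R) ≤ (P.L ^ k * M0 i : ℕ) - 1) →
      (∃ y, ζ p y * lamFam hPd (P.L ^ k) c M0 sg α p y ≠ 0) →
      ∀ (q : Balaban1983to89.Site P 0), B5Ineq137Torus.T P 0 p q ≤ tmax →
        q ∈ deepRows ρm (cubeB α) ∧ ∀ w, w ∉ cubeB α → Dβ ≤ B5Ineq137Torus.T P 0 q w := by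
    intro α p hp hdeep hex q hpq
    obtain ⟨y₀, hy₀⟩ := hex
    obtain ⟨-, -, hfar⟩ := rowHyp_ii_hull hPd hn hs0 hfit0 hR0 hR₀ hρR hgap hW (L ^ k * L ^ s) hζ0 hp hdeep α y₀ hy₀
    refine ⟨mem_deepRows.2 fun y hy => ?_, fun w hw => ?_⟩
    · by_contra hnot
      have h1 := (hfar y hnot).1
      have h2 := B5Ineq137Torus.T_triangle P 0 p q y
      linarith only [h1, h2, hy, hpq, hRbig]
    · have h1 := (hfar w hw).1
      have h2 := B5Ineq137Torus.T_triangle P 0 p q w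
      rw [hDβdef]; rw [htmaxdef] at hpq
      linarith only [h1, h2, hpq, hdT]
  have HY : ∀ (p : Balaban1983to89.Site P 0), p ∈ Ω₀ →
      (∀ i, R₀ + R ≤ (boxCoord hPd (P.L ^ k) c p i : ℝ) ∧ (boxCoord hPd (P.L ^ k) c p i : ℝ) + (R₀ + R) ≤ (P.L ^ k * M0 i : ℕ) - 1) →
      ∀ (α : ↥(labels (P.L ^ k) M0 sg)) (y : Balaban1983to89.Site P 0), ζ p y * lamFam hPd (P.L ^ k) c M0 sg α p y ≠ 0 →
        y ∈ cubeB α ∧ ∀ w, w ∉ cubeB α → R ≤ B5Ineq137Torus.T P 0 y w := by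
    intro p hp hdeep α y hy
    have H := rowHyp_ii_hull hPd hn hs0 hfit0 hR0 hR₀ hρR hgap hW (L ^ k * L ^ s) hζ0 hp hdeep α y hy
    exact ⟨H.2.1, fun w hw => (H.2.2 w hw).2⟩
  have hrow_of_deep : ∀ {α : ↥(labels (P.L ^ k) M0 sg)} {q : Balaban1983to89.Site P 0}, q ∈ deepRows ρm (cubeB α) →
      ∀ y, B5Ineq137Torus.T P 0 q y ≤
        ((2 * (5 * (L ^ k * L ^ s) / 8 + L ^ k) + 2 * (L ^ k * L ^ s) * (d + 1 + 1) + 1 : ℕ) : ℝ) → y ∈ cubeB α := by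
    intro α q hq y hy
    refine (mem_deepRows.1 hq) y ?_
    rw [hρmdef]; unfold rowMargin
    exact hy
  -- the region contains the reference box and every hull; the contour sites are deep rows of the region
  have hΩ₀' : Ω₀ ⊆ Ω := (subset_bbHull _ _).trans hΩ₀
  have hsubΩ : ∀ α : ↥(labels (P.L ^ k) M0 sg), cubeB α ⊆ Ω := cubeFamB_subset_of_hull_subset hPd hΩ₀
  have hrowΩ_of : ∀ {q : Balaban1983to89.Site P 0}, q ∈ deepRows ρm Ω →
      ∀ y, B5Ineq137Torus.T P 0 q y ≤ ((2 * (5 * (L ^ k * L ^ s) / 8 + L ^ k) + 2 * (L ^ k * L ^ s) * (d + 1 + 1) + 1 : ℕ) : ℝ) →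
        y ∈ Ω := by
    intro q hq y hy
    refine (mem_deepRows.1 hq) y ?_
    rw [hρmdef]; unfold rowMargin
    exact hy
  have hdeepC : ∀ i, ((d : ℝ) + 1) * (P.L : ℝ) ^ k ≤ (boxCoord hPd (P.L ^ k) c x₁ i : ℝ) ∧
      (boxCoord hPd (P.L ^ k) c x₁ i : ℝ) + ((d : ℝ) + 1) * (P.L : ℝ) ^ k ≤ (P.L ^ k * M0 i : ℕ) - 1 := fun i => by
    have h1 := hdeep₁ i
    have hd0 : (0 : ℝ) ≤ d := Nat.cast_nonneg d
    have h2 : ((d : ℝ) + 1) * (P.L : ℝ) ^ k ≤ R₀ + R := by nlinarith only [hR, hρm0, hR₀, hLk, hd0]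
    constructor <;> linarith only [h1.1, h1.2, h2]
  have hzΩ : ∀ z ∈ x₁ :: l, z ∈ deepRows ρm Ω := by
    intro z hz
    have hd0 : (0 : ℝ) ≤ d := Nat.cast_nonneg d
    have hT : B5Ineq137Torus.T P 0 x₁ z ≤ ((d : ℝ) + 1) * (P.L : ℝ) ^ k :=
      (hc1 z hz).trans (mul_le_mul_of_nonneg_left hnear (by linarith only [hd0]))
    have h2 := (mem_and_abs_sub_le_of_T_le hPd hfit0 hdeepC hT).2
    refine mem_deepRows_of_depth hPd hfit0 hΩ₀' fun i => ?_
    have h3 := h2 i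
    push_cast at h3
    obtain ⟨h4, h5⟩ := abs_le.1 h3
    have h1 := hdeep₁ i
    have h6 : ((d : ℝ) + 1) * (P.L : ℝ) ^ k + ρm ≤ R₀ + R := by nlinarith only [hR, hρm0, hR₀, hLk, hd0]
    constructor <;> linarith only [h1.1, h1.2, h4, h5, h6]
  have hx₁Ω : x₁ ∈ deepRows ρm Ω := hzΩ x₁ hx₁mem
  have hx₂Ω : x₂ ∈ deepRows ρm Ω := hzΩ x₂ hx₂mem
  -- the row sources and their vanishing
  set gs : Balaban1983to89.Site P 0 → ↥(labels (P.L ^ k) M0 sg) → Balaban1983to89.Site P 0 → ℂ :=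
    fun p α y => (ζ p y : ℂ) * (lamFam hPd (P.L ^ k) c M0 sg α p y : ℂ) * f y with hgsdef
  set ds : Balaban1983to89.Site P 0 → Balaban1983to89.Site P 0 → ↥(labels (P.L ^ k) M0 sg) → Balaban1983to89.Site P 0 → ℂ :=
    fun p p' α y => ((ζ p' y : ℂ) * (lamFam hPd (P.L ^ k) c M0 sg α p' y : ℂ) - (ζ p y : ℂ) * (lamFam hPd (P.L ^ k) c M0 sg α p y : ℂ)) * f y
    with hdsdef
  set q' : Balaban1983to89.Site P 0 → Balaban1983to89.Site P 0 → ℂ := fun p y => ((ζ p y : ℂ) - 1) * f y with hq'def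
  set dq : Balaban1983to89.Site P 0 → Balaban1983to89.Site P 0 → Balaban1983to89.Site P 0 → ℂ :=
    fun p p' y => ((ζ p' y : ℂ) - (ζ p y : ℂ)) * f y with hdqdef
  have hgs0 : ∀ (p : Balaban1983to89.Site P 0) (α : ↥(labels (P.L ^ k) M0 sg)),
      (¬∃ y, ζ p y * lamFam hPd (P.L ^ k) c M0 sg α p y ≠ 0) → gs p α = 0 := by
    intro p α hex
    push Not at hex
    funext y; rw [hgsdef]; dsimp only; rw [← Complex.ofReal_mul, hex y, Complex.ofReal_zero, zero_mul]; rfl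
  have hds0 : ∀ (p p' : Balaban1983to89.Site P 0) (α : ↥(labels (P.L ^ k) M0 sg)),
      (¬∃ y, ζ p' y * lamFam hPd (P.L ^ k) c M0 sg α p' y ≠ 0) → (¬∃ y, ζ p y * lamFam hPd (P.L ^ k) c M0 sg α p y ≠ 0) → ds p p' α = 0 := by
    intro p p' α hex' hex
    push Not at hex hex'
    funext y; rw [hdsdef]; dsimp only; rw [← Complex.ofReal_mul, ← Complex.ofReal_mul, hex y, hex' y]; simp
  have hgs_le : ∀ p α y, ‖gs p α y‖ ≤ F := fun p α y =>
    norm_rowSource_le (hζabs p y) (abs_lam_le_one (sum_abs_lamT_le_one hfit0) α p y) hF y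
  have hgs_act : ∀ p α y, gs p α y ≠ 0 → ζ p y * lamFam hPd (P.L ^ k) c M0 sg α p y ≠ 0 := fun p α y hy => (rowSource_ne_zero hy).1
  have hgs_supp : ∀ p α y, gs p α y ≠ 0 → f y ≠ 0 := fun p α y hy => (rowSource_ne_zero hy).2
  have hds_act : ∀ p p' α y, ds p p' α y ≠ 0 →
      ζ p' y * lamFam hPd (P.L ^ k) c M0 sg α p' y ≠ 0 ∨ ζ p y * lamFam hPd (P.L ^ k) c M0 sg α p y ≠ 0 := by
    intro p p' α y hy
    by_contra hno
    rw [not_or, not_not, not_not] at hno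
    apply hy
    rw [hdsdef]; dsimp only
    rw [← Complex.ofReal_mul, ← Complex.ofReal_mul, hno.1, hno.2]; simp
  have hds_supp : ∀ p p' α y, ds p p' α y ≠ 0 → f y ≠ 0 := fun p p' α y hy => right_ne_zero_of_mul hy
  -- the bond identity at both bonds
  have hid₁ : X₁ - Y₁ = ∑ α, (covD P.eps⁻¹ (cfg U) (gBox A' P.eps⁻¹ U k (cubeB α) *ᵥ gs x₁' α) ⟨x₁, μ⟩ -
        covD P.eps⁻¹ (cfg U) (G₀ *ᵥ gs x₁' α) ⟨x₁, μ⟩) +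
      ∑ α, ((P.eps⁻¹ : ℝ) : ℂ) * ((gBox A' P.eps⁻¹ U k (cubeB α) *ᵥ ds x₁ x₁' α) x₁ - (G₀ *ᵥ ds x₁ x₁' α) x₁) +
      covD P.eps⁻¹ (cfg U) (G₀ *ᵥ q' x₁') ⟨x₁, μ⟩ + ((P.eps⁻¹ : ℝ) : ℂ) * (G₀ *ᵥ dq x₁ x₁') x₁ :=
    covD_gLocT_sub_apply P.eps⁻¹ (cfg U) A' P.eps⁻¹ U k cubeB (lamFam hPd (P.L ^ k) c M0 sg) ζ G₀ f ⟨x₁, μ⟩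
      (rowHyp_i hPd hfit0 hζ0 hx₁e hdeep₁e₀) (rowHyp_i hPd hfit0 hζ0 hx₁ hdeep₁₀)
  have hid₂ : X₂ - Y₂ = ∑ α, (covD P.eps⁻¹ (cfg U) (gBox A' P.eps⁻¹ U k (cubeB α) *ᵥ gs x₂' α) ⟨x₂, μ⟩ -
        covD P.eps⁻¹ (cfg U) (G₀ *ᵥ gs x₂' α) ⟨x₂, μ⟩) +
      ∑ α, ((P.eps⁻¹ : ℝ) : ℂ) * ((gBox A' P.eps⁻¹ U k (cubeB α) *ᵥ ds x₂ x₂' α) x₂ - (G₀ *ᵥ ds x₂ x₂' α) x₂) +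
      covD P.eps⁻¹ (cfg U) (G₀ *ᵥ q' x₂') ⟨x₂, μ⟩ + ((P.eps⁻¹ : ℝ) : ℂ) * (G₀ *ᵥ dq x₂ x₂') x₂ :=
    covD_gLocT_sub_apply P.eps⁻¹ (cfg U) A' P.eps⁻¹ U k cubeB (lamFam hPd (P.L ^ k) c M0 sg) ζ G₀ f ⟨x₂, μ⟩
      (rowHyp_i hPd hfit0 hζ0 hx₂e hdeep₂e₀) (rowHyp_i hPd hfit0 hζ0 hx₂ hdeep₂₀)
  rw [hid₁, hid₂]
  -- the eight families of summands
  set Ec : ℂ := ((P.eps⁻¹ : ℝ) : ℂ) with hEcdef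
  have hEc : ‖Ec‖ = P.eps⁻¹ := by rw [hEcdef, Complex.norm_real, Real.norm_eq_abs, abs_of_pos (inv_pos.mpr heps)]
  set G : ↥(labels (P.L ^ k) M0 sg) → Matrix (Balaban1983to89.Site P 0) (Balaban1983to89.Site P 0) ℂ :=
    fun α => gBox A' P.eps⁻¹ U k (cubeB α) with hGdef
  set sA : ↥(labels (P.L ^ k) M0 sg) → ℂ := fun α =>
    τ * (covD P.eps⁻¹ (cfg U) (G α *ᵥ gs x₂' α) ⟨x₂, μ⟩ - covD P.eps⁻¹ (cfg U) (G₀ *ᵥ gs x₂' α) ⟨x₂, μ⟩) -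
      (covD P.eps⁻¹ (cfg U) (G α *ᵥ gs x₂' α) ⟨x₁, μ⟩ - covD P.eps⁻¹ (cfg U) (G₀ *ᵥ gs x₂' α) ⟨x₁, μ⟩) with hsAdef
  set sB : ↥(labels (P.L ^ k) M0 sg) → ℂ := fun α =>
    (covD P.eps⁻¹ (cfg U) (G α *ᵥ gs x₂' α) ⟨x₁, μ⟩ - covD P.eps⁻¹ (cfg U) (G₀ *ᵥ gs x₂' α) ⟨x₁, μ⟩) -
      (covD P.eps⁻¹ (cfg U) (G α *ᵥ gs x₁' α) ⟨x₁, μ⟩ - covD P.eps⁻¹ (cfg U) (G₀ *ᵥ gs x₁' α) ⟨x₁, μ⟩) with hsBdef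
  set sC : ↥(labels (P.L ^ k) M0 sg) → ℂ := fun α =>
    τ * (Ec * ((G α *ᵥ ds x₂ x₂' α) x₂ - (G₀ *ᵥ ds x₂ x₂' α) x₂)) - Ec * ((G α *ᵥ ds x₂ x₂' α) x₁ - (G₀ *ᵥ ds x₂ x₂' α) x₁)
    with hsCdef
  set sD : ↥(labels (P.L ^ k) M0 sg) → ℂ := fun α =>
    Ec * ((G α *ᵥ ds x₂ x₂' α) x₁ - (G₀ *ᵥ ds x₂ x₂' α) x₁) - Ec * ((G α *ᵥ ds x₁ x₁' α) x₁ - (G₀ *ᵥ ds x₁ x₁' α) x₁)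
    with hsDdef
  set tA : ℂ := τ * covD P.eps⁻¹ (cfg U) (G₀ *ᵥ q' x₂') ⟨x₂, μ⟩ - covD P.eps⁻¹ (cfg U) (G₀ *ᵥ q' x₂') ⟨x₁, μ⟩ with htAdef
  set tB : ℂ := covD P.eps⁻¹ (cfg U) (G₀ *ᵥ q' x₂') ⟨x₁, μ⟩ - covD P.eps⁻¹ (cfg U) (G₀ *ᵥ q' x₁') ⟨x₁, μ⟩ with htBdef
  set tC : ℂ := τ * (Ec * (G₀ *ᵥ dq x₂ x₂') x₂) - Ec * (G₀ *ᵥ dq x₂ x₂') x₁ with htCdef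
  set tD : ℂ := Ec * (G₀ *ᵥ dq x₂ x₂') x₁ - Ec * (G₀ *ᵥ dq x₁ x₁') x₁ with htDdef
  have hdecomp : τ * (∑ α, (covD P.eps⁻¹ (cfg U) (G α *ᵥ gs x₂' α) ⟨x₂, μ⟩ - covD P.eps⁻¹ (cfg U) (G₀ *ᵥ gs x₂' α) ⟨x₂, μ⟩) +
        ∑ α, Ec * ((G α *ᵥ ds x₂ x₂' α) x₂ - (G₀ *ᵥ ds x₂ x₂' α) x₂) +
        covD P.eps⁻¹ (cfg U) (G₀ *ᵥ q' x₂') ⟨x₂, μ⟩ + Ec * (G₀ *ᵥ dq x₂ x₂') x₂) -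
      (∑ α, (covD P.eps⁻¹ (cfg U) (G α *ᵥ gs x₁' α) ⟨x₁, μ⟩ - covD P.eps⁻¹ (cfg U) (G₀ *ᵥ gs x₁' α) ⟨x₁, μ⟩) +
        ∑ α, Ec * ((G α *ᵥ ds x₁ x₁' α) x₁ - (G₀ *ᵥ ds x₁ x₁' α) x₁) +
        covD P.eps⁻¹ (cfg U) (G₀ *ᵥ q' x₁') ⟨x₁, μ⟩ + Ec * (G₀ *ᵥ dq x₁ x₁') x₁) =
      ((∑ α, sA α + ∑ α, sB α) + (∑ α, sC α + ∑ α, sD α)) + ((tA + tB) + (tC + tD)) := by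
    simp only [hsAdef, hsBdef, hsCdef, hsDdef, htAdef, htBdef, htCdef, htDdef, Finset.sum_sub_distrib, Finset.mul_sum, mul_add, mul_sub]
    ring
  /- TERM A: the Hölder member of (1.11)–(1.12) at the regular `u` for each hull active at `x₂'`, fixed source -/
  have hEβ : Real.exp (-(δ * (((P.L : ℝ) ^ k)⁻¹ * (Dβ + R)))) ≤ eβ * E2R := by
    rw [heβdef, hE2Rdef, ← Real.exp_add]
    refine Real.exp_le_exp.2 ?_
    have e1 : ((P.L : ℝ) ^ k)⁻¹ * (Dβ + R) = ((P.L : ℝ) ^ k)⁻¹ * (2 * R - 1) - ((d : ℝ) + 2) * (((P.L : ℝ) ^ k)⁻¹ * (P.L : ℝ) ^ k) := by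
      rw [hDβdef]; ring
    rw [e1, hLLk]
    linarith
  set BA : ℝ := P.spacing k * (cA * Real.exp (-(δ * (((P.L : ℝ) ^ k)⁻¹ * D))) *
    Real.exp (-(δ * (((P.L : ℝ) ^ k)⁻¹ * (Dβ + R)))) * F) with hBAdef
  have hBA0 : 0 ≤ BA := by rw [hBAdef]; positivity
  have hsA_eq : ∀ α, sA α = τ * covD P.eps⁻¹ (cfg U) (G α *ᵥ gs x₂' α - G₀ *ᵥ gs x₂' α) ⟨x₂, μ⟩ -
      covD P.eps⁻¹ (cfg U) (G α *ᵥ gs x₂' α - G₀ *ᵥ gs x₂' α) ⟨x₁, μ⟩ := fun α => by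
    simp only [hsAdef, covD_sub']
  have hsA0 : ∀ α, gs x₂' α = 0 → sA α = 0 := fun α h0 => by
    simp only [hsAdef]; rw [h0]; simp only [mulVec_zero, covD_zero', sub_self, mul_zero]
  have hlen' : (l.length : ℝ) ≤ ((d + 1 : ℕ) : ℝ) * B5Ineq137Torus.T P 0 x₁ x₂ := by push_cast; exact hlen
  have htermA : ∀ α, w * ‖sA α‖ ≤ BA := by
    intro α
    by_cases hex : ∃ y, ζ x₂' y * lamFam hPd (P.L ^ k) c M0 sg α x₂' y ≠ 0
    · have h1 := deepq α x₂' hx₂e hdeep₂e hex x₁ (hc2' x₁ hx₁mem)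
      have h2 := deepq α x₂' hx₂e hdeep₂e hex x₂ (hc2' x₂ hx₂mem)
      have key := GA P hPd hPL hk1 hkK hks hsize (cubeB α) Ω (bbHull_bigBlock _ _) hΩ (hsubΩ α) A hec heceA hreg μ x₁ x₂ hne
        (hrow_of_deep h1.1) (hrow_of_deep h2.1) l hch hend hlen' (gs x₂' α) F D Dβ R (hgs_le x₂' α)
        (fun y hy => by by_contra hne'; exact hy (HY x₂' hx₂e hdeep₂e α y (hgs_act x₂' α y hne')).1)
        (fun y hy => hsupp₁ y (hgs_supp x₂' α y hy)) (fun y hy => hsupp₂ y (hgs_supp x₂' α y hy))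
        h1.2 h2.2 (fun y hy w hw => (HY x₂' hx₂e hdeep₂e α y (hgs_act x₂' α y hy)).2 w hw)
      rw [hsA_eq α]
      exact key
    · rw [hsA0 α (hgs0 x₂' α hex), norm_zero, mul_zero]; exact hBA0
  have hzeroA : ∀ α, α ∉ S x₂' → sA α = 0 := fun α hα =>
    hsA0 α (hgs0 x₂' α fun ⟨y, hy⟩ => hα (hS x₂' hdeep₂e₀ α y hy))
  have hsumA : w * ‖∑ α, sA α‖ ≤ m * BA := by
    rw [← Finset.sum_subset (Finset.subset_univ (S x₂')) (fun α _ hα => hzeroA α hα)]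
    calc w * ‖∑ α ∈ S x₂', sA α‖ ≤ w * ∑ α ∈ S x₂', ‖sA α‖ := mul_le_mul_of_nonneg_left (norm_sum_le _ _) hw0
      _ = ∑ α ∈ S x₂', w * ‖sA α‖ := Finset.mul_sum _ _ _
      _ ≤ ∑ α ∈ S x₂', BA := Finset.sum_le_sum fun α _ => htermA α
      _ = (S x₂').card * BA := by rw [Finset.sum_const, nsmul_eq_mul]
      _ ≤ m * BA := mul_le_mul_of_nonneg_right (hcard x₂') hBA0
  /- TERM B: the derivative member of (1.11)–(1.12) at `⟨x₁, x₁+e_μ⟩` on the difference of the row sources of `x₂'` and `x₁'` -/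
  set Λ₁ : ℝ := K₁ / (R₀ - R₁) + 3 * Real.pi * (d + 1 : ℕ) / (2 * sg) with hΛ₁def
  have hΛ₁0 : 0 ≤ Λ₁ := by rw [hΛ₁def]; positivity
  set dB : ↥(labels (P.L ^ k) M0 sg) → Balaban1983to89.Site P 0 → ℂ := fun α y =>
    ((ζ x₂' y * lamFam hPd (P.L ^ k) c M0 sg α x₂' y - ζ x₁' y * lamFam hPd (P.L ^ k) c M0 sg α x₁' y : ℝ) : ℂ) * f y with hdBdef
  have hdB : ∀ α, gs x₂' α - gs x₁' α = dB α := fun α => by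
    funext y; simp only [hgsdef, hdBdef, Pi.sub_apply]; push_cast; ring
  have hsB_eq : ∀ α, sB α = covD P.eps⁻¹ (cfg U) (G α *ᵥ dB α) ⟨x₁, μ⟩ - covD P.eps⁻¹ (cfg U) (G₀ *ᵥ dB α) ⟨x₁, μ⟩ := fun α => by
    rw [← hdB, covD_mulVec_sub', covD_mulVec_sub']
    simp only [hsBdef]; ring
  have hdB_le : ∀ α y, ‖dB α y‖ ≤ Λ₁ * (((d : ℝ) + 1) * T12) * F := by
    intro α y
    have h1 := abs_weight_shift_sub_le_of_hull (hPd := hPd) (c := c) hs0 hfit0 hN0 hK₁' hζabs hζ1 α.1 hz₁ hz₂ hroom₁ hroom₂ μ y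
    rw [hxz₁, hxz₂] at h1
    simp only [hdBdef]
    rw [norm_mul, Complex.norm_real, Real.norm_eq_abs]
    refine mul_le_mul (h1.trans ?_) (hF y) (norm_nonneg _) (by positivity)
    exact mul_le_mul_of_nonneg_left hl1 hΛ₁0
  have hdB_act : ∀ α y, dB α y ≠ 0 →
      ζ x₂' y * lamFam hPd (P.L ^ k) c M0 sg α x₂' y ≠ 0 ∨ ζ x₁' y * lamFam hPd (P.L ^ k) c M0 sg α x₁' y ≠ 0 := by
    intro α y hy
    by_contra hno
    rw [not_or, not_not, not_not] at hno
    apply hy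
    simp only [hdBdef]; rw [hno.1, hno.2]; simp
  set BB : ℝ := P.spacing k * (c₁ * Real.exp (-(δ * (((P.L : ℝ) ^ k)⁻¹ * D))) *
    Real.exp (-(δ * (((P.L : ℝ) ^ k)⁻¹ * (Dβ + R)))) * (Λ₁ * (((d : ℝ) + 1) * T12) * F)) with hBBdef
  have hBB0 : 0 ≤ BB := by rw [hBBdef]; positivity
  have htermB : ∀ α, ‖sB α‖ ≤ BB := by
    intro α
    by_cases hex : (∃ y, ζ x₂' y * lamFam hPd (P.L ^ k) c M0 sg α x₂' y ≠ 0) ∨ (∃ y, ζ x₁' y * lamFam hPd (P.L ^ k) c M0 sg α x₁' y ≠ 0)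
    · have hx₁d : x₁ ∈ deepRows ρm (cubeB α) ∧ ∀ w, w ∉ cubeB α → Dβ ≤ B5Ineq137Torus.T P 0 x₁ w := by
        rcases hex with hex | hex
        · exact deepq α x₂' hx₂e hdeep₂e hex x₁ (hc2' x₁ hx₁mem)
        · exact deepq α x₁' hx₁e hdeep₁e hex x₁ (hc1' x₁ hx₁mem)
      have hout : ∀ y, y ∉ cubeB α → dB α y = 0 := by
        intro y hy
        by_contra hne'
        rcases hdB_act α y hne' with h1 | h1
        · exact hy (HY x₂' hx₂e hdeep₂e α y h1).1
        · exact hy (HY x₁' hx₁e hdeep₁e α y h1).1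
      have hDf : ∀ y, dB α y ≠ 0 → ∀ w, w ∉ cubeB α → R ≤ B5Ineq137Torus.T P 0 y w := by
        intro y hy w hw
        rcases hdB_act α y hy with h1 | h1
        · exact (HY x₂' hx₂e hdeep₂e α y h1).2 w hw
        · exact (HY x₁' hx₁e hdeep₁e α y h1).2 w hw
      have key := G1 P hPd hPL hk1 hkK hks hsize (cubeB α) Ω (bbHull_bigBlock _ _) hΩ (hsubΩ α) A hec hece₁
        hreg x₁ (hrow_of_deep hx₁d.1) (dB α) (Λ₁ * (((d : ℝ) + 1) * T12) * F) D Dβ R (hdB_le α)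
        hout (fun y hy => hsupp₁ y (right_ne_zero_of_mul hy)) hx₁d.2 hDf μ
      rw [hsB_eq α]
      exact key
    · push Not at hex
      simp only [hsBdef]
      rw [hgs0 x₂' α (not_exists.2 fun y hy => hy (hex.1 y)), hgs0 x₁' α (not_exists.2 fun y hy => hy (hex.2 y))]
      simp only [mulVec_zero, covD_zero', sub_self, norm_zero]
      exact hBB0
  have hzeroB : ∀ α, α ∉ S x₂' ∪ S x₁' → sB α = 0 := by
    intro α hα
    rw [Finset.mem_union, not_or] at hα
    simp only [hsBdef]
    rw [hgs0 x₂' α fun ⟨y, hy⟩ => hα.1 (hS x₂' hdeep₂e₀ α y hy), hgs0 x₁' α fun ⟨y, hy⟩ => hα.2 (hS x₁' hdeep₁e₀ α y hy)]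
    simp only [mulVec_zero, covD_zero', sub_self]
  have hsumB : ‖∑ α, sB α‖ ≤ 2 * m * BB := by
    rw [← Finset.sum_subset (Finset.subset_univ (S x₂' ∪ S x₁')) (fun α _ hα => hzeroB α hα)]
    have hcardU : (((S x₂' ∪ S x₁').card : ℕ) : ℝ) ≤ 2 * m := by
      have h1 : (((S x₂' ∪ S x₁').card : ℕ) : ℝ) ≤ ((S x₂').card : ℝ) + ((S x₁').card : ℝ) := by
        exact_mod_cast Finset.card_union_le _ _
      linarith only [h1, hcard x₂', hcard x₁']
    calc ‖∑ α ∈ S x₂' ∪ S x₁', sB α‖ ≤ ∑ α ∈ S x₂' ∪ S x₁', ‖sB α‖ := norm_sum_le _ _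
      _ ≤ ∑ α ∈ S x₂' ∪ S x₁', BB := Finset.sum_le_sum fun α _ => htermB α
      _ = (S x₂' ∪ S x₁').card * BB := by rw [Finset.sum_const, nsmul_eq_mul]
      _ ≤ 2 * m * BB := mul_le_mul_of_nonneg_right hcardU hBB0
  /- TERM C: the transported difference of the values of `(G_α − G₀)(Δ_μ-source of x₂)` between `x₁` and `x₂`, telescoped ALONG `Γ` -/
  have hds_le : ∀ α y, ‖ds x₂ x₂' α y‖ ≤ Λ₁ * F := fun α y =>
    norm_rowSource_sub_le_of_lipschitz hPd hs0 hfit0 hN0 hK₁' hζabs (fun y => hζ1 x₂ y μ) α.1 hx₂ hx₂e hF y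
  -- the shortened support distance seen from the contour sites
  set D'' : ℝ := max (D - ((d : ℝ) + 1) * T12) 0 with hD''def
  have hD''0 : 0 ≤ D'' := le_max_right _ _
  have hD''supp : ∀ z ∈ x₁ :: l, ∀ y, f y ≠ 0 → D'' ≤ B5Ineq137Torus.T P 0 z y := by
    intro z hz y hy
    refine max_le ?_ (B5Ineq137Torus.T_nonneg P 0 _ y)
    have h1 := hsupp₁ y hy
    have h2 := B5Ineq137Torus.T_triangle P 0 x₁ z y
    linarith only [h1, h2, hc1 z hz]
  have hexpD'' : Real.exp (-(δ * (((P.L : ℝ) ^ k)⁻¹ * D''))) ≤ eβ * E := by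
    have h1 : D - ((d : ℝ) + 1) * T12 ≤ D'' := le_max_left _ _
    have h2 : ((P.L : ℝ) ^ k)⁻¹ * T12 ≤ 1 := by rw [inv_mul_le_iff₀ hLk, mul_one]; exact hnear
    have h3 : -(δ * (((P.L : ℝ) ^ k)⁻¹ * D'')) ≤ ((d : ℝ) + 2) * δ + -(δ / 2 * (((P.L : ℝ) ^ k)⁻¹ * D)) := by
      have h4 : δ * (((P.L : ℝ) ^ k)⁻¹ * (D - ((d : ℝ) + 1) * T12)) ≤ δ * (((P.L : ℝ) ^ k)⁻¹ * D'') :=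
        mul_le_mul_of_nonneg_left (mul_le_mul_of_nonneg_left h1 hLkinv.le) hδ0.le
      have h5 : δ / 2 * (((P.L : ℝ) ^ k)⁻¹ * D) ≤ δ * (((P.L : ℝ) ^ k)⁻¹ * D) := mul_le_mul_of_nonneg_right (by linarith) hεD
      have h6 : δ * (((d : ℝ) + 1) * (((P.L : ℝ) ^ k)⁻¹ * T12)) ≤ δ * (((d : ℝ) + 1) * 1) :=
        mul_le_mul_of_nonneg_left (mul_le_mul_of_nonneg_left h2 (by positivity)) hδ0.le
      have h7 : δ * (((P.L : ℝ) ^ k)⁻¹ * (D - ((d : ℝ) + 1) * T12)) =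
          δ * (((P.L : ℝ) ^ k)⁻¹ * D) - δ * (((d : ℝ) + 1) * (((P.L : ℝ) ^ k)⁻¹ * T12)) := by ring
      have h8 : δ * (((d : ℝ) + 1) * 1) ≤ ((d : ℝ) + 2) * δ := by nlinarith only [hδ0]
      linarith only [h4, h5, h6, h7, h8]
    calc Real.exp (-(δ * (((P.L : ℝ) ^ k)⁻¹ * D''))) ≤ Real.exp (((d : ℝ) + 2) * δ + -(δ / 2 * (((P.L : ℝ) ^ k)⁻¹ * D))) :=
          Real.exp_le_exp.2 h3
      _ = eβ * E := by rw [Real.exp_add]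
  set BC : ℝ := P.spacing k * (c₁ * Real.exp (-(δ * (((P.L : ℝ) ^ k)⁻¹ * D''))) *
    Real.exp (-(δ * (((P.L : ℝ) ^ k)⁻¹ * (Dβ + R)))) * (Λ₁ * F)) with hBCdef
  have hBC0 : 0 ≤ BC := by rw [hBCdef]; positivity
  have htermC : ∀ α, ‖sC α‖ ≤ BC * (((d : ℝ) + 1) * T12) := by
    intro α
    by_cases hex : (∃ y, ζ x₂' y * lamFam hPd (P.L ^ k) c M0 sg α x₂' y ≠ 0) ∨ (∃ y, ζ x₂ y * lamFam hPd (P.L ^ k) c M0 sg α x₂ y ≠ 0)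
    · -- every contour site is a `rowMargin`-deep row of the hull seeing `T ∖ hull` at distance `≥ Dβ`
      have hzdeep : ∀ z ∈ x₁ :: l, z ∈ deepRows ρm (cubeB α) ∧ ∀ w, w ∉ cubeB α → Dβ ≤ B5Ineq137Torus.T P 0 z w := by
        intro z hz
        rcases hex with hex | hex
        · exact deepq α x₂' hx₂e hdeep₂e hex z (hc2' z hz)
        · exact deepq α x₂ hx₂ hdeep₂ hex z (hc2t z hz)
      have hout : ∀ y, y ∉ cubeB α → ds x₂ x₂' α y = 0 := by
        intro y hy
        by_contra hne'
        rcases hds_act x₂ x₂' α y hne' with h1 | h1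
        · exact hy (HY x₂' hx₂e hdeep₂e α y h1).1
        · exact hy (HY x₂ hx₂ hdeep₂ α y h1).1
      have hDf : ∀ y, ds x₂ x₂' α y ≠ 0 → ∀ w, w ∉ cubeB α → R ≤ B5Ineq137Torus.T P 0 y w := by
        intro y hy w hw
        rcases hds_act x₂ x₂' α y hy with h1 | h1
        · exact (HY x₂' hx₂e hdeep₂e α y h1).2 w hw
        · exact (HY x₂ hx₂ hdeep₂ α y h1).2 w hw
      have hbond : ∀ z ∈ x₁ :: l, ∀ ν : Fin P.d,
          ‖covD P.eps⁻¹ (cfg (expGauge P e A)) (G α *ᵥ ds x₂ x₂' α - G₀ *ᵥ ds x₂ x₂' α) ⟨z, ν⟩‖ ≤ BC := by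
        intro z hz ν
        have key := G1 P hPd hPL hk1 hkK hks hsize (cubeB α) Ω (bbHull_bigBlock _ _) hΩ (hsubΩ α) A hec hece₁
          hreg z (hrow_of_deep (hzdeep z hz).1) (ds x₂ x₂' α) (Λ₁ * F) D'' Dβ R (hds_le α)
          hout (fun y hy => hD''supp z hz y (hds_supp x₂ x₂' α y hy)) (hzdeep z hz).2 hDf ν
        rw [covD_sub']
        exact key
      have htel := norm_holA_mul_sub_le hS2 e A (G α *ᵥ ds x₂ x₂' α - G₀ *ᵥ ds x₂ x₂' α) hBC0 x₁ l hch hbond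
      rw [hend] at htel
      have e1 : sC α = Ec * (τ * (G α *ᵥ ds x₂ x₂' α - G₀ *ᵥ ds x₂ x₂' α) x₂ - (G α *ᵥ ds x₂ x₂' α - G₀ *ᵥ ds x₂ x₂' α) x₁) := by
        simp only [hsCdef, Pi.sub_apply]; ring
      rw [e1, norm_mul, hEc]
      calc P.eps⁻¹ * ‖τ * (G α *ᵥ ds x₂ x₂' α - G₀ *ᵥ ds x₂ x₂' α) x₂ - (G α *ᵥ ds x₂ x₂' α - G₀ *ᵥ ds x₂ x₂' α) x₁‖
          ≤ P.eps⁻¹ * (P.eps * l.length * BC) := mul_le_mul_of_nonneg_left htel (inv_pos.mpr heps).le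
        _ = l.length * BC := by field_simp
        _ ≤ (((d : ℝ) + 1) * T12) * BC := mul_le_mul_of_nonneg_right hlenT hBC0
        _ = BC * (((d : ℝ) + 1) * T12) := mul_comm _ _
    · push Not at hex
      simp only [hsCdef]
      rw [hds0 x₂ x₂' α (not_exists.2 fun y hy => hy (hex.1 y)) (not_exists.2 fun y hy => hy (hex.2 y))]
      simp only [mulVec_zero, Pi.zero_apply, mul_zero, sub_zero, norm_zero]
      positivity
  have hzeroC : ∀ α, α ∉ S x₂' ∪ S x₂ → sC α = 0 := by
    intro α hα
    rw [Finset.mem_union, not_or] at hα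
    simp only [hsCdef]
    rw [hds0 x₂ x₂' α (fun ⟨y, hy⟩ => hα.1 (hS x₂' hdeep₂e₀ α y hy)) (fun ⟨y, hy⟩ => hα.2 (hS x₂ hdeep₂₀ α y hy))]
    simp only [mulVec_zero, Pi.zero_apply, mul_zero, sub_zero]
  have hsumC : ‖∑ α, sC α‖ ≤ 2 * m * (BC * (((d : ℝ) + 1) * T12)) := by
    rw [← Finset.sum_subset (Finset.subset_univ (S x₂' ∪ S x₂)) (fun α _ hα => hzeroC α hα)]
    have hcardU : (((S x₂' ∪ S x₂).card : ℕ) : ℝ) ≤ 2 * m := by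
      have h1 : (((S x₂' ∪ S x₂).card : ℕ) : ℝ) ≤ ((S x₂').card : ℝ) + ((S x₂).card : ℝ) := by
        exact_mod_cast Finset.card_union_le _ _
      linarith only [h1, hcard x₂', hcard x₂]
    calc ‖∑ α ∈ S x₂' ∪ S x₂, sC α‖ ≤ ∑ α ∈ S x₂' ∪ S x₂, ‖sC α‖ := norm_sum_le _ _
      _ ≤ ∑ α ∈ S x₂' ∪ S x₂, BC * (((d : ℝ) + 1) * T12) := Finset.sum_le_sum fun α _ => htermC α
      _ = (S x₂' ∪ S x₂).card * (BC * (((d : ℝ) + 1) * T12)) := by rw [Finset.sum_const, nsmul_eq_mul]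
      _ ≤ 2 * m * (BC * (((d : ℝ) + 1) * T12)) := mul_le_mul_of_nonneg_right hcardU (by positivity)
  /- TERM D: the value member of (1.11)–(1.12), on the difference of the bond-difference sources of `x₂` and `x₁` -/
  set Λ₂ : ℝ := K₂ / (R₀ - R₁) ^ 2 + 4 * Real.pi ^ 2 / (sg : ℝ) ^ 2 + 2 * (K₁ / (R₀ - R₁) * (3 * Real.pi * (d + 1 : ℕ) / (2 * sg)))
    with hΛ₂def
  have hΛ₂0 : 0 ≤ Λ₂ := by rw [hΛ₂def]; positivity
  set dD : ↥(labels (P.L ^ k) M0 sg) → Balaban1983to89.Site P 0 → ℂ := fun α y =>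
    (((ζ x₂' y * lamFam hPd (P.L ^ k) c M0 sg α x₂' y - ζ x₂ y * lamFam hPd (P.L ^ k) c M0 sg α x₂ y) -
        (ζ x₁' y * lamFam hPd (P.L ^ k) c M0 sg α x₁' y - ζ x₁ y * lamFam hPd (P.L ^ k) c M0 sg α x₁ y) : ℝ) : ℂ) * f y with hdDdef
  have hdD : ∀ α, ds x₂ x₂' α - ds x₁ x₁' α = dD α := fun α => by
    funext y; simp only [hdsdef, hdDdef, Pi.sub_apply]; push_cast; ring
  have hsD_eq : ∀ α, sD α = Ec * ((G α *ᵥ dD α) x₁ - (G₀ *ᵥ dD α) x₁) := fun α => by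
    rw [← hdD, Matrix.mulVec_sub, Matrix.mulVec_sub]
    simp only [hsDdef, Pi.sub_apply]; ring
  have hdD_le : ∀ α y, ‖dD α y‖ ≤ Λ₂ * (((d : ℝ) + 1) * T12) * F := by
    intro α y
    have h1 := abs_weight_bondDiff_sub_le_of_hull (hPd := hPd) (c := c) hs0 hfit0 hN0 hζabs hζ1 hζ2 α.1 hz₁ hz₂ hroom₁ hroom₂ μ y
    rw [hxz₁, hxz₂] at h1
    simp only [hdDdef]
    rw [norm_mul, Complex.norm_real, Real.norm_eq_abs]
    refine mul_le_mul (h1.trans ?_) (hF y) (norm_nonneg _) (by positivity)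
    exact mul_le_mul_of_nonneg_left hl1 hΛ₂0
  have hdD_act : ∀ α y, dD α y ≠ 0 →
      (ζ x₂' y * lamFam hPd (P.L ^ k) c M0 sg α x₂' y ≠ 0 ∨ ζ x₂ y * lamFam hPd (P.L ^ k) c M0 sg α x₂ y ≠ 0) ∨
      (ζ x₁' y * lamFam hPd (P.L ^ k) c M0 sg α x₁' y ≠ 0 ∨ ζ x₁ y * lamFam hPd (P.L ^ k) c M0 sg α x₁ y ≠ 0) := by
    intro α y hy
    by_contra hno
    simp only [not_or, not_not] at hno
    apply hy
    simp only [hdDdef]; rw [hno.1.1, hno.1.2, hno.2.1, hno.2.2]; simp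
  set BD : ℝ := P.spacing k ^ 2 * (c₂ * Real.exp (-(δ * (((P.L : ℝ) ^ k)⁻¹ * D))) *
    Real.exp (-(δ * (((P.L : ℝ) ^ k)⁻¹ * (Dβ + R)))) * (Λ₂ * (((d : ℝ) + 1) * T12) * F)) with hBDdef
  have hBD0 : 0 ≤ BD := by rw [hBDdef]; positivity
  have htermD : ∀ α, ‖sD α‖ ≤ P.eps⁻¹ * BD := by
    intro α
    by_cases hex : ((∃ y, ζ x₂' y * lamFam hPd (P.L ^ k) c M0 sg α x₂' y ≠ 0) ∨ (∃ y, ζ x₂ y * lamFam hPd (P.L ^ k) c M0 sg α x₂ y ≠ 0)) ∨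
        ((∃ y, ζ x₁' y * lamFam hPd (P.L ^ k) c M0 sg α x₁' y ≠ 0) ∨ (∃ y, ζ x₁ y * lamFam hPd (P.L ^ k) c M0 sg α x₁ y ≠ 0))
    · have hx₁d : x₁ ∈ deepRows ρm (cubeB α) ∧ ∀ w, w ∉ cubeB α → Dβ ≤ B5Ineq137Torus.T P 0 x₁ w := by
        rcases hex with (hex | hex) | (hex | hex)
        · exact deepq α x₂' hx₂e hdeep₂e hex x₁ (hc2' x₁ hx₁mem)
        · exact deepq α x₂ hx₂ hdeep₂ hex x₁ (hc2t x₁ hx₁mem)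
        · exact deepq α x₁' hx₁e hdeep₁e hex x₁ (hc1' x₁ hx₁mem)
        · exact deepq α x₁ hx₁ hdeep₁ hex x₁ (hc1t x₁ hx₁mem)
      have hout : ∀ y, y ∉ cubeB α → dD α y = 0 := by
        intro y hy
        by_contra hne'
        rcases hdD_act α y hne' with (h1 | h1) | (h1 | h1)
        · exact hy (HY x₂' hx₂e hdeep₂e α y h1).1
        · exact hy (HY x₂ hx₂ hdeep₂ α y h1).1
        · exact hy (HY x₁' hx₁e hdeep₁e α y h1).1
        · exact hy (HY x₁ hx₁ hdeep₁ α y h1).1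
      have hDf : ∀ y, dD α y ≠ 0 → ∀ w, w ∉ cubeB α → R ≤ B5Ineq137Torus.T P 0 y w := by
        intro y hy w hw
        rcases hdD_act α y hy with (h1 | h1) | (h1 | h1)
        · exact (HY x₂' hx₂e hdeep₂e α y h1).2 w hw
        · exact (HY x₂ hx₂ hdeep₂ α y h1).2 w hw
        · exact (HY x₁' hx₁e hdeep₁e α y h1).2 w hw
        · exact (HY x₁ hx₁ hdeep₁ α y h1).2 w hw
      have key := I3 (cubeB α) (bbHull_bigBlock _ _) (hsubΩ α) x₁ hx₁d.1 (dD α) (Λ₂ * (((d : ℝ) + 1) * T12) * F) D Dβ R (hdD_le α) hout hD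
        (fun y hy => hsupp₁ y (right_ne_zero_of_mul hy)) hDβ0 hx₁d.2 hR0 hDf
      rw [hsD_eq α, norm_mul, hEc]
      refine mul_le_mul_of_nonneg_left ?_ (inv_pos.mpr heps).le
      exact key
    · push Not at hex
      simp only [hsDdef]
      rw [hds0 x₂ x₂' α (not_exists.2 fun y hy => hy (hex.1.1 y)) (not_exists.2 fun y hy => hy (hex.1.2 y)),
        hds0 x₁ x₁' α (not_exists.2 fun y hy => hy (hex.2.1 y)) (not_exists.2 fun y hy => hy (hex.2.2 y))]
      simp only [mulVec_zero, Pi.zero_apply, mul_zero, sub_self, norm_zero]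
      positivity
  have hzeroD : ∀ α, α ∉ (S x₂' ∪ S x₂) ∪ (S x₁' ∪ S x₁) → sD α = 0 := by
    intro α hα
    simp only [Finset.mem_union, not_or] at hα
    simp only [hsDdef]
    rw [hds0 x₂ x₂' α (fun ⟨y, hy⟩ => hα.1.1 (hS x₂' hdeep₂e₀ α y hy)) (fun ⟨y, hy⟩ => hα.1.2 (hS x₂ hdeep₂₀ α y hy)),
      hds0 x₁ x₁' α (fun ⟨y, hy⟩ => hα.2.1 (hS x₁' hdeep₁e₀ α y hy)) (fun ⟨y, hy⟩ => hα.2.2 (hS x₁ hdeep₁₀ α y hy))]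
    simp only [mulVec_zero, Pi.zero_apply, mul_zero, sub_self]
  have hsumD : ‖∑ α, sD α‖ ≤ 4 * m * (P.eps⁻¹ * BD) := by
    rw [← Finset.sum_subset (Finset.subset_univ ((S x₂' ∪ S x₂) ∪ (S x₁' ∪ S x₁))) (fun α _ hα => hzeroD α hα)]
    have hcardU : (((((S x₂' ∪ S x₂) ∪ (S x₁' ∪ S x₁)).card : ℕ)) : ℝ) ≤ 4 * m := by
      have h1 : ((((S x₂' ∪ S x₂) ∪ (S x₁' ∪ S x₁)).card : ℕ) : ℝ) ≤ (((S x₂' ∪ S x₂).card : ℕ) : ℝ) + (((S x₁' ∪ S x₁).card : ℕ) : ℝ) := by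
        exact_mod_cast Finset.card_union_le _ _
      have h2 : (((S x₂' ∪ S x₂).card : ℕ) : ℝ) ≤ ((S x₂').card : ℝ) + ((S x₂).card : ℝ) := by exact_mod_cast Finset.card_union_le _ _
      have h3 : (((S x₁' ∪ S x₁).card : ℕ) : ℝ) ≤ ((S x₁').card : ℝ) + ((S x₁).card : ℝ) := by exact_mod_cast Finset.card_union_le _ _
      linarith only [h1, h2, h3, hcard x₂', hcard x₂, hcard x₁', hcard x₁]
    calc ‖∑ α ∈ (S x₂' ∪ S x₂) ∪ (S x₁' ∪ S x₁), sD α‖ ≤ ∑ α ∈ (S x₂' ∪ S x₂) ∪ (S x₁' ∪ S x₁), ‖sD α‖ := norm_sum_le _ _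
      _ ≤ ∑ α ∈ (S x₂' ∪ S x₂) ∪ (S x₁' ∪ S x₁), P.eps⁻¹ * BD := Finset.sum_le_sum fun α _ => htermD α
      _ = ((S x₂' ∪ S x₂) ∪ (S x₁' ∪ S x₁)).card * (P.eps⁻¹ * BD) := by rw [Finset.sum_const, nsmul_eq_mul]
      _ ≤ 4 * m * (P.eps⁻¹ * BD) := mul_le_mul_of_nonneg_right hcardU (by positivity)
  /- THE TAIL PART: the sources `(ζ″ − 1)f`, `Δζ″·f`, `Δ²ζ″·f` live at torus distance `> R₁ − 1` from `x₁` or `x₂` -/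
  set Dt : ℝ := max (max (D - ((d : ℝ) + 1) * (P.L : ℝ) ^ k) (R₁ - 1 - ((d : ℝ) + 2) * (P.L : ℝ) ^ k)) 0 with hDtdef
  have hDt0 : 0 ≤ Dt := le_max_right _ _
  have htail : ∀ z ∈ x₁ :: l, ∀ y, f y ≠ 0 →
      (R₁ - 1 < B5Ineq137Torus.T P 0 x₁ y ∨ R₁ - 1 < B5Ineq137Torus.T P 0 x₂ y) → Dt ≤ B5Ineq137Torus.T P 0 z y := by
    intro z hz y hy hfar
    have h1 := hsupp₁ y hy
    have h2 := B5Ineq137Torus.T_triangle P 0 x₁ z y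
    have h3 := B5Ineq137Torus.T_triangle P 0 x₂ z y
    have h4 := hc1 z hz
    have h5 := hc2 z hz
    have h6 : ((d : ℝ) + 1) * T12 ≤ ((d : ℝ) + 1) * (P.L : ℝ) ^ k := mul_le_mul_of_nonneg_left hnear (by positivity)
    refine max_le (max_le ?_ ?_) (B5Ineq137Torus.T_nonneg P 0 z y)
    · linarith only [h1, h2, h4, h6]
    · rcases hfar with h7 | h7
      · linarith only [h7, h2, h4, h6, hdT, hT0]
      · linarith only [h7, h3, h5, hdT]
  have hexpt : ∀ {δ'}, δ ≤ δ' → Real.exp (-(δ' * (((P.L : ℝ) ^ k)⁻¹ * Dt))) ≤ eβ * (E * ER1) := by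
    intro δ' hδ'
    have hx0 : 0 ≤ ((P.L : ℝ) ^ k)⁻¹ * Dt := mul_nonneg hLkinv.le hDt0
    refine (Real.exp_le_exp.2 (neg_le_neg (mul_le_mul_of_nonneg_right hδ' hx0))).trans ?_
    rw [heβdef, hEdef, hER1def, ← Real.exp_add, ← Real.exp_add]
    refine Real.exp_le_exp.2 ?_
    have h1 : D - ((d : ℝ) + 1) * (P.L : ℝ) ^ k ≤ Dt := (le_max_left _ _).trans (le_max_left _ _)
    have h2 : R₁ - 1 - ((d : ℝ) + 2) * (P.L : ℝ) ^ k ≤ Dt := (le_max_right _ _).trans (le_max_left _ _)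
    have hsum : D + (R₁ - 1) - (2 * (d : ℝ) + 3) * (P.L : ℝ) ^ k ≤ 2 * Dt := by linarith only [h1, h2]
    have h3 := mul_le_mul_of_nonneg_left hsum (mul_nonneg hδ0.le hLkinv.le)
    have e3 : δ * ((P.L : ℝ) ^ k)⁻¹ * (D + (R₁ - 1) - (2 * (d : ℝ) + 3) * (P.L : ℝ) ^ k) =
        δ * (((P.L : ℝ) ^ k)⁻¹ * D) + δ * (((P.L : ℝ) ^ k)⁻¹ * (R₁ - 1)) - δ * (2 * (d : ℝ) + 3) * (((P.L : ℝ) ^ k)⁻¹ * (P.L : ℝ) ^ k) := by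
      ring
    have e4 : δ * ((P.L : ℝ) ^ k)⁻¹ * (2 * Dt) = 2 * (δ * (((P.L : ℝ) ^ k)⁻¹ * Dt)) := by ring
    rw [e3, e4, hLLk, mul_one] at h3
    have h8 : δ * (2 * (d : ℝ) + 3) ≤ 2 * (((d : ℝ) + 2) * δ) := by nlinarith only [hδ0, hdpos]
    linarith only [h3, h8]
  have hne1 : ∀ (p : Balaban1983to89.Site P 0) (y : Balaban1983to89.Site P 0), ζ (p.shift μ) y ≠ 1 →
      R₁ - 1 < B5Ineq137Torus.T P 0 p y := by
    intro p y hz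
    have hgt : R₁ < B5Ineq137Torus.T P 0 (p.shift μ) y := lt_of_not_ge fun hle => hz (hζR₁ (p.shift μ) y hle)
    have h1 := abs_le.1 (abs_T_shift_sub_le p y μ)
    linarith
  have hne1' : ∀ (p : Balaban1983to89.Site P 0) (y : Balaban1983to89.Site P 0), ζ p y ≠ 1 → R₁ - 1 < B5Ineq137Torus.T P 0 p y := by
    intro p y hz
    have hgt : R₁ < B5Ineq137Torus.T P 0 p y := lt_of_not_ge fun hle => hz (hζR₁ p y hle)
    linarith
  /- TERM A″: [7] (1.9) on `Ω` at the regular `u`, on the tail source `(ζ″(x₂',·) − 1)f` -/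
  set BtA : ℝ := P.spacing k * (cH * Real.exp (-(δ₄ * (((P.L : ℝ) ^ k)⁻¹ * Dt))) * (2 * F)) with hBtAdef
  have htermtA : w * ‖tA‖ ≤ BtA := by
    have hsq₁ : ∀ y, q' x₂' y ≠ 0 → Dt ≤ B5Ineq137Torus.T P 0 x₁ y := fun y hy => by
      obtain ⟨hf, hT⟩ := T_gt_of_tail_ne_zero' hζR₁ x₂ μ hy
      exact htail x₁ hx₁mem y hf (Or.inr hT)
    have hsq₂ : ∀ y, q' x₂' y ≠ 0 → Dt ≤ B5Ineq137Torus.T P 0 x₂ y := fun y hy => by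
      obtain ⟨hf, hT⟩ := T_gt_of_tail_ne_zero' hζR₁ x₂ μ hy
      exact htail x₂ hx₂mem y hf (Or.inr hT)
    have key := GH P hPd hPL hk1 hkK hks hsize Ω hΩ A hec heceH hreg μ x₁ x₂ hne (hrowΩ_of hx₁Ω) (hrowΩ_of hx₂Ω) l hch hend hlen' (q' x₂') (2 * F) Dt
      (fun y => norm_tail_le' hζabs x₂' hF y) hsq₁ hsq₂
    rw [htAdef, hG₀def]
    exact key
  /- TERM B″: (1.10)'s derivative member on `Ω` at `⟨x₁, x₁+e_μ⟩`, on `(ζ″(x₂',·) − ζ″(x₁',·))f` -/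
  set dqB : Balaban1983to89.Site P 0 → ℂ := fun y => ((ζ x₂' y : ℂ) - (ζ x₁' y : ℂ)) * f y with hdqBdef
  have hdqB : q' x₂' - q' x₁' = dqB := by funext y; simp only [hq'def, hdqBdef, Pi.sub_apply]; ring
  have htB_eq : tB = covD P.eps⁻¹ (cfg U) (G₀ *ᵥ dqB) ⟨x₁, μ⟩ := by rw [← hdqB, covD_mulVec_sub']
  have hdqB_le : ∀ y, ‖dqB y‖ ≤ K₁ / (R₀ - R₁) * (((d : ℝ) + 1) * T12) * F := by
    intro y
    have h1 := abs_zeta_shift_sub_le_of_hull hPd (n := P.L ^ k) (c := c) hζ1 z₁ z₂ μ y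
    rw [hxz₁, hxz₂] at h1
    simp only [hdqBdef]
    rw [norm_mul, ← Complex.ofReal_sub, Complex.norm_real, Real.norm_eq_abs]
    refine mul_le_mul (h1.trans ?_) (hF y) (norm_nonneg _) (by positivity)
    exact mul_le_mul_of_nonneg_left hl1 hK₁'
  have hdqB_supp : ∀ y, dqB y ≠ 0 → Dt ≤ B5Ineq137Torus.T P 0 x₁ y := by
    intro y hy
    have hf : f y ≠ 0 := right_ne_zero_of_mul hy
    refine htail x₁ hx₁mem y hf ?_
    by_contra hno
    rw [not_or] at hno
    have h2 : ζ x₂' y = 1 := by by_contra h; exact hno.2 (hne1 x₂ y h)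
    have h1 : ζ x₁' y = 1 := by by_contra h; exact hno.1 (hne1 x₁ y h)
    apply hy
    simp only [hdqBdef]; rw [h1, h2]; simp
  set BtB : ℝ := P.spacing k * (c₃ * Real.exp (-(δ₄ * (((P.L : ℝ) ^ k)⁻¹ * Dt))) *
    (K₁ / (R₀ - R₁) * (((d : ℝ) + 1) * T12) * F)) with hBtBdef
  have htermtB : ‖tB‖ ≤ BtB := by
    have key := G3 P hPd hPL hk1 hkK hks hsize Ω hΩ A hec hece₃ hreg x₁ (hrowΩ_of hx₁Ω) dqB (K₁ / (R₀ - R₁) * (((d : ℝ) + 1) * T12) * F) Dt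
      hdqB_le hdqB_supp μ
    rw [htB_eq, hG₀def]
    exact key
  /- TERM C″: the transported difference of the values of `G₀(Δ_μζ″(x₂,·)f)` between `x₁` and `x₂`, telescoped ALONG `Γ` -/
  have hdq_le : ∀ y, ‖dq x₂ x₂' y‖ ≤ K₁ / (R₀ - R₁) * F := fun y => norm_tailDiff_le' hK₁' (fun y => hζ1 x₂ y μ) hF y
  set BtC : ℝ := P.spacing k * (c₃ * Real.exp (-(δ₄ * (((P.L : ℝ) ^ k)⁻¹ * Dt))) * (K₁ / (R₀ - R₁) * F)) with hBtCdef
  have hBtC0 : 0 ≤ BtC := by rw [hBtCdef]; positivity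
  have htermtC : ‖tC‖ ≤ BtC * (((d : ℝ) + 1) * T12) := by
    have hbond : ∀ z ∈ x₁ :: l, ∀ ν : Fin P.d, ‖covD P.eps⁻¹ (cfg (expGauge P e A)) (G₀ *ᵥ dq x₂ x₂') ⟨z, ν⟩‖ ≤ BtC := by
      intro z hz ν
      have hsq : ∀ y, dq x₂ x₂' y ≠ 0 → Dt ≤ B5Ineq137Torus.T P 0 z y := fun y hy => by
        obtain ⟨hf, hT⟩ := T_gt_of_tailDiff_ne_zero' hζR₁ x₂ μ hy
        exact htail z hz y hf (Or.inr hT)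
      have key := G3 P hPd hPL hk1 hkK hks hsize Ω hΩ A hec hece₃ hreg z (hrowΩ_of (hzΩ z hz)) (dq x₂ x₂') (K₁ / (R₀ - R₁) * F) Dt hdq_le hsq ν
      rw [hG₀def]
      exact key
    have htel := norm_holA_mul_sub_le hS2 e A (G₀ *ᵥ dq x₂ x₂') hBtC0 x₁ l hch hbond
    rw [hend] at htel
    have e1 : tC = Ec * (τ * (G₀ *ᵥ dq x₂ x₂') x₂ - (G₀ *ᵥ dq x₂ x₂') x₁) := by simp only [htCdef]; ring
    rw [e1, norm_mul, hEc]
    calc P.eps⁻¹ * ‖τ * (G₀ *ᵥ dq x₂ x₂') x₂ - (G₀ *ᵥ dq x₂ x₂') x₁‖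
        ≤ P.eps⁻¹ * (P.eps * l.length * BtC) := mul_le_mul_of_nonneg_left htel (inv_pos.mpr heps).le
      _ = l.length * BtC := by field_simp
      _ ≤ (((d : ℝ) + 1) * T12) * BtC := mul_le_mul_of_nonneg_right hlenT hBtC0
      _ = BtC * (((d : ℝ) + 1) * T12) := mul_comm _ _
  /- TERM D″: (1.10)'s value member on `Ω`, on the second difference of `ζ″` times `f` -/
  set dqD : Balaban1983to89.Site P 0 → ℂ := fun y =>
    (((ζ x₂' y - ζ x₂ y) - (ζ x₁' y - ζ x₁ y) : ℝ) : ℂ) * f y with hdqDdef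
  have hdqD : dq x₂ x₂' - dq x₁ x₁' = dqD := by
    funext y; simp only [hdqdef, hdqDdef, Pi.sub_apply]; push_cast; ring
  have htD_eq : tD = Ec * (G₀ *ᵥ dqD) x₁ := by
    rw [← hdqD, Matrix.mulVec_sub]
    simp only [htDdef, Pi.sub_apply]; ring
  have hdqD_le : ∀ y, ‖dqD y‖ ≤ K₂ / (R₀ - R₁) ^ 2 * (((d : ℝ) + 1) * T12) * F := by
    intro y
    have h1 := abs_zeta_bondDiff_sub_le_of_hull hPd (n := P.L ^ k) (c := c) hζ2 z₁ z₂ μ y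
    rw [hxz₁, hxz₂] at h1
    simp only [hdqDdef]
    rw [norm_mul, Complex.norm_real, Real.norm_eq_abs]
    refine mul_le_mul (h1.trans ?_) (hF y) (norm_nonneg _) (by positivity)
    exact mul_le_mul_of_nonneg_left hl1 hK₂'
  have hdqD_supp : ∀ y, dqD y ≠ 0 → Dt ≤ B5Ineq137Torus.T P 0 x₁ y := by
    intro y hy
    have hf : f y ≠ 0 := right_ne_zero_of_mul hy
    refine htail x₁ hx₁mem y hf ?_
    by_contra hno
    rw [not_or] at hno
    have h2' : ζ x₂' y = 1 := by by_contra h; exact hno.2 (hne1 x₂ y h)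
    have h2 : ζ x₂ y = 1 := by by_contra h; exact hno.2 (hne1' x₂ y h)
    have h1' : ζ x₁' y = 1 := by by_contra h; exact hno.1 (hne1 x₁ y h)
    have h1 : ζ x₁ y = 1 := by by_contra h; exact hno.1 (hne1' x₁ y h)
    apply hy
    simp only [hdqDdef]; rw [h1, h2, h1', h2']; simp
  set BtD : ℝ := P.spacing k ^ 2 * (c₂ * Real.exp (-(δ * (((P.L : ℝ) ^ k)⁻¹ * Dt))) *
    (K₂ / (R₀ - R₁) ^ 2 * (((d : ℝ) + 1) * T12) * F)) with hBtDdef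
  have htermtD : ‖tD‖ ≤ P.eps⁻¹ * BtD := by
    have key := I2 x₁ hx₁Ω dqD (K₂ / (R₀ - R₁) ^ 2 * (((d : ℝ) + 1) * T12) * F) Dt hdqD_le hDt0 hdqD_supp
    rw [htD_eq, norm_mul, hEc, hG₀def]
    refine mul_le_mul_of_nonneg_left ?_ (inv_pos.mpr heps).le
    exact key
  /- ASSEMBLY -/
  have hscale : P.eps⁻¹ * P.spacing k ^ 2 = P.spacing k * (P.L : ℝ) ^ k := by
    rw [Params.spacing]
    field_simp
  -- the Lipschitz moduli against the bracket: `L^k·Λ₁ ≤ Λ₀·br`, `(L^k)²·Λ₂ ≤ Λ₀₂·br²`, `L^k·K₁/(R₀−R₁) ≤ K₁·br`, `(L^k)²K₂/(R₀−R₁)² ≤ K₂·br²`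
  have hΛ₁le : (P.L : ℝ) ^ k * Λ₁ ≤ Λ₀ * br := by
    have h1 : Λ₁ ≤ Λ₀ * uv := by
      rw [hΛ₁def, huvdef, mul_add]
      refine add_le_add ?_ ?_
      · rw [div_eq_mul_inv]
        exact mul_le_mul_of_nonneg_right (le_max_left _ _) (inv_pos.mpr hgap').le
      · have e5 : 3 * Real.pi * (d + 1 : ℕ) / (2 * sg) = (3 * Real.pi * (d + 1 : ℕ) / 2) * (sg : ℝ)⁻¹ := by
          field_simp
        rw [e5]
        exact mul_le_mul_of_nonneg_right (le_max_right _ _) (inv_pos.mpr hsr).le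
    calc (P.L : ℝ) ^ k * Λ₁ ≤ (P.L : ℝ) ^ k * (Λ₀ * uv) := mul_le_mul_of_nonneg_left h1 hLk.le
      _ = Λ₀ * ((P.L : ℝ) ^ k * uv) := by ring
      _ ≤ Λ₀ * br := mul_le_mul_of_nonneg_left hLuv hΛ₀0
  have hΛ₂le : ((P.L : ℝ) ^ k) ^ 2 * Λ₂ ≤ Λ₀₂ * br ^ 2 := by
    have hu : 0 ≤ (R₀ - R₁)⁻¹ := (inv_pos.mpr hgap').le
    have hv : 0 ≤ (sg : ℝ)⁻¹ := (inv_pos.mpr hsr).le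
    have h1 : Λ₂ ≤ Λ₀₂ * uv ^ 2 := by
      rw [hΛ₂def, hΛ₀₂def, huvdef]
      have e1 : K₂ / (R₀ - R₁) ^ 2 = K₂ * ((R₀ - R₁)⁻¹) ^ 2 := by rw [div_eq_mul_inv, inv_pow]
      have e2 : 4 * Real.pi ^ 2 / (sg : ℝ) ^ 2 = 4 * Real.pi ^ 2 * ((sg : ℝ)⁻¹) ^ 2 := by rw [div_eq_mul_inv, inv_pow]
      have e3 : 2 * (K₁ / (R₀ - R₁) * (3 * Real.pi * (d + 1 : ℕ) / (2 * sg))) =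
          3 * Real.pi * (d + 1 : ℕ) * K₁ * ((R₀ - R₁)⁻¹ * (sg : ℝ)⁻¹) := by
        rw [div_eq_mul_inv, div_eq_mul_inv, mul_inv]
        ring
      rw [e1, e2, e3]
      have hq1 : ((R₀ - R₁)⁻¹) ^ 2 ≤ ((R₀ - R₁)⁻¹ + (sg : ℝ)⁻¹) ^ 2 := pow_le_pow_left₀ hu (le_add_of_nonneg_right hv) 2
      have hq2 : ((sg : ℝ)⁻¹) ^ 2 ≤ ((R₀ - R₁)⁻¹ + (sg : ℝ)⁻¹) ^ 2 := pow_le_pow_left₀ hv (le_add_of_nonneg_left hu) 2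
      have hq3 : (R₀ - R₁)⁻¹ * (sg : ℝ)⁻¹ ≤ ((R₀ - R₁)⁻¹ + (sg : ℝ)⁻¹) ^ 2 := by
        have e4 : ((R₀ - R₁)⁻¹ + (sg : ℝ)⁻¹) ^ 2 =
            (R₀ - R₁)⁻¹ * (sg : ℝ)⁻¹ + (((R₀ - R₁)⁻¹) ^ 2 + (R₀ - R₁)⁻¹ * (sg : ℝ)⁻¹ + ((sg : ℝ)⁻¹) ^ 2) := by ring
        rw [e4]
        exact le_add_of_nonneg_right (by positivity)
      have hπ : 0 ≤ 4 * Real.pi ^ 2 := by positivity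
      have hπK : 0 ≤ 3 * Real.pi * (d + 1 : ℕ) * K₁ := by positivity
      calc K₂ * ((R₀ - R₁)⁻¹) ^ 2 + 4 * Real.pi ^ 2 * ((sg : ℝ)⁻¹) ^ 2 + 3 * Real.pi * (d + 1 : ℕ) * K₁ * ((R₀ - R₁)⁻¹ * (sg : ℝ)⁻¹)
          ≤ K₂ * ((R₀ - R₁)⁻¹ + (sg : ℝ)⁻¹) ^ 2 + 4 * Real.pi ^ 2 * ((R₀ - R₁)⁻¹ + (sg : ℝ)⁻¹) ^ 2 +
            3 * Real.pi * (d + 1 : ℕ) * K₁ * ((R₀ - R₁)⁻¹ + (sg : ℝ)⁻¹) ^ 2 :=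
            add_le_add (add_le_add (mul_le_mul_of_nonneg_left hq1 hK₂) (mul_le_mul_of_nonneg_left hq2 hπ))
              (mul_le_mul_of_nonneg_left hq3 hπK)
        _ = (K₂ + 4 * Real.pi ^ 2 + 3 * Real.pi * (d + 1 : ℕ) * K₁) * ((R₀ - R₁)⁻¹ + (sg : ℝ)⁻¹) ^ 2 := by ring
    calc ((P.L : ℝ) ^ k) ^ 2 * Λ₂ ≤ ((P.L : ℝ) ^ k) ^ 2 * (Λ₀₂ * uv ^ 2) := mul_le_mul_of_nonneg_left h1 (by positivity)
      _ = Λ₀₂ * ((P.L : ℝ) ^ k * uv) ^ 2 := by ring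
      _ ≤ Λ₀₂ * br ^ 2 := mul_le_mul_of_nonneg_left (pow_le_pow_left₀ (by positivity) hLuv 2) hΛ₀₂0
  have hK₁le : (P.L : ℝ) ^ k * (K₁ / (R₀ - R₁)) ≤ K₁ * br := by
    calc (P.L : ℝ) ^ k * (K₁ / (R₀ - R₁)) = K₁ * ((P.L : ℝ) ^ k * (R₀ - R₁)⁻¹) := by rw [div_eq_mul_inv]; ring
      _ ≤ K₁ * br := mul_le_mul_of_nonneg_left hLu1 hK₁
  have hK₂le : ((P.L : ℝ) ^ k) ^ 2 * (K₂ / (R₀ - R₁) ^ 2) ≤ K₂ * br ^ 2 := by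
    calc ((P.L : ℝ) ^ k) ^ 2 * (K₂ / (R₀ - R₁) ^ 2) = K₂ * ((P.L : ℝ) ^ k * (R₀ - R₁)⁻¹) ^ 2 := by
          rw [div_eq_mul_inv, ← inv_pow]; ring
      _ ≤ K₂ * br ^ 2 := mul_le_mul_of_nonneg_left (pow_le_pow_left₀ (by positivity) hLu1 2) hK₂
  -- the two exponential factors of the cube part against `E`, `eβ·E2R`
  have hEE : Real.exp (-(δ * (((P.L : ℝ) ^ k)⁻¹ * D))) * Real.exp (-(δ * (((P.L : ℝ) ^ k)⁻¹ * (Dβ + R)))) ≤ E * (eβ * E2R) :=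
    mul_le_mul (hED le_rfl) hEβ (Real.exp_pos _).le hE0.le
  have hEE' : Real.exp (-(δ * (((P.L : ℝ) ^ k)⁻¹ * D''))) * Real.exp (-(δ * (((P.L : ℝ) ^ k)⁻¹ * (Dβ + R)))) ≤ (eβ * E) * (eβ * E2R) :=
    mul_le_mul hexpD'' hEβ (Real.exp_pos _).le (by positivity)
  -- the eight terms in the common shape `spacing·(C_T·slot·E·F)`
  have hA : w * ‖∑ α, sA α‖ ≤ P.spacing k * (CA * slot1 * E * F) := by
    refine hsumA.trans ?_
    have h1 : BA ≤ P.spacing k * (cA * (E * (eβ * E2R)) * F) := by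
      rw [hBAdef]
      refine mul_le_mul_of_nonneg_left (mul_le_mul_of_nonneg_right ?_ hF0) hsp0.le
      rw [mul_assoc]
      exact mul_le_mul_of_nonneg_left hEE hcA.le
    calc m * BA ≤ m * (P.spacing k * (cA * (E * (eβ * E2R)) * F)) := mul_le_mul_of_nonneg_left h1 hm0
      _ = P.spacing k * (CA * (m * 1 * E2R) * E * F) := by rw [hCAdef]; ring
      _ ≤ P.spacing k * (CA * slot1 * E * F) := by
          rw [hslot1def]
          refine mul_le_mul_of_nonneg_left ?_ hsp0.le
          refine mul_le_mul_of_nonneg_right (mul_le_mul_of_nonneg_right (mul_le_mul_of_nonneg_left ?_ hCA0.le) hE0.le) hF0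
          exact mul_le_mul_of_nonneg_right (mul_le_mul_of_nonneg_left hbr21 hm0) hE2R0.le
  have hB : w * ‖∑ α, sB α‖ ≤ P.spacing k * (CB * slot1 * E * F) := by
    have h1 : w * ‖∑ α, sB α‖ ≤ w * (2 * m * BB) := mul_le_mul_of_nonneg_left hsumB hw0
    refine h1.trans ?_
    have e6 : w * (2 * m * BB) = (w * T12) * Λ₁ * (P.spacing k * (2 * ((d : ℝ) + 1) * c₁ * m *
        (Real.exp (-(δ * (((P.L : ℝ) ^ k)⁻¹ * D))) * Real.exp (-(δ * (((P.L : ℝ) ^ k)⁻¹ * (Dβ + R))))) * F)) := by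
      rw [hBBdef]; ring
    rw [e6]
    have h2 : (w * T12) * Λ₁ ≤ Λ₀ * br := le_trans (mul_le_mul_of_nonneg_right hwT hΛ₁0) hΛ₁le
    have h3 : P.spacing k * (2 * ((d : ℝ) + 1) * c₁ * m *
        (Real.exp (-(δ * (((P.L : ℝ) ^ k)⁻¹ * D))) * Real.exp (-(δ * (((P.L : ℝ) ^ k)⁻¹ * (Dβ + R))))) * F) ≤
        P.spacing k * (2 * ((d : ℝ) + 1) * c₁ * m * (E * (eβ * E2R)) * F) :=
      mul_le_mul_of_nonneg_left (mul_le_mul_of_nonneg_right (mul_le_mul_of_nonneg_left hEE (by positivity)) hF0) hsp0.le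
    calc (w * T12) * Λ₁ * (P.spacing k * (2 * ((d : ℝ) + 1) * c₁ * m *
          (Real.exp (-(δ * (((P.L : ℝ) ^ k)⁻¹ * D))) * Real.exp (-(δ * (((P.L : ℝ) ^ k)⁻¹ * (Dβ + R))))) * F))
        ≤ (Λ₀ * br) * (P.spacing k * (2 * ((d : ℝ) + 1) * c₁ * m * (E * (eβ * E2R)) * F)) :=
          mul_le_mul h2 h3 (by positivity) (by positivity)
      _ = P.spacing k * (CB * (m * br * E2R) * E * F) := by rw [hCBdef]; ring
      _ ≤ P.spacing k * (CB * slot1 * E * F) := by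
          rw [hslot1def]
          refine mul_le_mul_of_nonneg_left ?_ hsp0.le
          refine mul_le_mul_of_nonneg_right (mul_le_mul_of_nonneg_right (mul_le_mul_of_nonneg_left ?_ hCB0) hE0.le) hF0
          exact mul_le_mul_of_nonneg_right (mul_le_mul_of_nonneg_left hbr2 hm0) hE2R0.le
  have hC : w * ‖∑ α, sC α‖ ≤ P.spacing k * (CC * slot1 * E * F) := by
    have h1 : w * ‖∑ α, sC α‖ ≤ w * (2 * m * (BC * (((d : ℝ) + 1) * T12))) := mul_le_mul_of_nonneg_left hsumC hw0
    refine h1.trans ?_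
    have e6 : w * (2 * m * (BC * (((d : ℝ) + 1) * T12))) = (w * T12) * Λ₁ * (P.spacing k * (2 * ((d : ℝ) + 1) * c₁ * m *
        (Real.exp (-(δ * (((P.L : ℝ) ^ k)⁻¹ * D''))) * Real.exp (-(δ * (((P.L : ℝ) ^ k)⁻¹ * (Dβ + R))))) * F)) := by
      rw [hBCdef]; ring
    rw [e6]
    have h2 : (w * T12) * Λ₁ ≤ Λ₀ * br := le_trans (mul_le_mul_of_nonneg_right hwT hΛ₁0) hΛ₁le
    have h3 : P.spacing k * (2 * ((d : ℝ) + 1) * c₁ * m *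
        (Real.exp (-(δ * (((P.L : ℝ) ^ k)⁻¹ * D''))) * Real.exp (-(δ * (((P.L : ℝ) ^ k)⁻¹ * (Dβ + R))))) * F) ≤
        P.spacing k * (2 * ((d : ℝ) + 1) * c₁ * m * ((eβ * E) * (eβ * E2R)) * F) :=
      mul_le_mul_of_nonneg_left (mul_le_mul_of_nonneg_right (mul_le_mul_of_nonneg_left hEE' (by positivity)) hF0) hsp0.le
    calc (w * T12) * Λ₁ * (P.spacing k * (2 * ((d : ℝ) + 1) * c₁ * m *
          (Real.exp (-(δ * (((P.L : ℝ) ^ k)⁻¹ * D''))) * Real.exp (-(δ * (((P.L : ℝ) ^ k)⁻¹ * (Dβ + R))))) * F))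
        ≤ (Λ₀ * br) * (P.spacing k * (2 * ((d : ℝ) + 1) * c₁ * m * ((eβ * E) * (eβ * E2R)) * F)) :=
          mul_le_mul h2 h3 (by positivity) (by positivity)
      _ = P.spacing k * (CC * (m * br * E2R) * E * F) := by rw [hCCdef]; ring
      _ ≤ P.spacing k * (CC * slot1 * E * F) := by
          rw [hslot1def]
          refine mul_le_mul_of_nonneg_left ?_ hsp0.le
          refine mul_le_mul_of_nonneg_right (mul_le_mul_of_nonneg_right (mul_le_mul_of_nonneg_left ?_ hCC0) hE0.le) hF0
          exact mul_le_mul_of_nonneg_right (mul_le_mul_of_nonneg_left hbr2 hm0) hE2R0.le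
  have hDt' : w * ‖∑ α, sD α‖ ≤ P.spacing k * (CD * slot1 * E * F) := by
    have h1 : w * ‖∑ α, sD α‖ ≤ w * (4 * m * (P.eps⁻¹ * BD)) := mul_le_mul_of_nonneg_left hsumD hw0
    refine h1.trans ?_
    have e6 : w * (4 * m * (P.eps⁻¹ * BD)) =
        (w * T12) * ((P.eps⁻¹ * P.spacing k ^ 2) * (4 * ((d : ℝ) + 1) * c₂ * m * Λ₂ *
          (Real.exp (-(δ * (((P.L : ℝ) ^ k)⁻¹ * D))) * Real.exp (-(δ * (((P.L : ℝ) ^ k)⁻¹ * (Dβ + R))))) * F)) := by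
      rw [hBDdef]; ring
    rw [e6, hscale]
    have e7 : (w * T12) * (P.spacing k * (P.L : ℝ) ^ k * (4 * ((d : ℝ) + 1) * c₂ * m * Λ₂ *
          (Real.exp (-(δ * (((P.L : ℝ) ^ k)⁻¹ * D))) * Real.exp (-(δ * (((P.L : ℝ) ^ k)⁻¹ * (Dβ + R))))) * F)) =
        ((w * T12) * ((P.L : ℝ) ^ k * Λ₂)) * (P.spacing k * (4 * ((d : ℝ) + 1) * c₂ * m *
          (Real.exp (-(δ * (((P.L : ℝ) ^ k)⁻¹ * D))) * Real.exp (-(δ * (((P.L : ℝ) ^ k)⁻¹ * (Dβ + R))))) * F)) := by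
      ring
    rw [e7]
    have h2 : (w * T12) * ((P.L : ℝ) ^ k * Λ₂) ≤ Λ₀₂ * br ^ 2 := by
      calc (w * T12) * ((P.L : ℝ) ^ k * Λ₂) ≤ (P.L : ℝ) ^ k * ((P.L : ℝ) ^ k * Λ₂) := mul_le_mul_of_nonneg_right hwT (by positivity)
        _ = ((P.L : ℝ) ^ k) ^ 2 * Λ₂ := by ring
        _ ≤ Λ₀₂ * br ^ 2 := hΛ₂le
    have h3 : P.spacing k * (4 * ((d : ℝ) + 1) * c₂ * m *
        (Real.exp (-(δ * (((P.L : ℝ) ^ k)⁻¹ * D))) * Real.exp (-(δ * (((P.L : ℝ) ^ k)⁻¹ * (Dβ + R))))) * F) ≤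
        P.spacing k * (4 * ((d : ℝ) + 1) * c₂ * m * (E * (eβ * E2R)) * F) :=
      mul_le_mul_of_nonneg_left (mul_le_mul_of_nonneg_right (mul_le_mul_of_nonneg_left hEE (by positivity)) hF0) hsp0.le
    calc ((w * T12) * ((P.L : ℝ) ^ k * Λ₂)) * (P.spacing k * (4 * ((d : ℝ) + 1) * c₂ * m *
          (Real.exp (-(δ * (((P.L : ℝ) ^ k)⁻¹ * D))) * Real.exp (-(δ * (((P.L : ℝ) ^ k)⁻¹ * (Dβ + R))))) * F))
        ≤ (Λ₀₂ * br ^ 2) * (P.spacing k * (4 * ((d : ℝ) + 1) * c₂ * m * (E * (eβ * E2R)) * F)) :=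
          mul_le_mul h2 h3 (by positivity) (by positivity)
      _ = P.spacing k * (CD * slot1 * E * F) := by rw [hCDdef, hslot1def]; ring
  have htA' : w * ‖tA‖ ≤ P.spacing k * (CtA * slot2 * E * F) := by
    refine htermtA.trans ?_
    rw [hBtAdef]
    refine mul_le_mul_of_nonneg_left ?_ hsp0.le
    calc cH * Real.exp (-(δ₄ * (((P.L : ℝ) ^ k)⁻¹ * Dt))) * (2 * F) ≤ cH * (eβ * (E * ER1)) * (2 * F) :=
          mul_le_mul_of_nonneg_right (mul_le_mul_of_nonneg_left (hexpt hδ4) hcH.le) (by positivity)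
      _ = CtA * (1 * ER1) * E * F := by rw [hCtAdef]; ring
      _ ≤ CtA * slot2 * E * F := by
          rw [hslot2def]
          refine mul_le_mul_of_nonneg_right (mul_le_mul_of_nonneg_right (mul_le_mul_of_nonneg_left ?_ hCtA0) hE0.le) hF0
          exact mul_le_mul_of_nonneg_right hbr21 hER10.le
  have htB' : w * ‖tB‖ ≤ P.spacing k * (CtB * slot2 * E * F) := by
    have h1 : w * ‖tB‖ ≤ w * BtB := mul_le_mul_of_nonneg_left htermtB hw0
    refine h1.trans ?_
    have e6 : w * BtB = (w * T12) * (K₁ / (R₀ - R₁)) *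
        (P.spacing k * (((d : ℝ) + 1) * c₃ * Real.exp (-(δ₄ * (((P.L : ℝ) ^ k)⁻¹ * Dt))) * F)) := by
      rw [hBtBdef]; ring
    rw [e6]
    have h2 : (w * T12) * (K₁ / (R₀ - R₁)) ≤ K₁ * br := le_trans (mul_le_mul_of_nonneg_right hwT hK₁') hK₁le
    have h3 : P.spacing k * (((d : ℝ) + 1) * c₃ * Real.exp (-(δ₄ * (((P.L : ℝ) ^ k)⁻¹ * Dt))) * F) ≤
        P.spacing k * (((d : ℝ) + 1) * c₃ * (eβ * (E * ER1)) * F) :=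
      mul_le_mul_of_nonneg_left (mul_le_mul_of_nonneg_right (mul_le_mul_of_nonneg_left (hexpt hδ4) (by positivity)) hF0) hsp0.le
    calc (w * T12) * (K₁ / (R₀ - R₁)) * (P.spacing k * (((d : ℝ) + 1) * c₃ * Real.exp (-(δ₄ * (((P.L : ℝ) ^ k)⁻¹ * Dt))) * F))
        ≤ (K₁ * br) * (P.spacing k * (((d : ℝ) + 1) * c₃ * (eβ * (E * ER1)) * F)) :=
          mul_le_mul h2 h3 (by positivity) (by positivity)
      _ = P.spacing k * (CtB * (br * ER1) * E * F) := by rw [hCtBdef]; ring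
      _ ≤ P.spacing k * (CtB * slot2 * E * F) := by
          rw [hslot2def]
          refine mul_le_mul_of_nonneg_left ?_ hsp0.le
          refine mul_le_mul_of_nonneg_right (mul_le_mul_of_nonneg_right (mul_le_mul_of_nonneg_left ?_ hCtB0) hE0.le) hF0
          exact mul_le_mul_of_nonneg_right hbr2 hER10.le
  have htC' : w * ‖tC‖ ≤ P.spacing k * (CtB * slot2 * E * F) := by
    have h1 : w * ‖tC‖ ≤ w * (BtC * (((d : ℝ) + 1) * T12)) := mul_le_mul_of_nonneg_left htermtC hw0
    refine h1.trans ?_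
    have e6 : w * (BtC * (((d : ℝ) + 1) * T12)) = (w * T12) * (K₁ / (R₀ - R₁)) *
        (P.spacing k * (((d : ℝ) + 1) * c₃ * Real.exp (-(δ₄ * (((P.L : ℝ) ^ k)⁻¹ * Dt))) * F)) := by
      rw [hBtCdef]; ring
    rw [e6]
    have h2 : (w * T12) * (K₁ / (R₀ - R₁)) ≤ K₁ * br := le_trans (mul_le_mul_of_nonneg_right hwT hK₁') hK₁le
    have h3 : P.spacing k * (((d : ℝ) + 1) * c₃ * Real.exp (-(δ₄ * (((P.L : ℝ) ^ k)⁻¹ * Dt))) * F) ≤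
        P.spacing k * (((d : ℝ) + 1) * c₃ * (eβ * (E * ER1)) * F) :=
      mul_le_mul_of_nonneg_left (mul_le_mul_of_nonneg_right (mul_le_mul_of_nonneg_left (hexpt hδ4) (by positivity)) hF0) hsp0.le
    calc (w * T12) * (K₁ / (R₀ - R₁)) * (P.spacing k * (((d : ℝ) + 1) * c₃ * Real.exp (-(δ₄ * (((P.L : ℝ) ^ k)⁻¹ * Dt))) * F))
        ≤ (K₁ * br) * (P.spacing k * (((d : ℝ) + 1) * c₃ * (eβ * (E * ER1)) * F)) :=
          mul_le_mul h2 h3 (by positivity) (by positivity)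
      _ = P.spacing k * (CtB * (br * ER1) * E * F) := by rw [hCtBdef]; ring
      _ ≤ P.spacing k * (CtB * slot2 * E * F) := by
          rw [hslot2def]
          refine mul_le_mul_of_nonneg_left ?_ hsp0.le
          refine mul_le_mul_of_nonneg_right (mul_le_mul_of_nonneg_right (mul_le_mul_of_nonneg_left ?_ hCtB0) hE0.le) hF0
          exact mul_le_mul_of_nonneg_right hbr2 hER10.le
  have htD' : w * ‖tD‖ ≤ P.spacing k * (CtD * slot2 * E * F) := by
    have h1 : w * ‖tD‖ ≤ w * (P.eps⁻¹ * BtD) := mul_le_mul_of_nonneg_left htermtD hw0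
    refine h1.trans ?_
    have e6 : w * (P.eps⁻¹ * BtD) = (w * T12) * ((P.eps⁻¹ * P.spacing k ^ 2) * (((d : ℝ) + 1) * c₂ * (K₂ / (R₀ - R₁) ^ 2) *
        Real.exp (-(δ * (((P.L : ℝ) ^ k)⁻¹ * Dt))) * F)) := by
      rw [hBtDdef]; ring
    rw [e6, hscale]
    have e7 : (w * T12) * (P.spacing k * (P.L : ℝ) ^ k * (((d : ℝ) + 1) * c₂ * (K₂ / (R₀ - R₁) ^ 2) *
          Real.exp (-(δ * (((P.L : ℝ) ^ k)⁻¹ * Dt))) * F)) =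
        ((w * T12) * ((P.L : ℝ) ^ k * (K₂ / (R₀ - R₁) ^ 2))) *
          (P.spacing k * (((d : ℝ) + 1) * c₂ * Real.exp (-(δ * (((P.L : ℝ) ^ k)⁻¹ * Dt))) * F)) := by ring
    rw [e7]
    have h2 : (w * T12) * ((P.L : ℝ) ^ k * (K₂ / (R₀ - R₁) ^ 2)) ≤ K₂ * br ^ 2 := by
      calc (w * T12) * ((P.L : ℝ) ^ k * (K₂ / (R₀ - R₁) ^ 2)) ≤ (P.L : ℝ) ^ k * ((P.L : ℝ) ^ k * (K₂ / (R₀ - R₁) ^ 2)) :=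
            mul_le_mul_of_nonneg_right hwT (by positivity)
        _ = ((P.L : ℝ) ^ k) ^ 2 * (K₂ / (R₀ - R₁) ^ 2) := by ring
        _ ≤ K₂ * br ^ 2 := hK₂le
    have h3 : P.spacing k * (((d : ℝ) + 1) * c₂ * Real.exp (-(δ * (((P.L : ℝ) ^ k)⁻¹ * Dt))) * F) ≤
        P.spacing k * (((d : ℝ) + 1) * c₂ * (eβ * (E * ER1)) * F) :=
      mul_le_mul_of_nonneg_left (mul_le_mul_of_nonneg_right (mul_le_mul_of_nonneg_left (hexpt le_rfl) (by positivity)) hF0) hsp0.le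
    calc ((w * T12) * ((P.L : ℝ) ^ k * (K₂ / (R₀ - R₁) ^ 2))) *
          (P.spacing k * (((d : ℝ) + 1) * c₂ * Real.exp (-(δ * (((P.L : ℝ) ^ k)⁻¹ * Dt))) * F))
        ≤ (K₂ * br ^ 2) * (P.spacing k * (((d : ℝ) + 1) * c₂ * (eβ * (E * ER1)) * F)) :=
          mul_le_mul h2 h3 (by positivity) (by positivity)
      _ = P.spacing k * (CtD * slot2 * E * F) := by rw [hCtDdef, hslot2def]; ring
  -- conclusion
  have hsplit : ‖((∑ α, sA α + ∑ α, sB α) + (∑ α, sC α + ∑ α, sD α)) + ((tA + tB) + (tC + tD))‖ ≤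
      (‖∑ α, sA α‖ + ‖∑ α, sB α‖ + (‖∑ α, sC α‖ + ‖∑ α, sD α‖)) + ((‖tA‖ + ‖tB‖) + (‖tC‖ + ‖tD‖)) :=
    (norm_add_le _ _).trans (add_le_add
      ((norm_add_le _ _).trans (add_le_add (norm_add_le _ _) (norm_add_le _ _)))
      ((norm_add_le _ _).trans (add_le_add (norm_add_le _ _) (norm_add_le _ _))))
  have hC1 : CA + CB + CC + CD ≤ C := by rw [hCdef]; linarith only [hcg.le, hCtA0, hCtB0, hCtD0]
  have hC2 : CtA + CtB + CtB + CtD ≤ C := by rw [hCdef]; linarith only [hcg.le, hCA0.le, hCB0, hCC0, hCD0]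
  calc w * ‖τ * (∑ α, (covD P.eps⁻¹ (cfg U) (G α *ᵥ gs x₂' α) ⟨x₂, μ⟩ - covD P.eps⁻¹ (cfg U) (G₀ *ᵥ gs x₂' α) ⟨x₂, μ⟩) +
          ∑ α, Ec * ((G α *ᵥ ds x₂ x₂' α) x₂ - (G₀ *ᵥ ds x₂ x₂' α) x₂) +
          covD P.eps⁻¹ (cfg U) (G₀ *ᵥ q' x₂') ⟨x₂, μ⟩ + Ec * (G₀ *ᵥ dq x₂ x₂') x₂) -
        (∑ α, (covD P.eps⁻¹ (cfg U) (G α *ᵥ gs x₁' α) ⟨x₁, μ⟩ - covD P.eps⁻¹ (cfg U) (G₀ *ᵥ gs x₁' α) ⟨x₁, μ⟩) +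
          ∑ α, Ec * ((G α *ᵥ ds x₁ x₁' α) x₁ - (G₀ *ᵥ ds x₁ x₁' α) x₁) +
          covD P.eps⁻¹ (cfg U) (G₀ *ᵥ q' x₁') ⟨x₁, μ⟩ + Ec * (G₀ *ᵥ dq x₁ x₁') x₁)‖
      = w * ‖((∑ α, sA α + ∑ α, sB α) + (∑ α, sC α + ∑ α, sD α)) + ((tA + tB) + (tC + tD))‖ := by rw [hdecomp]
    _ ≤ w * ((‖∑ α, sA α‖ + ‖∑ α, sB α‖ + (‖∑ α, sC α‖ + ‖∑ α, sD α‖)) + ((‖tA‖ + ‖tB‖) + (‖tC‖ + ‖tD‖))) :=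
        mul_le_mul_of_nonneg_left hsplit hw0
    _ = (w * ‖∑ α, sA α‖ + w * ‖∑ α, sB α‖ + (w * ‖∑ α, sC α‖ + w * ‖∑ α, sD α‖)) +
          ((w * ‖tA‖ + w * ‖tB‖) + (w * ‖tC‖ + w * ‖tD‖)) := by ring
    _ ≤ (P.spacing k * (CA * slot1 * E * F) + P.spacing k * (CB * slot1 * E * F) +
          (P.spacing k * (CC * slot1 * E * F) + P.spacing k * (CD * slot1 * E * F))) +
          ((P.spacing k * (CtA * slot2 * E * F) + P.spacing k * (CtB * slot2 * E * F)) +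
            (P.spacing k * (CtB * slot2 * E * F) + P.spacing k * (CtD * slot2 * E * F))) :=
        add_le_add (add_le_add (add_le_add hA hB) (add_le_add hC hDt')) (add_le_add (add_le_add htA' htB') (add_le_add htC' htD'))
    _ = P.spacing k * (((CA + CB + CC + CD) * slot1 + (CtA + CtB + CtB + CtD) * slot2) * E * F) := by ring
    _ ≤ P.spacing k * ((C * slot1 + C * slot2) * E * F) := by
        refine mul_le_mul_of_nonneg_left ?_ hsp0.le
        refine mul_le_mul_of_nonneg_right (mul_le_mul_of_nonneg_right ?_ hE0.le) hF0
        exact add_le_add (mul_le_mul_of_nonneg_right hC1 hslot10) (mul_le_mul_of_nonneg_right hC2 hslot20)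
    _ = P.spacing k * (C * br ^ 2 * (m * E2R + ER1) * E * F) := by rw [hslots]; ring

end DerivHolder

/-! ## §6 The members for the smooth product cut-off `ζ″ = ζ^Π(R₁, R₀)` of (2.29) -/

section ZetaPiMember

open BIJ88LocDeriv230ZetaPiFlatTorus (zetaPi_zero_eq_zero_of_le zetaPi_zero_eq_one_of_le abs_zetaPi_zero_le_one
  abs_zetaPi_zero_shift_sub_le abs_zetaPi_zero_secondDiff_le)
open BIJ88HkLocHolderTorus (zetaPi secondDiffConst)
open BIJ88Close231RegularTorusCwt (cubeFamB rowMargin)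
open Literature.Analysis.Calculus (exists_abs_deriv_and_deriv_deriv_smoothTransition_le)

/-- **THE HÖLDER MEMBER OF ORDER `1 + θ` OF (2.31) FOR A GENERAL BIG-BLOCK REGION `Ω`, AT `u = e^{ieεA}` WITH `A` (2.23)-REGULAR ON `Ω`, FOR `G_{k,loc}(u)` BUILT FROM THE BIG-BLOCK
HULLS, THE WEIGHTS OF (2.27) AND THE SMOOTH PRODUCT CUT-OFF `ζ″ = ζ^Π(R₁, R₀)` OF (2.29)** (print p. 263: *"ζ_k(x₁, x₂) is a smooth function
of x₁ − x₂"*, *"Bounds analogous to (2.30), (2.31) hold for covariant derivatives and Holder derivatives of G_{k,loc}(u) of order less than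
two"*): for every `0 ≤ θ < 1`, `∃ s₀ ∀ s ≥ s₀ ∃ c₀ e₁ > 0` (from `(d, L, a, e, c, β, θ, s)` and the tree's universal profile bound `C_σ` on `|σ′|`,
`|σ″|` only) such that, for all data as in `derivHolder231_regular_of_smooth` with `1 ≤ R₁ < R₀ ≤ (|T^{(0)}| − 3)/2`,
`(L^k/|x₁ − x₂|_T)^θ·‖U(A(Γ))(D_uψ)(x₂, μ) − (D_uψ)(x₁, μ)‖ ≤ (L^kε)·c₀·(1 + L^k((R₀−R₁)⁻¹ + s_g⁻¹))²·[m·e^{−δ₀(2R−1)/L^k} + e^{−(δ₀/2)(R₁−1)/L^k}]·e^{−(δ₀/2)D/L^k}·F`,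
`ψ = G_{k,loc}(u)f − G_k(Ω,u)f`, `δ₀ = 1/(8L^s)` — §4 at `K₁ = C_σ`, `K₂ = C_σ² + C_σ`.
[cite: BalabanImbrieJaffe1988, (2.31) p.263] [cite: Balaban1983RegularityDecay, (1.9), (1.11)–(1.12) p.573] -/
theorem derivHolder231_regular_region_zetaPi (d L : ℕ) (hL : 2 ≤ L) {a : ℝ} (ha : 0 < a) (e creg β : ℝ) (hcreg : 0 ≤ creg) (hβ : 0 < β)
    {θ : ℝ} (hθ0 : 0 ≤ θ) (hθ1 : θ < 1) :
    ∃ s₀ : ℕ, ∀ s : ℕ, s₀ ≤ s → ∃ c₀ e₁ : ℝ, 0 < c₀ ∧ 0 < e₁ ∧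
      ∀ (P : Params) (hPd : P.d = d + 1), P.L = L → ∀ (k : ℕ), 1 ≤ k → k ≤ P.K → k + s ≤ P.m + P.K →
      3 * (L ^ k * L ^ s) ≤ P.sitesPerDir 0 →
      ∀ (Ω : Finset (Balaban1983to89.Site P 0)),
        (∀ z z' : Balaban1983to89.Site P 0, (∀ μ, (z μ).val / (L ^ k * L ^ s) = (z' μ).val / (L ^ k * L ^ s)) → (z ∈ Ω ↔ z' ∈ Ω)) →
      ∀ (A : PBond P 0 → ℝ) (ec : ℝ), 0 < ec → ec ≤ e₁ →
      (∀ z ∈ Ω, ∀ (μ ν : Fin P.d),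
          P.spacing k * |e| / ec * |A ⟨z.shift μ, ν⟩ - A ⟨z, ν⟩| ≤ creg * ec ^ (β - 1) / (L : ℝ) ^ k) →
      ∀ (c M0 : Fin (d + 1) → ℕ), (∀ i, c i * P.L ^ k + P.L ^ k * M0 i ≤ P.sitesPerDir 0) → (∀ i, P.L ^ k * M0 i < P.sitesPerDir 0) →
        bbHull (L ^ k * L ^ s) (cubeT hPd (P.L ^ k) c fun i => P.L ^ k * M0 i) ⊆ Ω →
      ∀ (sg W : ℕ), 1 ≤ sg → ∀ (R R₀ R₁ : ℝ), ((rowMargin L (d + 1) k s : ℕ) : ℝ) + ((d : ℝ) + 2) * (P.L : ℝ) ^ k + 1 < R → 1 ≤ R₁ → R₁ < R₀ →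
        R₀ ≤ ((P.sitesPerDir 0 : ℝ) - 3) / 2 →
        2 * (sg : ℝ) / 3 + R₀ / 2 + R ≤ W → (∀ i, ((P.L ^ k * M0 i : ℕ) : ℝ) + R ≤ P.sitesPerDir 0) →
      ∀ (x₁ x₂ : Balaban1983to89.Site P 0) (μ : Fin P.d),
        x₁ ∈ (cubeT hPd (P.L ^ k) c fun i => P.L ^ k * M0 i) →
        (∀ i, R₀ + R ≤ (boxCoord hPd (P.L ^ k) c x₁ i : ℝ) ∧ (boxCoord hPd (P.L ^ k) c x₁ i : ℝ) + (R₀ + R) ≤ (P.L ^ k * M0 i : ℕ) - 1) →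
        x₁.shift μ ∈ (cubeT hPd (P.L ^ k) c fun i => P.L ^ k * M0 i) →
        (∀ i, R₀ + R ≤ (boxCoord hPd (P.L ^ k) c (x₁.shift μ) i : ℝ) ∧
          (boxCoord hPd (P.L ^ k) c (x₁.shift μ) i : ℝ) + (R₀ + R) ≤ (P.L ^ k * M0 i : ℕ) - 1) →
        x₂ ∈ (cubeT hPd (P.L ^ k) c fun i => P.L ^ k * M0 i) →
        (∀ i, R₀ + R ≤ (boxCoord hPd (P.L ^ k) c x₂ i : ℝ) ∧ (boxCoord hPd (P.L ^ k) c x₂ i : ℝ) + (R₀ + R) ≤ (P.L ^ k * M0 i : ℕ) - 1) →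
        x₂.shift μ ∈ (cubeT hPd (P.L ^ k) c fun i => P.L ^ k * M0 i) →
        (∀ i, R₀ + R ≤ (boxCoord hPd (P.L ^ k) c (x₂.shift μ) i : ℝ) ∧
          (boxCoord hPd (P.L ^ k) c (x₂.shift μ) i : ℝ) + (R₀ + R) ≤ (P.L ^ k * M0 i : ℕ) - 1) →
      ∀ (l : List (Balaban1983to89.Site P 0)), IsSChain x₁ l → pathEnd x₁ l = x₂ →
        (l.length : ℝ) ≤ ((d : ℝ) + 1) * B5Ineq137Torus.T P 0 x₁ x₂ →
      ∀ (f : Balaban1983to89.Site P 0 → ℂ) (F D : ℝ), (∀ y, ‖f y‖ ≤ F) → 0 ≤ D →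
        (∀ y, f y ≠ 0 → D ≤ B5Ineq137Torus.T P 0 x₁ y) → (∀ y, f y ≠ 0 → D ≤ B5Ineq137Torus.T P 0 x₂ y) →
        ((P.L : ℝ) ^ k / B5Ineq137Torus.T P 0 x₁ x₂) ^ θ *
          ‖holA e A x₁ l *
              (covD P.eps⁻¹ (cfg (expGauge P e A))
                  (gLocT (B1RG242Torus.α P a k * (P.L : ℝ) ^ (k * P.d)) P.eps⁻¹ (expGauge P e A) k
                    (cubeFamB hPd (P.L ^ k) c M0 sg W (L ^ k * L ^ s)) (lamFam hPd (P.L ^ k) c M0 sg) (zetaPi R₁ R₀ 0) *ᵥ f) ⟨x₂, μ⟩ -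
                covD P.eps⁻¹ (cfg (expGauge P e A))
                  (gBox (B1RG242Torus.α P a k * (P.L : ℝ) ^ (k * P.d)) P.eps⁻¹ (expGauge P e A) k Ω *ᵥ f) ⟨x₂, μ⟩) -
            (covD P.eps⁻¹ (cfg (expGauge P e A))
                (gLocT (B1RG242Torus.α P a k * (P.L : ℝ) ^ (k * P.d)) P.eps⁻¹ (expGauge P e A) k
                  (cubeFamB hPd (P.L ^ k) c M0 sg W (L ^ k * L ^ s)) (lamFam hPd (P.L ^ k) c M0 sg) (zetaPi R₁ R₀ 0) *ᵥ f) ⟨x₁, μ⟩ -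
              covD P.eps⁻¹ (cfg (expGauge P e A))
                (gBox (B1RG242Torus.α P a k * (P.L : ℝ) ^ (k * P.d)) P.eps⁻¹ (expGauge P e A) k Ω *ᵥ f) ⟨x₁, μ⟩)‖ ≤
          P.spacing k * (c₀ * (1 + (P.L : ℝ) ^ k * ((R₀ - R₁)⁻¹ + (sg : ℝ)⁻¹)) ^ 2 *
            ((((⌊(((P.L : ℝ) ^ k) - 1 + R₀) / sg⌋₊ : ℝ) + 3) ^ (d + 1)) *
                Real.exp (-(1 / (8 * (L : ℝ) ^ s) * (((P.L : ℝ) ^ k)⁻¹ * (2 * R - 1)))) +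
              Real.exp (-(1 / (8 * (L : ℝ) ^ s) / 2 * (((P.L : ℝ) ^ k)⁻¹ * (R₁ - 1))))) *
            Real.exp (-(1 / (8 * (L : ℝ) ^ s) / 2 * (((P.L : ℝ) ^ k)⁻¹ * D))) * F) := by
  obtain ⟨C, hC0, hC1, hC2⟩ := exists_abs_deriv_and_deriv_deriv_smoothTransition_le
  have hK₂ : 0 ≤ C ^ 2 + C := by positivity
  obtain ⟨s₀, H0⟩ := derivHolder231_regular_region_of_smooth d L hL ha e creg β hcreg hβ hθ0 hθ1 hC0 hK₂
  refine ⟨s₀, fun s hs => ?_⟩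
  obtain ⟨c₀, e₁, hc₀, he₁, H⟩ := H0 s hs
  refine ⟨c₀, e₁, hc₀, he₁, ?_⟩
  intro P hPd hPL k hk1 hkK hks hsize Ω hΩ A ec hec hece hreg c M0 hfit0 hN0 hΩ₀ sg W hsg R R₀ R₁ hR hR₁ hR10 hR₀N hW hgap x₁ x₂ μ hx₁ hdeep₁
    hx₁e hdeep₁e hx₂ hdeep₂ hx₂e hdeep₂e l hch hend hlen f F D hF hD hsupp₁ hsupp₂
  have eK : secondDiffConst C R₁ R₀ = (C ^ 2 + C) / (R₀ - R₁) ^ 2 := by rw [secondDiffConst, div_pow, add_div]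
  exact H P hPd hPL k hk1 hkK hks hsize Ω hΩ A ec hec hece hreg c M0 hfit0 hN0 hΩ₀ sg W hsg R R₀ R₁ hR (zero_le_one.trans hR₁) hR10 hW hgap
    (zetaPi R₁ R₀ 0) (abs_zetaPi_zero_le_one R₁ R₀) (zetaPi_zero_eq_zero_of_le hR10) (zetaPi_zero_eq_one_of_le hR10)
    (abs_zetaPi_zero_shift_sub_le hC1 hR10) (fun x y κ ν => (abs_zetaPi_zero_secondDiff_le hC1 hC2 hR10 hR₁ hR₀N x y κ ν).trans_eq eK)
    x₁ x₂ μ hx₁ hdeep₁ hx₁e hdeep₁e hx₂ hdeep₂ hx₂e hdeep₂e l hch hend hlen f F D hF hD hsupp₁ hsupp₂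

/-- **THE COVARIANT-DERIVATIVE ANALOGUE OF (2.31) FOR A GENERAL BIG-BLOCK REGION `Ω`, `A` REGULAR ON `Ω`, FOR THE SMOOTH PRODUCT CUT-OFF `ζ″ = ζ^Π(R₁, R₀)`** (the
order-`1` member for the data of this file; §2 at `K₁ = C_σ` — r18 gen 24's `deriv231_regular_torus_cwt` is the same member for p13's cut-off
of record): `‖D_u(G_{k,loc}(u)f)(⟨x,μ⟩) − D_u(G_k(Ω,u)f)(⟨x,μ⟩)‖ ≤`
`(L^kε)·c₀·[m(1 + L^k((R₀−R₁)⁻¹ + s_g⁻¹))e^{−δ₀(2R−1)/L^k} + (1 + L^k(R₀−R₁)⁻¹)e^{−(δ₀/2)(R₁−1)/L^k}]·e^{−(δ₀/2)D/L^k}·F` for `R > rowMargin + 1`,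
`0 ≤ R₁ < R₀`, bond end points at chart depth `≥ R₀ + R`. [cite: BalabanImbrieJaffe1988, (2.31) p.263] -/
theorem deriv231_regular_region_zetaPi (d L : ℕ) (hL : 2 ≤ L) {a : ℝ} (ha : 0 < a) (e creg β : ℝ) (hcreg : 0 ≤ creg) (hβ : 0 < β) :
    ∃ s₀ : ℕ, ∀ s : ℕ, s₀ ≤ s → ∃ c₀ e₁ : ℝ, 0 < c₀ ∧ 0 < e₁ ∧
      ∀ (P : Params) (hPd : P.d = d + 1), P.L = L → ∀ (k : ℕ), 1 ≤ k → k ≤ P.K → k + s ≤ P.m + P.K →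
      3 * (L ^ k * L ^ s) ≤ P.sitesPerDir 0 →
      ∀ (Ω : Finset (Balaban1983to89.Site P 0)),
        (∀ z z' : Balaban1983to89.Site P 0, (∀ μ, (z μ).val / (L ^ k * L ^ s) = (z' μ).val / (L ^ k * L ^ s)) → (z ∈ Ω ↔ z' ∈ Ω)) →
      ∀ (A : PBond P 0 → ℝ) (ec : ℝ), 0 < ec → ec ≤ e₁ →
      (∀ z ∈ Ω, ∀ (μ ν : Fin P.d),
          P.spacing k * |e| / ec * |A ⟨z.shift μ, ν⟩ - A ⟨z, ν⟩| ≤ creg * ec ^ (β - 1) / (L : ℝ) ^ k) →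
      ∀ (c M0 : Fin (d + 1) → ℕ), (∀ i, c i * P.L ^ k + P.L ^ k * M0 i ≤ P.sitesPerDir 0) → (∀ i, P.L ^ k * M0 i < P.sitesPerDir 0) →
        bbHull (L ^ k * L ^ s) (cubeT hPd (P.L ^ k) c fun i => P.L ^ k * M0 i) ⊆ Ω →
      ∀ (sg W : ℕ), 1 ≤ sg → ∀ (R R₀ R₁ : ℝ), ((rowMargin L (d + 1) k s : ℕ) : ℝ) + 1 < R → 0 ≤ R₁ → R₁ < R₀ →
        2 * (sg : ℝ) / 3 + R₀ / 2 + R ≤ W → (∀ i, ((P.L ^ k * M0 i : ℕ) : ℝ) + R ≤ P.sitesPerDir 0) →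
      ∀ (x : Balaban1983to89.Site P 0) (μ : Fin P.d),
        x ∈ (cubeT hPd (P.L ^ k) c fun i => P.L ^ k * M0 i) →
        (∀ i, R₀ + R ≤ (boxCoord hPd (P.L ^ k) c x i : ℝ) ∧ (boxCoord hPd (P.L ^ k) c x i : ℝ) + (R₀ + R) ≤ (P.L ^ k * M0 i : ℕ) - 1) →
        x.shift μ ∈ (cubeT hPd (P.L ^ k) c fun i => P.L ^ k * M0 i) →
        (∀ i, R₀ + R ≤ (boxCoord hPd (P.L ^ k) c (x.shift μ) i : ℝ) ∧
          (boxCoord hPd (P.L ^ k) c (x.shift μ) i : ℝ) + (R₀ + R) ≤ (P.L ^ k * M0 i : ℕ) - 1) →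
      ∀ (f : Balaban1983to89.Site P 0 → ℂ) (F D : ℝ), (∀ y, ‖f y‖ ≤ F) → 0 ≤ D → (∀ y, f y ≠ 0 → D ≤ B5Ineq137Torus.T P 0 x y) →
        ‖covD P.eps⁻¹ (cfg (expGauge P e A))
              (gLocT (B1RG242Torus.α P a k * (P.L : ℝ) ^ (k * P.d)) P.eps⁻¹ (expGauge P e A) k
                (cubeFamB hPd (P.L ^ k) c M0 sg W (L ^ k * L ^ s)) (lamFam hPd (P.L ^ k) c M0 sg)
                (zetaPi R₁ R₀ 0) *ᵥ f) ⟨x, μ⟩ -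
            covD P.eps⁻¹ (cfg (expGauge P e A))
              (gBox (B1RG242Torus.α P a k * (P.L : ℝ) ^ (k * P.d)) P.eps⁻¹ (expGauge P e A) k Ω *ᵥ f) ⟨x, μ⟩‖ ≤
          P.spacing k * (c₀ * ((((⌊(((P.L : ℝ) ^ k) - 1 + R₀) / sg⌋₊ : ℝ) + 3) ^ (d + 1)) *
                (1 + (P.L : ℝ) ^ k * ((R₀ - R₁)⁻¹ + (sg : ℝ)⁻¹)) *
                Real.exp (-(1 / (8 * (L : ℝ) ^ s) * (((P.L : ℝ) ^ k)⁻¹ * (2 * R - 1)))) +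
              (1 + (P.L : ℝ) ^ k * (R₀ - R₁)⁻¹) * Real.exp (-(1 / (8 * (L : ℝ) ^ s) / 2 * (((P.L : ℝ) ^ k)⁻¹ * (R₁ - 1))))) *
            Real.exp (-(1 / (8 * (L : ℝ) ^ s) / 2 * (((P.L : ℝ) ^ k)⁻¹ * D))) * F) := by
  obtain ⟨C, hC0, hC1, -⟩ := exists_abs_deriv_and_deriv_deriv_smoothTransition_le
  obtain ⟨s₀, H0⟩ := deriv231_regular_region_of_lipschitz d L hL ha e creg β hcreg hβ hC0
  refine ⟨s₀, fun s hs => ?_⟩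
  obtain ⟨c₀, e₁, hc₀, he₁, H⟩ := H0 s hs
  refine ⟨c₀, e₁, hc₀, he₁, ?_⟩
  intro P hPd hPL k hk1 hkK hks hsize Ω hΩ A ec hec hece hreg c M0 hfit0 hN0 hΩ₀ sg W hsg R R₀ R₁ hR hR₁ hR10 hW hgap x μ hx hdeep hxe hdeepe
    f F D hF hD hsupp
  exact H P hPd hPL k hk1 hkK hks hsize Ω hΩ A ec hec hece hreg c M0 hfit0 hN0 hΩ₀ sg W hsg R R₀ R₁ hR hR₁ hR10 hW hgap (zetaPi R₁ R₀ 0)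
    (abs_zetaPi_zero_le_one R₁ R₀) (zetaPi_zero_eq_zero_of_le hR10) (zetaPi_zero_eq_one_of_le hR10) (abs_zetaPi_zero_shift_sub_le hC1 hR10)
    x μ hx hdeep hxe hdeepe f F D hF hD hsupp

end ZetaPiMember

end

end Literature.MathematicalPhysics.QuantumFieldTheory.BalabanImbrieJaffe1984to88.BIJ88LocDerivHolder231RegularRegion
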